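import Mathlib.Analysis.ODE.Gronwall
import Mathlib.MeasureTheory.Function.Floor
import Mathlib.MeasureTheory.Constructions.Polish.StronglyMeasurable
import Mathlib.MeasureTheory.Integral.DominatedConvergence
import Literature.Analysis.FunctionSpaces.ItoProcesses
import Literature.Probability.Process.ProgressiveDensity
import HarnessLib

/-!
# Itô's theorem for Lipschitz SDEs (canonical Brownian motion, raw filtration): the proof

Topic `Analysis/FunctionSpaces`; sibling proof file of
`Literature/Analysis/FunctionSpaces/ItoProcesses.lean`. It proves
`existsUnique_strongSolution_of_lipschitz_of_facts`: the named fact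
`Literature.Analysis.FunctionSpaces.existsUnique_strongSolution_of_lipschitz` (Revuz–Yor, Ch. IX, Thm (2.1): existence and
pathwise uniqueness of the strong solution of `dX = b(t, X) dt + σ(t, X) dB`, `X₀ = x₀`, for
coefficients Lipschitz in `x` uniformly in `t` and locally bounded in `t`, driven by the canonical
Brownian motion `Literature.Probability.Process.brownian` and adapted to its raw natural filtration
`Literature.Probability.RandomPlanarGeometry.brownianFiltration` under `Literature.Probability.Process.preWienerMeasure`) follows from two named facts S2, S4 on
the Itô integral stated here. Both facts are proved from the construction of the integral in
`Literature/Probability/Process/ItoIntegralStopping.lean` (which imports this file for `trunc`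
and the optional-time plumbing), and the hypothesis-free discharge
`existsUnique_strongSolution_of_lipschitz_holds` is the three-line assembly in
`Literature/Analysis/FunctionSpaces/ItoProcessesLipschitz.lean`.

`Literature.IsItoIntegral H B J 𝓕 P` is a characterisation (u.c.p. limit of elementary integrals along
every sequence of bounded simple processes approximating `H` in `L²_loc(ds)` in probability); the
stochastic integral behind it is constructed in `Literature/Probability/Process/`
(`SimpleIntegralMartingale`, `ItoIntegralCore`, `ProgressiveDensity`, `DoobL2Inequality`,
`ItoIntegralStopping`). The printed proof of RY IX (2.1)
(Picard iteration in the norm `Φ_t(U, V) = E[sup_{s ≤ t} |U_s - V_s|²]`, Doob's `L²` inequality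
plus the Itô isometry for the martingale part, Cauchy–Schwarz for the drift,
`Φ_T(X^{n-1}, Xⁿ) ≤ D CⁿTⁿ/n!`, a.s. uniform convergence, then localisation and Gronwall's lemma
for uniqueness) is decomposed as follows (`W = preWienerMeasure`, `B = brownian`,
`𝓕 = brownianFiltration`):

* **S1'** `Literature.Probability.Process.exists_isItoIntegral_of_sq_integrable` (`ProgressiveDensity`, proved): existence
  of `∫ H dB` for progressive `H` with `E ∫₀ᵗ H² < ∞` for all `t`, the integral being a
  square-integrable martingale of the *raw* filtration — RY IV Thm (2.2), Prop. (2.8). (The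
  named fact S1 `Literature.Probability.Process.exists_isItoIntegral` of `ItoCalculus` asks only `∫₀ᵗ H² < ∞` a.s.; its
  local-martingale conclusion would need a localising sequence of stopping times of the raw
  filtration, where hitting times are only optional. It is not used here: every integrand of
  the proof is square integrable.)
* **S2** `Literature.Analysis.FunctionSpaces.lintegral_iSup_itoIntegral_sub_sq_le` (this file, named fact; hypothesis `hS2`
  below; proved downstream as `IsItoIntegral.lintegral_iSup_sub_sq_le` of `ItoIntegralStopping`):
  the Doob–Itô `L²` maximal inequality in difference form,
  `E[sup_{s ≤ t} (J_s - J'_s)²] ≤ 4 E ∫₀ᵗ (H_s - H'_s)² ds` — RY IV Thm (2.2) with Ch. II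
  Thm (1.7).
* **S4** `Literature.Analysis.FunctionSpaces.exists_itoIntegral_truncation_of_sq_integrable` (this file, named fact; hypothesis
  `hS4` below; proved downstream via `IsItoIntegral.ae_eq_stoppedProcess` of
  `ItoIntegralStopping`: dyadic upper approximations `ρₙ ↓ ρ` are stopping times of the raw
  filtration, `Hₙ1_{(0,ρₙ]}` are simple, u.c.p. limits are unique): `(K 1_{[0,ρ]})·B = (K·B)^ρ`
  at an optional time `ρ` for integrands with `E ∫₀ᵗ (K1_{[0,ρ]})² < ∞` — RY IV Prop. (2.5),
  (2.10)(ii) — which is what the uniqueness proof uses (`|X| ≤ k` on `[0, ρ_k]`). (The general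
  statement for a.s. locally square-integrable `K`, like S1, would need a localising sequence of
  raw stopping times and is not used.)
* **G** `Literature.Analysis.FunctionSpaces.gronwall_of_le_integral` (proved): Gronwall's lemma in the integral form of RY,
  Appendix §1, from Mathlib's `le_gronwallBound_of_liminf_deriv_right_le`.
* **T4** (proved) an Itô integral of the zero integrand, or against the zero integrator,
  vanishes identically a.s. (u.c.p. limits of the zero sequence).
* **T1** (proved) raw-filtration version plumbing: a local martingale has an adapted version
  (`Literature.Analysis.FunctionSpaces.adaptedVersion`) and a progressive version (`Literature.Analysis.FunctionSpaces.progVersion`); every Itô integral has an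
  adapted, progressively measurable version which is again an Itô integral of the same integrand
  (`IsItoIntegral.exists_isStronglyProgressive`).
* **T2** (proved) the pathwise time integral `Literature.timeIntegral g t ω = ∫₀ᵗ g(s,ω) ds` of a
  progressive process is progressive, adapted, with continuous paths where the integrand is
  locally integrable; composition `(s, ω) ↦ F(s, U_s(ω))` with a jointly Borel `F` and truncation
  `𝟙_{s ≤ ρ} U_s` at an optional time `ρ` preserve progressivity (`isStronglyProgressive_trunc`).
* **T7** (proved) pathwise uniqueness `IsStrongSolution.unique_of_lipschitz`: reduce to
  progressive solutions (`dyadicReg`), localise at the optional times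
  `Literature.ratHitting (|X| ∨ |Y|) (|x₀| + k)`, identify the stopped difference `Y^ρ - X^ρ` with
  `∫₀ 𝟙_{[0,ρ]}(b(Y) - b(X)) ds + (J₂ - J₁)` (S4 core; the truncated integrands are square
  integrable because `|X|, |Y| ≤ |x₀| + k` on `[0, ρ]`, `lintegral_trunc_along_sq_ne_top`), bound
  `E[sup_{s≤t}(Y^ρ_s - X^ρ_s)²] ≤ (2TK² + 8K²) E∫₀ᵗ (Y^ρ - X^ρ)²` (Cauchy–Schwarz + S2 +
  Lipschitz), Gronwall (G), and let `k → ∞` along the a.s. continuous paths.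
* **T6** (proved) existence by the Picard scheme `Literature.Analysis.FunctionSpaces.picardSeq` (`X⁰ ≡ x₀`, `Xⁿ⁺¹ = S Xⁿ` with
  `Literature.Analysis.FunctionSpaces.picardStep`), carried with the invariant `Literature.Analysis.FunctionSpaces.PicardInv` (progressive, a.s. continuous,
  `E sup_{s≤t} U_s² < ∞`, so that `σ(s, U_s)` is square integrable, `PicardInv.lintegral_along_sq_lt_top`,
  and its Itô integral exists by S1' and is a martingale); the contraction estimate
  `E[sup_{s≤t}(SU - SV)²] ≤ (2TK² + 8K²) E∫₀ᵗ (U - V)²` (`lintegral_iSup_picardStep_sub_sq_le`, S2),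
  the invariant of the step (`picardInv_picardStep`: `E sup (SU)² ≤ 3x₀² + 3Φ(SU,Sx₀) + 3Φ(Sx₀,x₀)`),
  the factorial bound `Φ_t(Xⁿ, Xⁿ⁺¹) ≤ D Cⁿtⁿ/n!` (`picardDist_le`, Tonelli) with `D < ∞`
  (`picardDist_zero_lt_top`), Markov + Borel–Cantelli for a.s. locally uniform convergence
  (`ae_tendsto_picardLimit`), `L²(sup)` convergence of the tail (`lintegral_iSup_picard_sub_limit_sq_le`),
  and the identification `X = SX` (`ae_picardLimit_eq_picardStep`); hence
  `exists_isStrongSolution_of_lipschitz`.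
* **T8** (proved): the assembly `existsUnique_strongSolution_of_lipschitz_of_facts (hS2) (hS4)`.

## References

* D. Revuz, M. Yor, *Continuous Martingales and Brownian Motion* (3rd ed., 1999): Ch. II
  Thm (1.7) (Doob's `L^p` inequality, p. 54 of the PDF / book p. 54); Ch. IV Thm (2.2), Prop. (2.5),
  Prop. (2.7), Prop. (2.10) (stochastic integrals, book pp. 137–141); Ch. IX Thm (2.1)
  (book p. 375); Appendix §1 (Gronwall's lemma, book p. 543).
* K. Itô, *On stochastic differential equations*, Mem. Amer. Math. Soc. 4 (1951).
-/

open MeasureTheory ProbabilityTheory Filter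
open scoped NNReal ENNReal Topology

noncomputable section

namespace Literature.Analysis.FunctionSpaces

/-! ### Gronwall's lemma (integral form) -/

/-- **Gronwall's lemma** in the integral form of Revuz–Yor: if `φ` is a nonnegative, locally
bounded Borel function on `ℝ₊` with `φ(t) ≤ a + b ∫₀ᵗ φ(s) ds` for every `t` (`b ≥ 0`), then
`φ(t) ≤ a e^{bt}`; in particular `a = 0` forces `φ ≡ 0`. Stated on a bounded interval `[0, T]`
(only the values of `φ : ℝ → ℝ` on `[0, T]` enter; the version on `ℝ₊` follows by letting `T`
vary). Proof: the primitive `F(t) = ∫₀ᵗ φ` is continuous with right difference quotients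
eventually below any `r > a + b F(t)`, so Mathlib's
`le_gronwallBound_of_liminf_deriv_right_le` bounds `F`, and `φ ≤ a + b F`.
Revuz–Yor, *Continuous Martingales and Brownian Motion* (1999), Appendix §1 (Theorem,
Gronwall's lemma). [cite: RevuzYor1999, Appendix §1 (Gronwall's lemma)] -/
theorem gronwall_of_le_integral {φ : ℝ → ℝ} {a b T : ℝ} (hb : 0 ≤ b) (hT : 0 ≤ T)
    (hφm : Measurable φ) (hφ0 : ∀ t ∈ Set.Icc 0 T, 0 ≤ φ t) (hbdd : ∃ C, ∀ t ∈ Set.Icc 0 T, φ t ≤ C)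
    (hle : ∀ t ∈ Set.Icc 0 T, φ t ≤ a + b * ∫ s in (0 : ℝ)..t, φ s) :
    ∀ t ∈ Set.Icc 0 T, φ t ≤ a * Real.exp (b * t) := by
  obtain ⟨C, hC⟩ := hbdd
  -- integrability of `φ` on `[0, T]`
  have hint : IntegrableOn φ (Set.Icc 0 T) := by
    refine Measure.integrableOn_of_bounded (M := max C 0) measure_Icc_lt_top.ne
      hφm.aestronglyMeasurable ?_
    rw [ae_restrict_iff' measurableSet_Icc]
    refine ae_of_all _ fun t ht ↦ ?_
    rw [Real.norm_eq_abs, abs_of_nonneg (hφ0 t ht)]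
    exact (hC t ht).trans (le_max_left _ _)
  have hii : ∀ x ∈ Set.Icc 0 T, ∀ y ∈ Set.Icc 0 T, IntervalIntegrable φ volume x y := by
    intro x hx y hy
    exact (hint.mono_set (Set.uIcc_subset_Icc hx hy)).intervalIntegrable
  set F : ℝ → ℝ := fun t ↦ ∫ s in (0 : ℝ)..t, φ s with hF
  have hFcont : ContinuousOn F (Set.Icc 0 T) := by
    have := intervalIntegral.continuousOn_primitive_interval (μ := volume) (f := φ) (a := 0)
      (b := T) (by rwa [Set.uIcc_of_le hT])
    rwa [Set.uIcc_of_le hT] at this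
  -- pointwise bound `φ ≤ a + b F` on `[0, T]`
  have hφF : ∀ t ∈ Set.Icc 0 T, φ t ≤ a + b * F t := fun t ht ↦ hle t ht
  -- the right difference quotients of `F`
  have hderiv : ∀ x ∈ Set.Ico 0 T, ∀ r, a + b * F x < r →
      ∃ᶠ z in 𝓝[>] x, (z - x)⁻¹ * (F z - F x) < r := by
    intro x hx r hr
    obtain ⟨r', h1, h2⟩ := exists_between hr
    -- continuity of `F` within `[0, T]` at `x`: `a + b F s < r'` for `s` near `x`
    have hcont : ContinuousWithinAt F (Set.Icc 0 T) x := hFcont x ⟨hx.1, hx.2.le⟩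
    have hev : ∀ᶠ s in 𝓝[Set.Icc 0 T] x, a + b * F s < r' := by
      have : ContinuousWithinAt (fun s ↦ a + b * F s) (Set.Icc 0 T) x :=
        (continuousWithinAt_const.mul hcont).const_add a
      exact this.eventually (gt_mem_nhds h1)
    obtain ⟨δ, hδ, hδ'⟩ := Metric.mem_nhdsWithin_iff.1 hev
    -- for `z ∈ (x, min T (x + δ))` the quotient is `< r`
    have hzev : ∀ᶠ z in 𝓝[>] x, z ∈ Set.Ioo x (min T (x + δ)) :=
      Ioo_mem_nhdsGT (lt_min hx.2 (by linarith))
    refine (hzev.mono fun z hz ↦ ?_).frequently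
    have hxz : x < z := hz.1
    have hzT : z ≤ T := (hz.2.trans_le (min_le_left _ _)).le
    have hzδ : z < x + δ := hz.2.trans_le (min_le_right _ _)
    have hxI : x ∈ Set.Icc 0 T := ⟨hx.1, hx.2.le⟩
    have hzI : z ∈ Set.Icc 0 T := ⟨hx.1.trans hxz.le, hzT⟩
    -- `F z - F x = ∫_x^z φ ≤ (z - x) r'`
    have hsub : F z - F x = ∫ s in x..z, φ s := by
      simp only [hF]
      rw [intervalIntegral.integral_interval_sub_left (hii 0 ⟨le_rfl, hT⟩ z hzI)
        (hii 0 ⟨le_rfl, hT⟩ x hxI)]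
    have hbound : ∫ s in x..z, φ s ≤ ∫ _ in x..z, r' := by
      refine intervalIntegral.integral_mono_on hxz.le (hii x hxI z hzI)
        intervalIntegrable_const fun s hs ↦ ?_
      have hsI : s ∈ Set.Icc 0 T := ⟨hx.1.trans hs.1, hs.2.trans hzT⟩
      refine (hφF s hsI).trans (le_of_lt (hδ' ⟨?_, hsI⟩))
      rw [Metric.mem_ball, Real.dist_eq, abs_lt]
      constructor <;> linarith [hs.1, hs.2]
    rw [intervalIntegral.integral_const, smul_eq_mul] at hbound
    rw [hsub]
    have hzx : 0 < z - x := sub_pos.2 hxz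
    calc (z - x)⁻¹ * ∫ s in x..z, φ s ≤ (z - x)⁻¹ * ((z - x) * r') :=
          mul_le_mul_of_nonneg_left hbound (inv_nonneg.2 hzx.le)
      _ = r' := by field_simp
      _ < r := h2
  have hF0 : F 0 ≤ 0 := by simp [hF]
  have hGB := le_gronwallBound_of_liminf_deriv_right_le (f := F) (f' := fun x ↦ a + b * F x)
    (δ := 0) (K := b) (ε := a) (a := 0) (b := T) hFcont hderiv hF0
    (fun x _ ↦ by show a + b * F x ≤ b * F x + a; linarith)
  intro t ht
  have hFt : F t ≤ gronwallBound 0 b a t := by simpa using hGB t ht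
  rcases eq_or_ne b 0 with rfl | hb0
  · have := hφF t ht
    simp only [zero_mul, add_zero, Real.exp_zero, mul_one] at this ⊢
    exact this
  · rw [gronwallBound_of_K_ne_0 hb0] at hFt
    simp only [zero_mul, zero_add] at hFt
    calc φ t ≤ a + b * F t := hφF t ht
      _ ≤ a + b * (a / b * (Real.exp (b * t) - 1)) := by gcongr
      _ = a * Real.exp (b * t) := by field_simp; ring

/-- Gronwall's lemma with `a = 0`: a nonnegative bounded Borel `φ` on `[0, T]` with
`φ(t) ≤ b ∫₀ᵗ φ` there vanishes on `[0, T]` (the form used for pathwise uniqueness in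
RY IX (2.1)).
Revuz–Yor, *Continuous Martingales and Brownian Motion* (1999), Appendix §1. [cite: RevuzYor1999, Appendix §1 (Gronwall's lemma)] -/
theorem eq_zero_of_le_integral {φ : ℝ → ℝ} {b T : ℝ} (hb : 0 ≤ b) (hT : 0 ≤ T)
    (hφm : Measurable φ) (hφ0 : ∀ t ∈ Set.Icc 0 T, 0 ≤ φ t) (hbdd : ∃ C, ∀ t ∈ Set.Icc 0 T, φ t ≤ C)
    (hle : ∀ t ∈ Set.Icc 0 T, φ t ≤ b * ∫ s in (0 : ℝ)..t, φ s) :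
    ∀ t ∈ Set.Icc 0 T, φ t = 0 := by
  intro t ht
  have h := gronwall_of_le_integral (a := 0) hb hT hφm hφ0 hbdd
    (fun s hs ↦ by simpa using hle s hs) t ht
  rw [zero_mul] at h
  exact le_antisymm h (hφ0 t ht)

/-! ### The pre-Wiener measure is finite -/

/-- `preWienerMeasure` is a finite measure: it is a probability measure
(`Literature.Probability.RandomPlanarGeometry.isProbabilityMeasure_preWienerMeasure'`, from the proved Kolmogorov extension theorem); the
instance form used by the `lintegral`/`measure_lt_top` estimates of this file.
Kallenberg, *Foundations of Modern Probability* (2002), Thm 6.16. [folklore] -/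
instance instIsFiniteMeasurePreWienerMeasure : IsFiniteMeasure Literature.Probability.Process.preWienerMeasure := by
  haveI := Literature.Probability.RandomPlanarGeometry.isProbabilityMeasure_preWienerMeasure'
  infer_instance

/-! ### u.c.p. limits of the zero sequence; Itô integrals that vanish -/

section UCP

variable {Ω : Type*} {m : MeasurableSpace Ω} {J : ℝ≥0 → Ω → ℝ} {P : Measure Ω}

/-- If the constant zero sequence of processes converges to `J` uniformly on compacts in
probability, then almost surely `J_t = 0` for all `t` (each deviation event has constant,
hence zero, probability; the exceptional set is a countable union of such events).
Revuz–Yor, *Continuous Martingales and Brownian Motion* (1999), Ch. IV, Prop. (2.13) (u.c.p.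
limits). [folklore] -/
theorem ae_forall_eq_zero_of_tendstoUCP_zero (h : Literature.Probability.Process.TendstoUCP (fun _ ↦ (0 : ℝ≥0 → Ω → ℝ)) J P) :
    ∀ᵐ ω ∂P, ∀ t, J t ω = 0 := by
  have key : ∀ (t : ℝ≥0) (ε : ℝ), 0 < ε → P {ω | ∃ s ≤ t, ε ≤ |J s ω|} = 0 := by
    intro t ε hε
    have h' := h t ε hε
    simp only [Pi.zero_apply, zero_sub, abs_neg] at h'
    exact tendsto_nhds_unique tendsto_const_nhds h'
  have hsub : {ω | ¬ ∀ t, J t ω = 0} ⊆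
      ⋃ T : ℕ, ⋃ k : ℕ, {ω | ∃ s ≤ (T : ℝ≥0), 1 / ((k : ℝ) + 1) ≤ |J s ω|} := by
    intro ω hω
    simp only [Set.mem_setOf_eq, not_forall] at hω
    obtain ⟨t, ht⟩ := hω
    obtain ⟨T, hT⟩ := exists_nat_ge t
    have hpos : 0 < |J t ω| := abs_pos.2 ht
    obtain ⟨k, hk⟩ := exists_nat_one_div_lt hpos
    simp only [Set.mem_iUnion, Set.mem_setOf_eq]
    exact ⟨T, k, t, hT, hk.le⟩
  rw [ae_iff]
  exact measure_mono_null hsub <| (measure_iUnion_null_iff).2 fun T ↦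
    (measure_iUnion_null_iff).2 fun k ↦ key _ _ (by positivity)

variable {𝓕 : Filtration ℝ≥0 m}

/-- The empty simple process (no partition times, value `0`): its step process and its
elementary integrals vanish identically.
Revuz–Yor, *Continuous Martingales and Brownian Motion* (1999), Ch. IV, Def. (2.3). [folklore] -/
def _root_.Literature.Probability.Process.SimpleProcess.zero (m : MeasurableSpace Ω) (𝓕 : Filtration ℝ≥0 m) : Literature.Probability.Process.SimpleProcess m 𝓕 where
  times := []
  sorted := List.Pairwise.nil.sortedLT
  value := fun _ _ ↦ 0
  measurable := fun _ h ↦ (Nat.not_lt_zero _ h).elim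
  bounded := ⟨0, fun _ _ ↦ by simp⟩

/-- The step process of the empty simple process is `0`.
Revuz–Yor, *Continuous Martingales and Brownian Motion* (1999), Ch. IV, Def. (2.3). [folklore] -/
@[simp]
theorem _root_.Literature.Probability.Process.SimpleProcess.zero_toProcess : (Literature.Probability.Process.SimpleProcess.zero m 𝓕).toProcess = 0 := by
  funext t ω
  simp [Literature.Probability.Process.SimpleProcess.toProcess, Literature.Probability.Process.SimpleProcess.zero]

/-- The elementary integrals of the empty simple process vanish.
Revuz–Yor, *Continuous Martingales and Brownian Motion* (1999), Ch. IV, (2.4). [folklore] -/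
@[simp]
theorem _root_.Literature.Probability.Process.SimpleProcess.zero_integral (B : ℝ≥0 → Ω → ℝ) :
    (Literature.Probability.Process.SimpleProcess.zero m 𝓕).integral B = 0 := by
  funext t ω
  simp [Literature.Probability.Process.SimpleProcess.integral, Literature.Probability.Process.SimpleProcess.zero]

/-- The elementary integral of any simple process against the zero integrator vanishes.
Revuz–Yor, *Continuous Martingales and Brownian Motion* (1999), Ch. IV, (2.4). [folklore] -/
@[simp]
theorem _root_.Literature.Probability.Process.SimpleProcess.integral_zero_right (H : Literature.Probability.Process.SimpleProcess m 𝓕) :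
    H.integral (0 : ℝ≥0 → Ω → ℝ) = 0 := by
  funext t ω
  simp [Literature.Probability.Process.SimpleProcess.integral]

/-- The constant sequence of empty simple processes approximates the zero integrand.
Revuz–Yor, *Continuous Martingales and Brownian Motion* (1999), Ch. IV, Def. (2.9). [folklore] -/
theorem _root_.Literature.Probability.Process.SimpleProcess.isApproxSeq_zero :
    Literature.Probability.Process.SimpleProcess.IsApproxSeq (fun _ ↦ Literature.Probability.Process.SimpleProcess.zero m 𝓕) (0 : ℝ≥0 → Ω → ℝ) P := by
  intro t ε hε
  have hset : {ω : Ω | ENNReal.ofReal ε ≤ ∫⁻ s in Set.Icc (0 : ℝ) t,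
      ENNReal.ofReal (((Literature.Probability.Process.SimpleProcess.zero m 𝓕).toProcess s.toNNReal ω -
        (0 : ℝ≥0 → Ω → ℝ) s.toNNReal ω) ^ 2)} = ∅ := by
    ext ω
    simp only [Literature.Probability.Process.SimpleProcess.zero_toProcess, Pi.zero_apply, sub_zero, ne_eq, OfNat.ofNat_ne_zero,
      not_false_eq_true, zero_pow, ENNReal.ofReal_zero, lintegral_const, zero_mul,
      nonpos_iff_eq_zero, ENNReal.ofReal_eq_zero, not_le, Set.mem_setOf_eq,
      Set.mem_empty_iff_false, iff_false]
    exact hε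
  simp only [hset, measure_empty]
  exact tendsto_const_nhds

/-- **An Itô integral of the zero integrand vanishes**: if `IsItoIntegral 0 B J 𝓕 P` then
almost surely `J_t = 0` for all `t` (test the characterisation on the constant sequence of
empty simple processes, whose elementary integrals are `0`).
Revuz–Yor, *Continuous Martingales and Brownian Motion* (1999), Ch. IV, Thm (2.2). [folklore] -/
theorem _root_.Literature.Probability.Process.IsItoIntegral.ae_forall_eq_zero_of_integrand {B : ℝ≥0 → Ω → ℝ}
    (h : Literature.Probability.Process.IsItoIntegral (0 : ℝ≥0 → Ω → ℝ) B J 𝓕 P) : ∀ᵐ ω ∂P, ∀ t, J t ω = 0 := by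
  have h1 := h.2.2.2.2 (fun _ ↦ Literature.Probability.Process.SimpleProcess.zero m 𝓕) Literature.Probability.Process.SimpleProcess.isApproxSeq_zero
  simp only [Literature.Probability.Process.SimpleProcess.zero_integral] at h1
  exact ae_forall_eq_zero_of_tendstoUCP_zero h1

/-- **An Itô integral against the zero integrator vanishes**: if `IsItoIntegral H 0 J 𝓕 P` then
almost surely `J_t = 0` for all `t` (along the approximating sequence provided by the
characterisation, all elementary integrals against `0` are `0`). (General `(Ω, 𝓕, P)`; not
used on the canonical space, where `brownian` is a genuine Brownian motion.)
Revuz–Yor, *Continuous Martingales and Brownian Motion* (1999), Ch. IV, Thm (2.2). [folklore] -/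
theorem _root_.Literature.Probability.Process.IsItoIntegral.ae_forall_eq_zero_of_integrator {H : ℝ≥0 → Ω → ℝ}
    (h : Literature.Probability.Process.IsItoIntegral H (0 : ℝ≥0 → Ω → ℝ) J 𝓕 P) : ∀ᵐ ω ∂P, ∀ t, J t ω = 0 := by
  obtain ⟨Hn, hHn⟩ := h.2.2.2.1
  have h1 := h.2.2.2.2 Hn hHn
  simp only [Literature.Probability.Process.SimpleProcess.integral_zero_right] at h1
  exact ae_forall_eq_zero_of_tendstoUCP_zero h1

end UCP

section Infrastructure

variable {Ω : Type*} {m : MeasurableSpace Ω}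

/-! ### Dyadic regularisation: progressive versions of adapted processes

The device `Literature.Analysis.FunctionSpaces.dyadicReg` (limit along the dyadic lower approximations `⌊2ⁿt⌋/2ⁿ`, file
`ItoProcesses`) turns an adapted process into a progressively measurable one
(`isStronglyProgressive_dyadicReg`) agreeing with it along continuous paths
(`dyadicReg_apply_of_continuous`); two small complements. -/

/-- The dyadic lower approximations of `0` are `0`. [folklore] -/
theorem dyadicFloor_zero (n : ℕ) : dyadicFloor n 0 = 0 := by
  simp [dyadicFloor]

/-- The dyadic regularisation does not change the value at time `0`. [folklore] -/
theorem dyadicReg_apply_zero (Z : ℝ≥0 → Ω → ℝ) (ω : Ω) : dyadicReg Z 0 ω = Z 0 ω := by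
  simp only [dyadicReg, dyadicFloor_zero]
  exact tendsto_const_nhds.limUnder_eq

variable {𝓕 : Filtration ℝ≥0 m} {P : Measure Ω}

/-- The dyadic regularisation of an adapted real process is adapted. [folklore] -/
theorem adapted_dyadicReg {Z : ℝ≥0 → Ω → ℝ} (hZ : Adapted 𝓕 Z) : Adapted 𝓕 (dyadicReg Z) :=
  fun i ↦ ((isStronglyProgressive_dyadicReg hZ).stronglyAdapted i).measurable

/-! ### Transfer of the Itô characterisation along indistinguishable versions -/

section Transfer

variable {H H' B J J' : ℝ≥0 → Ω → ℝ}

/-- u.c.p. convergence only depends on the limit up to indistinguishability. [folklore] -/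
theorem _root_.Literature.Probability.Process.TendstoUCP.congr_right {Y : ℕ → ℝ≥0 → Ω → ℝ} (h : Literature.Probability.Process.TendstoUCP Y J P)
    (hJ : ∀ᵐ ω ∂P, ∀ t, J' t ω = J t ω) : Literature.Probability.Process.TendstoUCP Y J' P := by
  intro t ε hε
  refine (h t ε hε).congr' (Eventually.of_forall fun n ↦ measure_congr ?_)
  filter_upwards [hJ] with ω hω
  change (∃ s ≤ t, ε ≤ |Y n s ω - J s ω|) = (∃ s ≤ t, ε ≤ |Y n s ω - J' s ω|)
  simp only [hω]

/-- `IsItoIntegral` transfers to an indistinguishable version of the integral which vanishes at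
time `0` and is itself a local martingale (the latter is not automatic for raw filtrations: it
needs adaptedness of the stopped processes of the version). [folklore] -/
theorem _root_.Literature.Probability.Process.IsItoIntegral.congr_integral (h : Literature.Probability.Process.IsItoIntegral H B J 𝓕 P)
    (hJ : ∀ᵐ ω ∂P, ∀ t, J' t ω = J t ω) (h0 : ∀ ω, J' 0 ω = 0)
    (hloc : Literature.Probability.RandomPlanarGeometry.IsLocalMartingale J' 𝓕 P) : Literature.Probability.Process.IsItoIntegral H B J' 𝓕 P := by
  refine ⟨h0, ?_, hloc, h.2.2.2.1, fun Hn hHn ↦ (h.2.2.2.2 Hn hHn).congr_right hJ⟩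
  filter_upwards [h.2.1, hJ] with ω hc hω
  have : (J' · ω) = (J · ω) := funext hω
  rw [this]
  exact hc

end Transfer

/-! ### Adapted and progressive versions of local martingales and Itô integrals -/

section Version

variable {X : ℝ≥0 → Ω → ℝ}

/-- An **adapted version of a local martingale** for a raw filtration: along a localizing
sequence `τₙ` of `X`, the stopped processes `(𝟙_{0<τₙ} X)^{τₙ}` are adapted and eventually
(in `n`, for every fixed time, on the event `τₙ → ∞`) equal to `X`; their pointwise
`limUnder` is therefore an adapted process indistinguishable from `X`. [folklore] -/
def adaptedVersion (h : Locally (fun Y ↦ Martingale Y 𝓕 P) 𝓕 X P) :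
    ℝ≥0 → Ω → ℝ :=
  fun t ω ↦ limUnder atTop fun n ↦
    stoppedProcess (fun i ↦ {ω | ⊥ < h.localSeq n ω}.indicator (X i)) (h.localSeq n) t ω

/-- The adapted version of a local martingale is (strongly) adapted. [folklore] -/
theorem stronglyAdapted_adaptedVersion (h : Locally (fun Y ↦ Martingale Y 𝓕 P) 𝓕 X P) :
    StronglyAdapted 𝓕 (adaptedVersion h) := fun t ↦
  @MeasureTheory.StronglyMeasurable.limUnder ℕ Ω ℝ (𝓕 t) _ _ atTop _
    (fun n ω ↦ stoppedProcess (fun i ↦ {ω | ⊥ < h.localSeq n ω}.indicator (X i))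
      (h.localSeq n) t ω) _ _ (fun n ↦ (h.stoppedProcess_localSeq n).stronglyAdapted t)

/-- The adapted version of a local martingale is adapted. [folklore] -/
theorem adapted_adaptedVersion (h : Locally (fun Y ↦ Martingale Y 𝓕 P) 𝓕 X P) :
    Adapted 𝓕 (adaptedVersion h) := fun t ↦
  ((stronglyAdapted_adaptedVersion h) t).measurable

/-- The adapted version of a local martingale is indistinguishable from it. [folklore] -/
theorem ae_adaptedVersion_eq (h : Locally (fun Y ↦ Martingale Y 𝓕 P) 𝓕 X P) :
    ∀ᵐ ω ∂P, ∀ t, (adaptedVersion h) t ω = X t ω := by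
  filter_upwards [h.isLocalizingSequence_localSeq.tendsto_top] with ω hω t
  apply Tendsto.limUnder_eq
  refine tendsto_const_nhds.congr' ?_
  have hev : ∀ᶠ n in atTop, ((t : ℝ≥0) : WithTop ℝ≥0) < h.localSeq n ω :=
    hω.eventually (Ioi_mem_nhds (WithTop.coe_lt_top t))
  filter_upwards [hev] with n hn
  show X t ω = stoppedProcess (fun i ↦ {ω | ⊥ < h.localSeq n ω}.indicator (X i)) (h.localSeq n) t ω
  rw [stoppedProcess_eq_of_le hn.le, Set.indicator_of_mem]
  exact lt_of_le_of_lt bot_le hn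

/-- The adapted version of a local martingale vanishing identically at `0` vanishes identically
at `0`. [folklore] -/
theorem adaptedVersion_apply_zero (h : Locally (fun Y ↦ Martingale Y 𝓕 P) 𝓕 X P)
    (h0 : ∀ ω, X 0 ω = 0) (ω : Ω) : (adaptedVersion h) 0 ω = 0 := by
  apply Tendsto.limUnder_eq
  refine tendsto_const_nhds.congr' (Eventually.of_forall fun n ↦ ?_)
  have hle : ((0 : ℝ≥0) : WithTop ℝ≥0) ≤ h.localSeq n ω := by
    rw [WithTop.coe_zero]; exact bot_le
  show (0 : ℝ) = stoppedProcess (fun i ↦ {ω | ⊥ < h.localSeq n ω}.indicator (X i)) (h.localSeq n) 0 ω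
  rw [stoppedProcess_eq_of_le hle]
  by_cases hω : ω ∈ {ω | ⊥ < h.localSeq n ω}
  · rw [Set.indicator_of_mem hω, h0]
  · rw [Set.indicator_of_notMem hω]

/-- A time-constant process given by an `𝓕 0`-measurable set indicator times a progressive
process is progressive. [folklore] -/
theorem isStronglyProgressive_indicator {Z : ℝ≥0 → Ω → ℝ} (hZ : IsStronglyProgressive 𝓕 Z)
    {s : Set Ω} (hs : MeasurableSet[𝓕 0] s) :
    IsStronglyProgressive 𝓕 (fun i ↦ s.indicator (Z i)) := by
  have h1 : IsStronglyProgressive 𝓕 (fun (_ : ℝ≥0) ω ↦ s.indicator (fun _ ↦ (1 : ℝ)) ω) := by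
    intro i
    have hsi : MeasurableSet[𝓕 i] s := 𝓕.mono zero_le s hs
    have : Measurable[𝓕 i] (s.indicator fun _ ↦ (1 : ℝ)) :=
      measurable_const.indicator hsi
    exact (this.comp (@measurable_snd (Set.Iic i) Ω _ (𝓕 i))).stronglyMeasurable
  have := h1.mul hZ
  convert this using 2 with i
  funext ω
  by_cases hω : ω ∈ s <;> simp [hω]

/-- The stopped-indicator processes of a progressive process along stopping times are
martingales as soon as they are indistinguishable from martingales (raw filtration: the
adaptedness comes from progressivity, the conditional expectations from the a.e. equality).
[folklore] -/
theorem martingale_stoppedProcess_congr {Z Z' : ℝ≥0 → Ω → ℝ} {τ : Ω → WithTop ℝ≥0}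
    (hτ : IsStoppingTime 𝓕 τ)
    (hM : Martingale (stoppedProcess (fun i ↦ {ω | ⊥ < τ ω}.indicator (Z i)) τ) 𝓕 P)
    (hZ' : IsStronglyProgressive 𝓕 Z') (hae : ∀ᵐ ω ∂P, ∀ t, Z' t ω = Z t ω) :
    Martingale (stoppedProcess (fun i ↦ {ω | ⊥ < τ ω}.indicator (Z' i)) τ) 𝓕 P := by
  have hs : MeasurableSet[𝓕 0] {ω | ⊥ < τ ω} := by
    have : {ω | ⊥ < τ ω} = {ω | τ ω ≤ ((0 : ℝ≥0) : WithTop ℝ≥0)}ᶜ := by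
      ext ω
      simp only [Set.mem_setOf_eq, Set.mem_compl_iff, not_le, WithTop.coe_zero]
      rfl
    rw [this]
    exact (hτ 0).compl
  have hprog := (isStronglyProgressive_indicator hZ' hs).stoppedProcess hτ
  have haeM : ∀ i, stoppedProcess (fun i ↦ {ω | ⊥ < τ ω}.indicator (Z' i)) τ i =ᵐ[P]
      stoppedProcess (fun i ↦ {ω | ⊥ < τ ω}.indicator (Z i)) τ i := by
    intro i
    filter_upwards [hae] with ω hω
    simp only [stoppedProcess, Set.indicator_apply, Set.mem_setOf_eq, hω]
  refine ⟨hprog.stronglyAdapted, fun i j hij ↦ ?_⟩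
  calc P[stoppedProcess (fun i ↦ {ω | ⊥ < τ ω}.indicator (Z' i)) τ j|𝓕 i]
      =ᵐ[P] P[stoppedProcess (fun i ↦ {ω | ⊥ < τ ω}.indicator (Z i)) τ j|𝓕 i] :=
        condExp_congr_ae (haeM j)
    _ =ᵐ[P] stoppedProcess (fun i ↦ {ω | ⊥ < τ ω}.indicator (Z i)) τ i := hM.2 i j hij
    _ =ᵐ[P] stoppedProcess (fun i ↦ {ω | ⊥ < τ ω}.indicator (Z' i)) τ i := (haeM i).symm

/-- A progressive process indistinguishable from a local martingale is a local martingale (same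
localizing sequence). [folklore] -/
theorem isLocalMartingale_congr_of_isStronglyProgressive {Z' : ℝ≥0 → Ω → ℝ}
    (h : Locally (fun Y ↦ Martingale Y 𝓕 P) 𝓕 X P) (hZ' : IsStronglyProgressive 𝓕 Z')
    (hae : ∀ᵐ ω ∂P, ∀ t, Z' t ω = X t ω) : Literature.Probability.RandomPlanarGeometry.IsLocalMartingale Z' 𝓕 P :=
  ⟨h.localSeq, h.isLocalizingSequence_localSeq, fun n ↦
    martingale_stoppedProcess_congr (h.isLocalizingSequence_localSeq.isStoppingTime n)
      (h.stoppedProcess_localSeq n) hZ' hae⟩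

/-- The **progressive version** of a local martingale with a.s. continuous paths (raw
filtration): the left regularisation of its adapted version. [folklore] -/
def progVersion (h : Locally (fun Y ↦ Martingale Y 𝓕 P) 𝓕 X P) :
    ℝ≥0 → Ω → ℝ :=
  dyadicReg (adaptedVersion h)

/-- The progressive version of a local martingale is progressively measurable. [folklore] -/
theorem isStronglyProgressive_progVersion (h : Locally (fun Y ↦ Martingale Y 𝓕 P) 𝓕 X P) :
    IsStronglyProgressive 𝓕 (progVersion h) :=
  isStronglyProgressive_dyadicReg (adapted_adaptedVersion h)

/-- The progressive version of a local martingale is adapted. [folklore] -/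
theorem adapted_progVersion (h : Locally (fun Y ↦ Martingale Y 𝓕 P) 𝓕 X P) :
    Adapted 𝓕 (progVersion h) :=
  adapted_dyadicReg (adapted_adaptedVersion h)

/-- The progressive version of a local martingale vanishing identically at `0` vanishes
identically at `0`. [folklore] -/
theorem progVersion_apply_zero (h : Locally (fun Y ↦ Martingale Y 𝓕 P) 𝓕 X P)
    (h0 : ∀ ω, X 0 ω = 0) (ω : Ω) : (progVersion h) 0 ω = 0 := by
  rw [progVersion, dyadicReg_apply_zero, adaptedVersion_apply_zero h h0]

/-- The progressive version of an a.s.-continuous local martingale is indistinguishable from it.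
[folklore] -/
theorem ae_progVersion_eq (h : Locally (fun Y ↦ Martingale Y 𝓕 P) 𝓕 X P)
    (hc : ∀ᵐ ω ∂P, Continuous (X · ω)) : ∀ᵐ ω ∂P, ∀ t, (progVersion h) t ω = X t ω := by
  filter_upwards [(ae_adaptedVersion_eq h), hc] with ω hω hcω t
  have hfun : ((adaptedVersion h) · ω) = (X · ω) := funext hω
  rw [progVersion, dyadicReg_apply_of_continuous (by rw [hfun]; exact hcω), hω]

/-- The progressive version of an a.s.-continuous local martingale is a local martingale (raw
filtration, same localizing sequence). [folklore] -/
theorem isLocalMartingale_progVersion (h : Locally (fun Y ↦ Martingale Y 𝓕 P) 𝓕 X P)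
    (hc : ∀ᵐ ω ∂P, Continuous (X · ω)) : Literature.Probability.RandomPlanarGeometry.IsLocalMartingale (progVersion h) 𝓕 P :=
  isLocalMartingale_congr_of_isStronglyProgressive h (isStronglyProgressive_progVersion h)
    (ae_progVersion_eq h hc)

variable {H B J : ℝ≥0 → Ω → ℝ}

/-- **Progressive versions of Itô integrals.** If `J` is an Itô integral `∫ H dB` in the sense
of `IsItoIntegral` (raw filtration `𝓕`), then the progressive version
`(progVersion h.isLocalMartingale)` of `J` is again an Itô integral of `H`, is adapted and
progressively measurable for `𝓕`, vanishes identically at time `0`, and is indistinguishable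
from `J`. [folklore] -/
theorem _root_.Literature.Probability.Process.IsItoIntegral.progVersion (h : Literature.Probability.Process.IsItoIntegral H B J 𝓕 P) :
    Literature.Probability.Process.IsItoIntegral H B (progVersion h.isLocalMartingale) 𝓕 P ∧
      (∀ᵐ ω ∂P, ∀ t, (progVersion h.isLocalMartingale) t ω = J t ω) :=
  ⟨h.congr_integral ((ae_progVersion_eq h.isLocalMartingale) h.continuous)
    ((progVersion_apply_zero h.isLocalMartingale) h.apply_zero)
    ((isLocalMartingale_progVersion h.isLocalMartingale) h.continuous),
    (ae_progVersion_eq h.isLocalMartingale) h.continuous⟩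

/-- Every Itô integral admits an adapted, progressively measurable version vanishing at `0`
which is again an Itô integral of the same integrand. [folklore] -/
theorem _root_.Literature.Probability.Process.IsItoIntegral.exists_isStronglyProgressive (h : Literature.Probability.Process.IsItoIntegral H B J 𝓕 P) :
    ∃ J' : ℝ≥0 → Ω → ℝ, Literature.Probability.Process.IsItoIntegral H B J' 𝓕 P ∧ IsStronglyProgressive 𝓕 J' ∧
      Adapted 𝓕 J' ∧ ∀ᵐ ω ∂P, ∀ t, J' t ω = J t ω :=
  ⟨_, h.progVersion.1, isStronglyProgressive_progVersion h.isLocalMartingale,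
    adapted_progVersion h.isLocalMartingale, h.progVersion.2⟩

end Version



/-! ### Progressive measurability of composed, truncated and time-integrated processes -/

section Progressive

/-- The real process `(s, ω) ↦ F(s, U_s(ω))` obtained by evaluating a function of time and
state along a process (e.g. the drift `b(s, X_s)` and diffusion coefficient `σ(s, X_s)` of
`Literature.Analysis.FunctionSpaces.IsStrongSolution`, which are literally `along b X` and `along σ X`). [folklore] -/
def along (F : ℝ → ℝ → ℝ) (U : ℝ≥0 → Ω → ℝ) : ℝ≥0 → Ω → ℝ := fun s ω ↦ F s (U s ω)

/-- The **truncation** `𝟙_{[0,ρ]} H` of a process at a random time `ρ`: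
`trunc ρ H s ω = H s ω` if `s ≤ ρ ω` and `0` otherwise (the integrand `K 𝟙_{[0,T]}` of
Revuz–Yor IV Prop. (2.5)). [folklore] -/
def trunc (ρ : Ω → WithTop ℝ≥0) (H : ℝ≥0 → Ω → ℝ) : ℝ≥0 → Ω → ℝ :=
  fun s ω ↦ if (s : WithTop ℝ≥0) ≤ ρ ω then H s ω else 0

/-- Unfolding of `trunc`. [folklore] -/
theorem trunc_apply (ρ : Ω → WithTop ℝ≥0) (H : ℝ≥0 → Ω → ℝ) (s : ℝ≥0) (ω : Ω) :
    trunc ρ H s ω = if (s : WithTop ℝ≥0) ≤ ρ ω then H s ω else 0 := rfl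

/-- Below the truncation time the truncated process is the process. [folklore] -/
theorem trunc_of_le {ρ : Ω → WithTop ℝ≥0} {H : ℝ≥0 → Ω → ℝ} {s : ℝ≥0} {ω : Ω}
    (h : (s : WithTop ℝ≥0) ≤ ρ ω) : trunc ρ H s ω = H s ω := if_pos h

/-- After the truncation time the truncated process vanishes. [folklore] -/
theorem trunc_of_not_le {ρ : Ω → WithTop ℝ≥0} {H : ℝ≥0 → Ω → ℝ} {s : ℝ≥0} {ω : Ω}
    (h : ¬ (s : WithTop ℝ≥0) ≤ ρ ω) : trunc ρ H s ω = 0 := if_neg h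

/-- A jointly Borel function of time and state evaluated along a progressive real process is
progressive (e.g. `(s, ω) ↦ σ(s, X_s(ω))`). [folklore] -/
theorem IsStronglyProgressive.comp_measurable₂ {U : ℝ≥0 → Ω → ℝ} (hU : IsStronglyProgressive 𝓕 U)
    {F : ℝ → ℝ → ℝ} (hF : Measurable (Function.uncurry F)) :
    IsStronglyProgressive 𝓕 (along F U) := by
  intro i
  have h1 : Measurable[Subtype.instMeasurableSpace.prod (𝓕 i)]
      (fun p : Set.Iic i × Ω ↦ (((p.1 : ℝ≥0) : ℝ), U p.1 p.2)) := by
    refine Measurable.prodMk (m := Subtype.instMeasurableSpace.prod (𝓕 i)) ?_ (hU i).measurable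
    exact (measurable_coe_nnreal_real.comp measurable_subtype_coe).comp
      (@measurable_fst (Set.Iic i) Ω _ (𝓕 i))
  exact (hF.comp h1).stronglyMeasurable

/-- The **pathwise time integral** `A_t(ω) = ∫₀ᵗ g(s, ω) ds` of a real process `g`, in the form
used by `Literature.Analysis.FunctionSpaces.IsItoProcess` (interval integral over `(0, t]` of `s ↦ g s.toNNReal ω` for the
Lebesgue measure). [folklore] -/
def timeIntegral (g : ℝ≥0 → Ω → ℝ) : ℝ≥0 → Ω → ℝ :=
  fun t ω ↦ ∫ s in (0 : ℝ)..t, g s.toNNReal ω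

/-- The time integral vanishes at time `0`. [folklore] -/
@[simp]
theorem timeIntegral_apply_zero (g : ℝ≥0 → Ω → ℝ) (ω : Ω) : timeIntegral g 0 ω = 0 := by
  simp [timeIntegral]

/-- The time integral of a progressive process is progressive (Fubini measurability of the
parametric Bochner integral on `Set.Iic i × Ω` with the σ-algebra `𝓑 ⊗ 𝓕 i`). [folklore] -/
theorem isStronglyProgressive_timeIntegral {g : ℝ≥0 → Ω → ℝ} (hg : IsStronglyProgressive 𝓕 g) :
    IsStronglyProgressive 𝓕 (timeIntegral g) := by
  intro i
  letI mΩ : MeasurableSpace Ω := 𝓕 i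
  -- the integrand `(p, s) ↦ 𝟙_{(0, p.1]}(s) g (s⁺ ∧ i) p.2` is jointly measurable
  have hgi : Measurable (fun p : Set.Iic i × Ω ↦ g p.1 p.2) := (hg i).measurable
  have hG : Measurable (fun q : (Set.Iic i × Ω) × ℝ ↦ g (min q.2.toNNReal i) q.1.2) := by
    have h1 : Measurable (fun q : (Set.Iic i × Ω) × ℝ ↦
        ((⟨min q.2.toNNReal i, Set.mem_Iic.2 (min_le_right _ _)⟩, q.1.2) : Set.Iic i × Ω)) :=
      ((measurable_real_toNNReal.comp measurable_snd).min measurable_const).subtype_mk.prodMk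
        (measurable_snd.comp measurable_fst)
    exact hgi.comp h1
  have hS : MeasurableSet {q : (Set.Iic i × Ω) × ℝ | q.2 ∈ Set.Ioc (0 : ℝ) q.1.1} := by
    have h1 : Measurable (fun q : (Set.Iic i × Ω) × ℝ ↦ q.2) := measurable_snd
    have h2 : Measurable (fun q : (Set.Iic i × Ω) × ℝ ↦ ((q.1.1 : ℝ≥0) : ℝ)) :=
      (measurable_coe_nnreal_real.comp measurable_subtype_coe).comp (measurable_fst.comp measurable_fst)
    exact (measurableSet_lt measurable_const h1).inter (measurableSet_le h1 h2)
  have hf : StronglyMeasurable (Function.uncurry fun (p : Set.Iic i × Ω) (s : ℝ) ↦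
      {q : (Set.Iic i × Ω) × ℝ | q.2 ∈ Set.Ioc (0 : ℝ) q.1.1}.indicator
        (fun q ↦ g (min q.2.toNNReal i) q.1.2) (p, s)) :=
    (hG.indicator hS).stronglyMeasurable
  have hint := StronglyMeasurable.integral_prod_right (ν := (volume : Measure ℝ)) hf
  have heq : (fun p : Set.Iic i × Ω ↦ timeIntegral g p.1 p.2) = fun p ↦
      ∫ s, {q : (Set.Iic i × Ω) × ℝ | q.2 ∈ Set.Ioc (0 : ℝ) q.1.1}.indicator
        (fun q ↦ g (min q.2.toNNReal i) q.1.2) (p, s) := by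
    funext p
    rw [timeIntegral, intervalIntegral.integral_of_le (NNReal.coe_nonneg _),
      ← integral_indicator measurableSet_Ioc]
    congr 1
    funext s
    simp only [Set.indicator_apply, Set.mem_setOf_eq]
    split_ifs with hs
    · rw [min_eq_left ((Real.toNNReal_le_iff_le_coe.2 hs.2).trans p.1.2)]
    · rfl
  rw [heq]
  exact hint

/-- The time integral of a progressive process is adapted. [folklore] -/
theorem adapted_timeIntegral {g : ℝ≥0 → Ω → ℝ} (hg : IsStronglyProgressive 𝓕 g) :
    Adapted 𝓕 (timeIntegral g) := fun i ↦
  ((isStronglyProgressive_timeIntegral hg).stronglyAdapted i).measurable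

/-- The time integral has continuous paths wherever the integrand is locally integrable in time.
[folklore] -/
theorem continuous_timeIntegral {g : ℝ≥0 → Ω → ℝ} {ω : Ω}
    (hint : ∀ t : ℝ≥0, IntegrableOn (fun s : ℝ ↦ g s.toNNReal ω) (Set.Icc 0 t)) :
    Continuous (timeIntegral g · ω) := by
  have hcont : ContinuousOn (fun x : ℝ ↦ ∫ s in (0 : ℝ)..x, g s.toNNReal ω) (Set.Ici 0) := by
    intro x hx
    have hx0 : 0 ≤ x := hx
    have hT : IntegrableOn (fun s : ℝ ↦ g s.toNNReal ω) (Set.uIcc 0 (x + 1)) := by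
      rw [Set.uIcc_of_le (by linarith)]
      have := hint (x + 1).toNNReal
      rwa [Real.coe_toNNReal _ (by linarith)] at this
    have h1 := (intervalIntegral.continuousOn_primitive_interval hT) x
      (by rw [Set.uIcc_of_le (by linarith)]; exact ⟨hx0, by linarith⟩)
    refine h1.mono_of_mem_nhdsWithin ?_
    rw [Set.uIcc_of_le (by linarith), mem_nhdsWithin_iff_exists_mem_nhds_inter]
    refine ⟨Set.Iio (x + 1), Iio_mem_nhds (by linarith), fun y hy ↦ ⟨hy.2, le_of_lt hy.1⟩⟩
  exact hcont.comp_continuous NNReal.continuous_coe fun t ↦ t.2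

/-- **Truncation at an optional time preserves progressivity**: if `U` is progressive and `ρ` is
an optional time of the raw filtration (`{ρ < t} ∈ 𝓕 t` for all `t`), then
`(s, ω) ↦ 𝟙_{s ≤ ρ(ω)} U_s(ω)` is progressive. (The indicator `𝟙_{ρ < s}` is the left
regularisation of the adapted process `𝟙_{ρ < t}`.) [folklore] -/
theorem isStronglyProgressive_trunc {U : ℝ≥0 → Ω → ℝ} (hU : IsStronglyProgressive 𝓕 U)
    {ρ : Ω → WithTop ℝ≥0} (hρ : ∀ t : ℝ≥0, MeasurableSet[𝓕 t] {ω | ρ ω < t}) :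
    IsStronglyProgressive 𝓕 (trunc ρ U) := by
  let V : ℝ≥0 → Ω → ℝ := fun t ω ↦ if ρ ω < t then 1 else 0
  have hV : Adapted 𝓕 V := fun t ↦ Measurable.ite (hρ t) measurable_const measurable_const
  have hVeq : ∀ t ω, dyadicReg V t ω = V t ω := by
    intro t ω
    apply Tendsto.limUnder_eq
    by_cases h : ρ ω < t
    · have hd : Tendsto (fun n ↦ ((dyadicFloor n t : ℝ≥0) : WithTop ℝ≥0)) atTop (𝓝 (t : WithTop ℝ≥0)) :=
        (WithTop.continuous_coe.tendsto t).comp (tendsto_dyadicFloor t)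
      have hev : ∀ᶠ n in atTop, ρ ω < dyadicFloor n t := hd.eventually (Ioi_mem_nhds h)
      refine tendsto_const_nhds.congr' ?_
      filter_upwards [hev] with n hn
      show V t ω = V (dyadicFloor n t) ω
      simp only [V, if_pos h, if_pos hn]
    · refine tendsto_const_nhds.congr' (Eventually.of_forall fun n ↦ ?_)
      have hn : ¬ ρ ω < dyadicFloor n t :=
        fun h' ↦ h (h'.trans_le (WithTop.coe_le_coe.2 (dyadicFloor_le n t)))
      show V t ω = V (dyadicFloor n t) ω
      simp only [V, if_neg h, if_neg hn]
  have hprog : IsStronglyProgressive 𝓕 (dyadicReg V) := isStronglyProgressive_dyadicReg hV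
  have heq : trunc ρ U = fun s ω ↦ (1 - dyadicReg V s ω) * U s ω := by
    funext s ω
    rw [hVeq, trunc_apply]
    simp only [V]
    by_cases h : (s : WithTop ℝ≥0) ≤ ρ ω
    · rw [if_pos h, if_neg (not_lt.2 h)]
      ring
    · rw [if_neg h, if_pos (not_le.1 h)]
      ring
  rw [heq]
  exact ((isStronglyProgressive_const 𝓕 (1 : ℝ)).sub hprog).mul hU


/-- A progressive real process is jointly measurable in `(t, ω)` (it is the pointwise, eventually
constant, limit of its restrictions to `Set.Iic n × Ω`, `n ∈ ℕ`). [folklore] -/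
theorem IsStronglyProgressive.measurable_uncurry {U : ℝ≥0 → Ω → ℝ}
    (hU : IsStronglyProgressive 𝓕 U) : Measurable (fun p : ℝ≥0 × Ω ↦ U p.1 p.2) := by
  have hn : ∀ n : ℕ, Measurable (fun p : ℝ≥0 × Ω ↦ U (min p.1 (n : ℝ≥0)) p.2) := by
    intro n
    have h1 : Measurable[inferInstance, Subtype.instMeasurableSpace.prod (𝓕 n)]
        (fun p : ℝ≥0 × Ω ↦ ((⟨min p.1 n, Set.mem_Iic.2 (min_le_right _ _)⟩, p.2) :
          Set.Iic (n : ℝ≥0) × Ω)) := by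
      refine Measurable.prodMk ?_ ?_
      · exact (measurable_fst.min measurable_const).subtype_mk
      · exact measurable_snd.mono le_rfl (𝓕.le n)
    exact (hU n).measurable.comp h1
  refine measurable_of_tendsto_metrizable hn (tendsto_pi_nhds.2 fun p ↦ ?_)
  refine tendsto_const_nhds.congr' ?_
  filter_upwards [eventually_ge_atTop ⌈(p.1 : ℝ≥0)⌉₊] with n hn'
  rw [min_eq_left ((Nat.le_ceil _).trans (by exact_mod_cast hn'))]

/-! ### Optional times: hitting of a level along rational times -/

section Optional

/-- The **first nonnegative rational time** (rationals `q`, read as `q⁺ = max(q,0)`) at which the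
real process `U` strictly exceeds the level `c`, as a `WithTop ℝ≥0`-valued random time (`⊤` if
never). For an adapted `U` this is an *optional* time of the raw filtration
(`{ratHitting U c < t} ∈ 𝓕 t`), though in general not a stopping time; along continuous paths
starting below `c` the process stays `≤ c` up to and including this time, and the times tend to
`⊤` as `c → ∞`. Substitute, for raw filtrations, of the hitting times
`T_k = inf{t : |X_t| or |Y_t| > k}` of the uniqueness proof of RY IX (2.1). [folklore] -/
def ratHitting (U : ℝ≥0 → Ω → ℝ) (c : ℝ) : Ω → WithTop ℝ≥0 :=
  fun ω ↦ ⨅ (q : ℚ) (_ : c < U (q : ℝ).toNNReal ω), (((q : ℝ).toNNReal : ℝ≥0) : WithTop ℝ≥0)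

variable {U : ℝ≥0 → Ω → ℝ} {c : ℝ}

/-- `ratHitting U c ω < t` iff some rational time `q⁺ < t` has `U q⁺ ω > c`. [folklore] -/
theorem ratHitting_lt_iff {ω : Ω} {t : WithTop ℝ≥0} :
    ratHitting U c ω < t ↔ ∃ q : ℚ, c < U (q : ℝ).toNNReal ω ∧
      (((q : ℝ).toNNReal : ℝ≥0) : WithTop ℝ≥0) < t := by
  simp only [ratHitting, iInf_lt_iff, exists_prop]

/-- A rational time at which `U` exceeds `c` bounds `ratHitting U c` from above. [folklore] -/
theorem ratHitting_le {ω : Ω} {q : ℚ} (hq : c < U (q : ℝ).toNNReal ω) :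
    ratHitting U c ω ≤ (((q : ℝ).toNNReal : ℝ≥0) : WithTop ℝ≥0) :=
  (iInf_le _ q).trans (iInf_le _ hq)

/-- `ratHitting U c` is an **optional time** of any raw filtration to which `U` is adapted.
[folklore] -/
theorem measurableSet_ratHitting_lt (hU : Adapted 𝓕 U) (t : ℝ≥0) :
    MeasurableSet[𝓕 t] {ω | ratHitting U c ω < t} := by
  have hset : {ω | ratHitting U c ω < t} = ⋃ q : ℚ, ⋃ (_ : ((q : ℝ).toNNReal : ℝ≥0) < t),
      {ω | c < U (q : ℝ).toNNReal ω} := by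
    ext ω
    simp only [Set.mem_setOf_eq, ratHitting_lt_iff, WithTop.coe_lt_coe, Set.mem_iUnion,
      exists_prop, and_comm]
  rw [hset]
  refine MeasurableSet.iUnion fun q ↦ MeasurableSet.iUnion fun hq ↦ ?_
  exact measurableSet_lt (measurable_const (a := c)) ((hU _).mono (𝓕.mono hq.le) le_rfl)

/-- `ratHitting U c` is a measurable random time. [folklore] -/
theorem measurable_ratHitting (hU : Adapted 𝓕 U) : Measurable (ratHitting U c) := by
  refine measurable_of_Iio fun x ↦ ?_
  induction x with
  | top =>
    have : ratHitting U c ⁻¹' Set.Iio ⊤ = ⋃ n : ℕ, {ω | ratHitting U c ω < (n : ℝ≥0)} := by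
      ext ω
      simp only [Set.mem_preimage, Set.mem_Iio, Set.mem_iUnion, Set.mem_setOf_eq]
      constructor
      · intro h
        obtain ⟨r, hr⟩ := WithTop.ne_top_iff_exists.1 h.ne
        obtain ⟨n, hn⟩ := exists_nat_gt r
        exact ⟨n, by rw [← hr]; exact_mod_cast hn⟩
      · rintro ⟨n, hn⟩
        exact hn.trans (WithTop.coe_lt_top _)
    rw [this]
    exact MeasurableSet.iUnion fun n ↦ 𝓕.le _ _ (measurableSet_ratHitting_lt hU n)
  | coe t => exact 𝓕.le _ _ (measurableSet_ratHitting_lt hU t)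

/-- Along a continuous path starting at or below the level, the process stays `≤ c` up to and
including the optional time `ratHitting U c`. [folklore] -/
theorem le_of_le_ratHitting {ω : Ω} (hc : Continuous (U · ω)) (h0 : U 0 ω ≤ c) {s : ℝ≥0}
    (hs : (s : WithTop ℝ≥0) ≤ ratHitting U c ω) : U s ω ≤ c := by
  by_contra hlt
  rw [not_le] at hlt
  rcases eq_or_ne s 0 with rfl | hs0
  · exact (not_le.2 hlt) h0
  have hs0' : (0 : ℝ) < s := by exact_mod_cast pos_iff_ne_zero.2 hs0
  -- `U > c` on a neighbourhood of `s`
  have hev : ∀ᶠ r in 𝓝 s, c < U r ω := (hc.tendsto s).eventually (lt_mem_nhds hlt)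
  rw [Metric.eventually_nhds_iff] at hev
  obtain ⟨δ, hδ, hδ'⟩ := hev
  -- a rational time in `(s - δ, s) ∩ (0, s)`
  obtain ⟨q, hq1, hq2⟩ := exists_rat_btwn (max_lt (sub_lt_self (s : ℝ) hδ) hs0')
  have hq0 : (0 : ℝ) < q := (le_max_right _ _).trans_lt hq1
  have hqs : (q : ℝ).toNNReal < s := by
    rw [← NNReal.coe_lt_coe, Real.coe_toNNReal _ hq0.le]; exact hq2
  have hdist : dist (q : ℝ).toNNReal s < δ := by
    rw [NNReal.dist_eq, Real.coe_toNNReal _ hq0.le, abs_sub_comm, abs_of_pos (sub_pos.2 hq2)]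
    linarith [(le_max_left _ _).trans_lt hq1]
  have hcq : c < U (q : ℝ).toNNReal ω := hδ' hdist
  have := (hs.trans (ratHitting_le hcq))
  exact (not_lt.2 (WithTop.coe_le_coe.1 this)) hqs

/-- Along a continuous path the optional times `ratHitting U c` exceed any given time for all
large levels `c`. [folklore] -/
theorem eventually_lt_ratHitting {ω : Ω} (hc : Continuous (U · ω)) (T : ℝ≥0) :
    ∀ᶠ c in atTop, (T : WithTop ℝ≥0) < ratHitting U c ω := by
  -- `U(·, ω)` is bounded on the compact `[0, T + 1]`
  obtain ⟨M, hM⟩ : ∃ M, ∀ r ∈ Set.Icc (0 : ℝ≥0) (T + 1), U r ω ≤ M := by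
    have hK : IsCompact (Set.Icc (0 : ℝ≥0) (T + 1)) := isCompact_Icc
    obtain ⟨M, hM⟩ := (hK.image_of_continuousOn hc.continuousOn).isBounded.bddAbove
    exact ⟨M, fun r hr ↦ hM ⟨r, hr, rfl⟩⟩
  filter_upwards [eventually_ge_atTop M] with c hc'
  -- every rational time `q⁺` with `U q⁺ > c ≥ M` lies beyond `T + 1`
  have key : ∀ q : ℚ, c < U (q : ℝ).toNNReal ω → T + 1 < (q : ℝ).toNNReal := by
    intro q hq
    by_contra hle
    rw [not_lt] at hle
    exact (not_le.2 (hc'.trans_lt hq)) (hM _ ⟨zero_le, hle⟩)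
  have h1 : ((T + 1 : ℝ≥0) : WithTop ℝ≥0) ≤ ratHitting U c ω :=
    le_iInf₂ fun q hq ↦ WithTop.coe_le_coe.2 (key q hq).le
  refine lt_of_lt_of_le ?_ h1
  exact_mod_cast lt_add_one T

end Optional

end Progressive

end Infrastructure

/-! ### Named facts on the Itô integral against the canonical Brownian motion -/

/-- **Doob–Itô `L²` maximal inequality** (difference form) for Itô integrals against the
canonical Brownian motion: if `J = ∫ H dB` and `J' = ∫ H' dB` (`IsItoIntegral`, raw Brownian
filtration) with `H, H'` progressively measurable, then for every `t`,
`E[sup_{s ≤ t} (J_s - J'_s)²] ≤ 4 E[∫₀ᵗ (H_s - H'_s)² ds]` (both sides in `[0, ∞]`; trivial when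
the right side is infinite). This is the Itô isometry `‖K·B‖_{H²} = ‖K‖_{L²(B)}` for
`K = (H - H') 1_{[0,t]}` (the map `K ↦ K·M` is a linear isometry from `L²(M)` into `H²₀`)
combined with Doob's `L²`-inequality `‖X*‖₂ ≤ 2 sup_t ‖X_t‖₂`; it is the estimate
"by the Doob and Cauchy–Schwarz inequalities … ≤ 8E[∫₀ᵗ (f(r,U.) - f(r,V.))² d⟨M,M⟩_r]" of the
proof of RY IX (2.1). Raw-filtration / characterised-integral version, label '?'. Named fact
(closed `Prop`, no proof here).
Revuz–Yor, *Continuous Martingales and Brownian Motion* (1999), Ch. IV, Thm (2.2) and Ch. II,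
Thm (1.7). [cite: RevuzYor1999, Ch. IV Thm (2.2) and Ch. II Thm (1.7)] -/
def lintegral_iSup_itoIntegral_sub_sq_le : Prop :=
  ∀ ⦃H H' J J' : ℝ≥0 → (ℝ≥0 → ℝ) → ℝ⦄,
    IsStronglyProgressive Literature.Probability.RandomPlanarGeometry.brownianFiltration H →
    IsStronglyProgressive Literature.Probability.RandomPlanarGeometry.brownianFiltration H' →
    Literature.Probability.Process.IsItoIntegral H Literature.Probability.Process.brownian J Literature.Probability.RandomPlanarGeometry.brownianFiltration Literature.Probability.Process.preWienerMeasure →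
    Literature.Probability.Process.IsItoIntegral H' Literature.Probability.Process.brownian J' Literature.Probability.RandomPlanarGeometry.brownianFiltration Literature.Probability.Process.preWienerMeasure →
    ∀ t : ℝ≥0,
      ∫⁻ ω, ⨆ s ∈ Set.Iic t, ENNReal.ofReal ((J s ω - J' s ω) ^ 2) ∂Literature.Probability.Process.preWienerMeasure ≤
        4 * ∫⁻ ω, (∫⁻ s in Set.Icc (0 : ℝ) t,
          ENNReal.ofReal ((H s.toNNReal ω - H' s.toNNReal ω) ^ 2)) ∂Literature.Probability.Process.preWienerMeasure

/-- **Stopping an Itô integral by truncating the integrand** (`(K·B)^ρ = (K 1_{[0,ρ]})·B`),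
canonical Brownian motion, raw Brownian filtration, square-integrable form: if `J = ∫ H dB`
(`IsItoIntegral`) with `H` progressively measurable, `ρ` is an *optional* time of the raw
filtration (`{ρ < t} ∈ 𝓕_t` for all `t`; under the usual conditions of RY this is the same as a
stopping time, and hitting times of a.s.-continuous adapted processes are of this kind), and the
truncated integrand `H 1_{[0,ρ]}` (`Literature.trunc ρ H s ω = if s ≤ ρ ω then H s ω else 0`) satisfies
`E ∫₀ᵗ (H 1_{[0,ρ]})² ds < ∞` for every `t`, then `H 1_{[0,ρ]}` has an Itô integral
indistinguishable from the stopped process `J^ρ`: RY IV (2.5) `K1_{[0,T]}·M = (K·M)^T`, extended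
to locally bounded integrands in (2.10)(ii). (The square-integrability hypothesis — which holds in
the uniqueness proof of RY IX (2.1), where `|X| ≤ k` on `[0, ρ_k]` — makes `∫ H1_{[0,ρ]} dB` a
true martingale of the *raw* filtration, so that no localising sequence of raw stopping times is
needed; `J'` is unique up to indistinguishability by `IsItoIntegral.unique_holds`.)
Raw-filtration version, label '?'. Named fact here (hypothesis `hS4` of the uniqueness theorems
below); it is proved from the construction of the integral in
`Literature/Probability/Process/ItoIntegralStopping.lean` (`IsItoIntegral.ae_eq_stoppedProcess`).
Revuz–Yor, *Continuous Martingales and Brownian Motion* (1999), Ch. IV, Prop. (2.5) and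
Prop. (2.10)(ii). [cite: RevuzYor1999, Ch. IV Prop. (2.5) and Prop. (2.10)(ii)] -/
def exists_itoIntegral_truncation_of_sq_integrable : Prop :=
  ∀ ⦃H J : ℝ≥0 → (ℝ≥0 → ℝ) → ℝ⦄ ⦃ρ : (ℝ≥0 → ℝ) → WithTop ℝ≥0⦄,
    IsStronglyProgressive Literature.Probability.RandomPlanarGeometry.brownianFiltration H →
    Literature.Probability.Process.IsItoIntegral H Literature.Probability.Process.brownian J Literature.Probability.RandomPlanarGeometry.brownianFiltration Literature.Probability.Process.preWienerMeasure →
    (∀ t : ℝ≥0, MeasurableSet[Literature.Probability.RandomPlanarGeometry.brownianFiltration t] {ω | ρ ω < t}) →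
    (∀ t : ℝ≥0, ∫⁻ ω, (∫⁻ s in Set.Icc (0 : ℝ) t,
      ENNReal.ofReal (trunc ρ H s.toNNReal ω ^ 2)) ∂Literature.Probability.Process.preWienerMeasure ≠ ∞) →
    ∃ J' : ℝ≥0 → (ℝ≥0 → ℝ) → ℝ,
      Literature.Probability.Process.IsItoIntegral (trunc ρ H) Literature.Probability.Process.brownian J' Literature.Probability.RandomPlanarGeometry.brownianFiltration Literature.Probability.Process.preWienerMeasure ∧
        ∀ᵐ ω ∂Literature.Probability.Process.preWienerMeasure, ∀ t, J' t ω = stoppedProcess J ρ t ω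

end Literature.Analysis.FunctionSpaces

namespace Literature.Analysis.FunctionSpaces

/-! ### Pathwise uniqueness for Lipschitz SDEs: analytic lemmas -/

section UniquenessLemmas

variable {Ω : Type*} {m : MeasurableSpace Ω} {P : Measure Ω}

/-- Cauchy–Schwarz for a time integral: `(∫ₐᵇ f)² ≤ (b - a) ∫ₐᵇ f²` (expand
`0 ≤ ∫ (f - c)²` with `c` the mean of `f`). [folklore] -/
theorem sq_integral_le_mul_integral_sq {f : ℝ → ℝ} {a b : ℝ} (hab : a ≤ b)
    (hf : IntegrableOn f (Set.Ioc a b)) (hf2 : IntegrableOn (fun x ↦ f x ^ 2) (Set.Ioc a b)) :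
    (∫ x in a..b, f x) ^ 2 ≤ (b - a) * ∫ x in a..b, f x ^ 2 := by
  rw [intervalIntegral.integral_of_le hab, intervalIntegral.integral_of_le hab]
  rcases eq_or_lt_of_le hab with rfl | hlt
  · simp
  have hpos : 0 < b - a := sub_pos.2 hlt
  set μ : Measure ℝ := volume.restrict (Set.Ioc a b) with hμ
  haveI : IsFiniteMeasure μ := by
    rw [hμ]
    exact isFiniteMeasure_restrict.2 measure_Ioc_lt_top.ne
  have hμu : (μ Set.univ).toReal = b - a := by
    rw [hμ, Measure.restrict_apply_univ, Real.volume_Ioc, ENNReal.toReal_ofReal hpos.le]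
  set I := ∫ x, f x ∂μ with hI
  set c := I / (b - a) with hc
  have key : 0 ≤ ∫ x, (f x - c) ^ 2 ∂μ := integral_nonneg fun x ↦ sq_nonneg _
  have hexp : ∫ x, (f x - c) ^ 2 ∂μ = (∫ x, f x ^ 2 ∂μ) - 2 * c * I + c ^ 2 * (b - a) := by
    have i1 : Integrable (fun x ↦ f x ^ 2) μ := hf2
    have i2 : Integrable (fun x ↦ 2 * c * f x) μ := hf.const_mul (2 * c)
    have i3 : Integrable (fun _ : ℝ ↦ c ^ 2) μ := integrable_const _
    calc ∫ x, (f x - c) ^ 2 ∂μ = ∫ x, (f x ^ 2 - 2 * c * f x + c ^ 2) ∂μ := by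
          congr 1; funext x; ring
      _ = (∫ x, (f x ^ 2 - 2 * c * f x) ∂μ) + ∫ _, c ^ 2 ∂μ :=
          integral_add (f := fun x ↦ f x ^ 2 - 2 * c * f x) (g := fun _ ↦ c ^ 2) (i1.sub i2) i3
      _ = ((∫ x, f x ^ 2 ∂μ) - ∫ x, 2 * c * f x ∂μ) + ∫ _, c ^ 2 ∂μ := by
          rw [integral_sub i1 i2]
      _ = _ := by
          rw [integral_const_mul, integral_const, smul_eq_mul, Measure.real, hμu]
          ring
  rw [hexp, hc] at key
  have : I ^ 2 / (b - a) ≤ ∫ x, f x ^ 2 ∂μ := by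
    have h2 : (∫ x, f x ^ 2 ∂μ) - 2 * (I / (b - a)) * I + (I / (b - a)) ^ 2 * (b - a) =
        (∫ x, f x ^ 2 ∂μ) - I ^ 2 / (b - a) := by
      field_simp
      ring
    linarith [h2 ▸ key]
  rwa [div_le_iff₀ hpos, mul_comm] at this

/-- Truncating the integrand of a time integral at a random time `ρ` stops the time integral:
`∫₀ˢ 𝟙_{r ≤ ρ} g(r) dr = ∫₀^{s ∧ ρ} g(r) dr`. [folklore] -/
theorem timeIntegral_trunc (g : ℝ≥0 → Ω → ℝ) (ρ : Ω → WithTop ℝ≥0) (s : ℝ≥0) (ω : Ω) :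
    timeIntegral (trunc ρ g) s ω = timeIntegral g ((min (s : WithTop ℝ≥0) (ρ ω)).untopA) ω := by
  unfold timeIntegral
  by_cases htop : ρ ω = ⊤
  · have hfun : (fun x : ℝ ↦ trunc ρ g x.toNNReal ω) = fun x ↦ g x.toNNReal ω := by
      funext x
      simp only [trunc_apply, htop, le_top, if_true]
    rw [hfun, htop, min_eq_left le_top]
    rfl
  · obtain ⟨r₀, hr₀⟩ := WithTop.ne_top_iff_exists.1 htop
    have hfun : (fun x : ℝ ↦ trunc ρ g x.toNNReal ω) =
        Set.indicator {x | x ≤ (r₀ : ℝ)} (fun x ↦ g x.toNNReal ω) := by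
      funext x
      simp only [trunc_apply, ← hr₀, WithTop.coe_le_coe, Set.indicator_apply, Set.mem_setOf_eq,
        Real.toNNReal_le_iff_le_coe]
    rw [hfun, ← hr₀, ← WithTop.coe_min]
    change ∫ x in (0 : ℝ)..s, Set.indicator {x | x ≤ (r₀ : ℝ)} (fun x ↦ g x.toNNReal ω) x =
      ∫ x in (0 : ℝ)..((min s r₀ : ℝ≥0) : ℝ), g x.toNNReal ω
    rcases le_total s r₀ with h | h
    · rw [min_eq_left h]
      refine intervalIntegral.integral_congr fun x hx ↦ ?_
      rw [Set.uIcc_of_le (NNReal.coe_nonneg s)] at hx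
      simp only [Set.indicator_apply, Set.mem_setOf_eq]
      rw [if_pos (hx.2.trans (NNReal.coe_le_coe.2 h))]
    · rw [min_eq_right h]
      exact intervalIntegral.integral_indicator ⟨r₀.coe_nonneg, NNReal.coe_le_coe.2 h⟩

/-- **Gronwall step of the uniqueness proof.** Let `D` be a jointly measurable, a.s. uniformly
bounded real process on a finite measure space such that, for `t ≤ T`,
`E[sup_{s ≤ t} D_s²] ≤ C E[∫₀ᵗ D_r² dr]` with a finite constant `C`. Then `D_s = 0` a.s. for
every `s ≤ T` (Tonelli, then Gronwall's lemma for the bounded monotone function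
`t ↦ E[sup_{s ≤ t} D_s²]`). This is the passage "Φ_t ≤ C ∫₀ᵗ Φ_s ds, Φ locally bounded, hence
Φ ≡ 0" of the proof of RY IX (2.1). [folklore] -/
theorem ae_eq_zero_of_lintegral_iSup_sq_le [IsFiniteMeasure P] {D : ℝ≥0 → Ω → ℝ}
    (hD : Measurable (fun p : ℝ≥0 × Ω ↦ D p.1 p.2)) {M : ℝ} (hM : ∀ᵐ ω ∂P, ∀ s, |D s ω| ≤ M)
    {T : ℝ≥0} {C : ℝ≥0∞} (hC : C ≠ ∞)
    (hle : ∀ t ≤ T, ∫⁻ ω, ⨆ s ∈ Set.Iic t, ENNReal.ofReal (D s ω ^ 2) ∂P ≤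
      C * ∫⁻ ω, (∫⁻ r in Set.Icc (0 : ℝ) t, ENNReal.ofReal (D r.toNNReal ω ^ 2)) ∂P) :
    ∀ s ≤ T, ∀ᵐ ω ∂P, D s ω = 0 := by
  set Φ : ℝ≥0 → ℝ≥0∞ := fun t ↦ ∫⁻ ω, ⨆ s ∈ Set.Iic t, ENNReal.ofReal (D s ω ^ 2) ∂P with hΦ
  have hΦmono : Monotone Φ := fun t t' h ↦
    lintegral_mono fun ω ↦ biSup_mono fun s (hs : s ∈ Set.Iic t) ↦ Set.mem_Iic.2 (hs.trans h)
  have hΦbdd : ∀ t, Φ t ≤ ENNReal.ofReal (M ^ 2) * P Set.univ := by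
    intro t
    calc Φ t ≤ ∫⁻ _, ENNReal.ofReal (M ^ 2) ∂P := by
          refine lintegral_mono_ae (hM.mono fun ω hω ↦ iSup₂_le fun s _ ↦ ?_)
          refine ENNReal.ofReal_le_ofReal ?_
          have h1 := hω s
          have h2 : |D s ω| ^ 2 ≤ M ^ 2 := pow_le_pow_left₀ (abs_nonneg _) h1 2
          rwa [sq_abs] at h2
      _ = ENNReal.ofReal (M ^ 2) * P Set.univ := lintegral_const _
  have hΦfin : ∀ t, Φ t < ∞ := fun t ↦
    (hΦbdd t).trans_lt (ENNReal.mul_lt_top ENNReal.ofReal_lt_top (measure_lt_top _ _))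
  -- measurability of `(ω, r) ↦ D_{r⁺}(ω)²`
  have hmeas2 : Measurable (fun q : Ω × ℝ ↦ ENNReal.ofReal (D q.2.toNNReal q.1 ^ 2)) := by
    have : Measurable (fun q : Ω × ℝ ↦ D q.2.toNNReal q.1) :=
      hD.comp ((measurable_real_toNNReal.comp measurable_snd).prodMk measurable_fst)
    exact (this.pow_const 2).ennreal_ofReal
  -- Tonelli and the bound `D_r² ≤ sup_{s ≤ r⁺} D_s²`
  have hswap : ∀ t : ℝ≥0, ∫⁻ ω, (∫⁻ r in Set.Icc (0 : ℝ) t, ENNReal.ofReal (D r.toNNReal ω ^ 2)) ∂P ≤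
      ∫⁻ r in Set.Icc (0 : ℝ) t, Φ r.toNNReal := by
    intro t
    rw [lintegral_lintegral_swap (hmeas2.aemeasurable)]
    refine lintegral_mono fun r ↦ lintegral_mono fun ω ↦ ?_
    exact le_iSup₂_of_le r.toNNReal (Set.mem_Iic.2 le_rfl) le_rfl
  -- the real-valued bounded monotone function `φ`
  set φ : ℝ → ℝ := fun r ↦ (Φ r.toNNReal).toReal with hφ
  have hφmono : Monotone φ := fun r r' h ↦
    ENNReal.toReal_mono (hΦfin _).ne (hΦmono (Real.toNNReal_le_toNNReal h))
  have hφm : Measurable φ := hφmono.measurable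
  have hφ0 : ∀ r, 0 ≤ φ r := fun r ↦ ENNReal.toReal_nonneg
  have hφbdd : ∃ Cb, ∀ r ∈ Set.Icc 0 (T : ℝ), φ r ≤ Cb :=
    ⟨(ENNReal.ofReal (M ^ 2) * P Set.univ).toReal, fun r _ ↦ ENNReal.toReal_mono
      (ENNReal.mul_ne_top ENNReal.ofReal_ne_top (measure_ne_top _ _)) (hΦbdd _)⟩
  have hφint : ∀ t : ℝ, IntegrableOn φ (Set.Icc 0 t) := by
    intro t
    obtain ⟨Cb, hCb⟩ : ∃ Cb, ∀ r, φ r ≤ Cb :=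
      ⟨(ENNReal.ofReal (M ^ 2) * P Set.univ).toReal, fun r ↦ ENNReal.toReal_mono
        (ENNReal.mul_ne_top ENNReal.ofReal_ne_top (measure_ne_top _ _)) (hΦbdd _)⟩
    refine Measure.integrableOn_of_bounded (M := Cb) measure_Icc_lt_top.ne
      hφm.aestronglyMeasurable (ae_of_all _ fun r ↦ ?_)
    rw [Real.norm_eq_abs, abs_of_nonneg (hφ0 r)]
    exact hCb r
  -- the integral inequality in real form
  have hkey : ∀ t ∈ Set.Icc 0 (T : ℝ), φ t ≤ C.toReal * ∫ r in (0 : ℝ)..t, φ r := by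
    intro t ht
    have ht' : t.toNNReal ≤ T := Real.toNNReal_le_iff_le_coe.2 ht.2
    have h1 := (hle _ ht').trans (mul_le_mul_right (hswap _) C)
    rw [Real.coe_toNNReal _ ht.1] at h1
    have h2 : ∫⁻ r in Set.Icc (0 : ℝ) t, Φ r.toNNReal = ENNReal.ofReal (∫ r in (0 : ℝ)..t, φ r) := by
      rw [intervalIntegral.integral_of_le ht.1, ← integral_Icc_eq_integral_Ioc,
        ofReal_integral_eq_lintegral_ofReal (hφint t) (ae_of_all _ fun r ↦ hφ0 r)]
      refine setLIntegral_congr_fun measurableSet_Icc fun r _ ↦ ?_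
      rw [hφ, ENNReal.ofReal_toReal (hΦfin _).ne]
    rw [h2] at h1
    have h3 := ENNReal.toReal_mono (ENNReal.mul_ne_top hC ENNReal.ofReal_ne_top) h1
    rwa [ENNReal.toReal_mul, ENNReal.toReal_ofReal
      (intervalIntegral.integral_nonneg ht.1 fun r _ ↦ hφ0 r)] at h3
  have hzero := eq_zero_of_le_integral ENNReal.toReal_nonneg T.coe_nonneg hφm
    (fun r _ ↦ hφ0 r) hφbdd hkey
  have hΦT : Φ T = 0 := by
    have h1 := hzero T ⟨T.coe_nonneg, le_rfl⟩
    simp only [hφ, Real.toNNReal_coe] at h1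
    exact ((ENNReal.toReal_eq_zero_iff _).1 h1).resolve_right (hΦfin T).ne
  intro s hs
  have h1 : ∫⁻ ω, ENNReal.ofReal (D s ω ^ 2) ∂P = 0 :=
    le_antisymm ((lintegral_mono fun ω ↦ le_iSup₂_of_le s hs le_rfl).trans hΦT.le) bot_le
  have hmeas : Measurable (fun ω ↦ ENNReal.ofReal (D s ω ^ 2)) :=
    ((hD.comp (measurable_const.prodMk measurable_id)).pow_const 2).ennreal_ofReal
  filter_upwards [(lintegral_eq_zero_iff hmeas).1 h1] with ω hω
  simp only [Pi.zero_apply, ENNReal.ofReal_eq_zero] at hω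
  exact pow_eq_zero_iff (n := 2) two_ne_zero |>.1 (le_antisymm hω (sq_nonneg _))

end UniquenessLemmas

end Literature.Analysis.FunctionSpaces

namespace Literature.Analysis.FunctionSpaces

section UniquenessAux

variable {Ω : Type*} {m : MeasurableSpace Ω}

/-- The finite random time `s ∧ ρ` read in `ℝ≥0` coerces back to `min s ρ`. [folklore] -/
theorem coe_untopA_min (s : ℝ≥0) (ρ : WithTop ℝ≥0) :
    (((min (s : WithTop ℝ≥0) ρ).untopA : ℝ≥0) : WithTop ℝ≥0) = min (s : WithTop ℝ≥0) ρ := by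
  have : min (s : WithTop ℝ≥0) ρ ≠ ⊤ := ne_top_of_le_ne_top WithTop.coe_ne_top (min_le_left _ _)
  rw [WithTop.untopA_eq_untop this, WithTop.coe_untop]

/-- `s ∧ ρ ≤ ρ`. [folklore] -/
theorem coe_untopA_min_le (s : ℝ≥0) (ρ : WithTop ℝ≥0) :
    (((min (s : WithTop ℝ≥0) ρ).untopA : ℝ≥0) : WithTop ℝ≥0) ≤ ρ := by
  rw [coe_untopA_min]; exact min_le_right _ _

/-- `s ∧ ρ ≤ s`. [folklore] -/
theorem untopA_min_le (s : ℝ≥0) (ρ : WithTop ℝ≥0) : (min (s : WithTop ℝ≥0) ρ).untopA ≤ s := by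
  have := min_le_left (s : WithTop ℝ≥0) ρ
  rw [← coe_untopA_min] at this
  exact WithTop.coe_le_coe.1 this

/-- Stopping a continuous path at a random time gives a continuous path. [folklore] -/
theorem continuous_stoppedProcess_apply {X : ℝ≥0 → Ω → ℝ} {ω : Ω} (h : Continuous (X · ω))
    (ρ : Ω → WithTop ℝ≥0) : Continuous (fun s ↦ stoppedProcess X ρ s ω) := by
  by_cases htop : ρ ω = ⊤
  · have : (fun s ↦ stoppedProcess X ρ s ω) = (X · ω) := by
      funext s; rw [stoppedProcess_eq_of_le (by rw [htop]; exact le_top)]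
    rwa [this]
  · obtain ⟨r₀, hr₀⟩ := WithTop.ne_top_iff_exists.1 htop
    have : (fun s ↦ stoppedProcess X ρ s ω) = fun s ↦ X (min s r₀) ω := by
      funext s
      simp only [stoppedProcess, ← hr₀, ← WithTop.coe_min]
      rfl
    rw [this]
    exact h.comp (continuous_id.min continuous_const)

/-- Nonnegative parts of rationals are dense in `ℝ≥0`. [folklore] -/
theorem denseRange_toNNReal_ratCast : DenseRange (fun q : ℚ ↦ ((q : ℝ).toNNReal)) := by
  have h1 : DenseRange Real.toNNReal :=
    Function.Surjective.denseRange fun x ↦ ⟨x, Real.toNNReal_coe⟩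
  exact h1.comp Rat.denseRange_cast continuous_real_toNNReal

/-- Measurability of `r ↦ ↑r⁺ : ℝ → WithTop ℝ≥0`. [folklore] -/
theorem measurable_coe_toNNReal_withTop :
    Measurable (fun r : ℝ ↦ ((r.toNNReal : ℝ≥0) : WithTop ℝ≥0)) :=
  WithTop.continuous_coe.measurable.comp measurable_real_toNNReal

/-- Truncation at a random time preserves local integrability of a path. [folklore] -/
theorem integrableOn_trunc {g : ℝ≥0 → Ω → ℝ} {ρ : Ω → WithTop ℝ≥0} {ω : Ω} {S : Set ℝ}
    (h : IntegrableOn (fun r : ℝ ↦ g r.toNNReal ω) S) :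
    IntegrableOn (fun r : ℝ ↦ trunc ρ g r.toNNReal ω) S := by
  have : (fun r : ℝ ↦ trunc ρ g r.toNNReal ω) =
      {r : ℝ | ((r.toNNReal : ℝ≥0) : WithTop ℝ≥0) ≤ ρ ω}.indicator (fun r ↦ g r.toNNReal ω) := by
    funext r
    simp only [trunc_apply, Set.indicator_apply, Set.mem_setOf_eq]
  rw [this]
  exact h.indicator (measurableSet_le measurable_coe_toNNReal_withTop measurable_const)

variable {𝓕 : Filtration ℝ≥0 m} {P : Measure Ω}

/-- The paths of a strong solution are almost surely continuous (time integral of a locally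
integrable drift plus an a.s.-continuous Itô integral).
Revuz–Yor, *Continuous Martingales and Brownian Motion* (1999), Ch. IX, Def. (1.2) ("a solution
is clearly a continuous semimartingale"). [folklore] -/
theorem IsStrongSolution.ae_continuous {b σ : ℝ → ℝ → ℝ} {x₀ : ℝ} {X B : ℝ≥0 → Ω → ℝ}
    (h : IsStrongSolution b σ x₀ X B 𝓕 P) : ∀ᵐ ω ∂P, Continuous (X · ω) := by
  obtain ⟨h0, -, hint, J, hJ, heq⟩ := h
  filter_upwards [hint, hJ.continuous, heq] with ω hi hc he
  have : (X · ω) = fun t ↦ x₀ + timeIntegral (fun s ω ↦ b s (X s ω)) t ω + J t ω := by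
    funext t
    rw [he t, h0 ω]
    rfl
  rw [this]
  exact (continuous_const.add (continuous_timeIntegral hi)).add hc

end UniquenessAux

/-! ### Pathwise uniqueness for Lipschitz SDEs (RY IX Thm (2.1), uniqueness half) -/

section UniquenessPathwise

/-- **Pathwise step of the `L²(sup)` estimates.** For a single path: if
`d(s) = ∫₀ˢ g + j(s)` with `g² ≤ K² e²` (Lipschitz drift difference along the paths, `e` a
bounded path) then `sup_{s ≤ t} d(s)² ≤ 2tK² ∫₀ᵗ e² + 2 sup_{s ≤ t} j(s)²` (Cauchy–Schwarz for the
drift part; the `(h+k)² ≤ 2h² + 2k²` step of RY IX (2.1)), written in `ℝ≥0∞`. [folklore] -/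
theorem iSup_sq_le_of_integral_repr {d j g e : ℝ≥0 → ℝ} {K M : ℝ} (hK : 0 ≤ K) (t : ℝ≥0)
    (hrepr : ∀ s, d s = (∫ r in (0 : ℝ)..s, g r.toNNReal) + j s)
    (hg : ∀ r, g r ^ 2 ≤ K ^ 2 * e r ^ 2) (hM : ∀ s ≤ t, |e s| ≤ M)
    (hgm : Measurable (fun r : ℝ ↦ g r.toNNReal)) (hem : Measurable (fun r : ℝ ↦ e r.toNNReal)) :
    ⨆ s ∈ Set.Iic t, ENNReal.ofReal (d s ^ 2) ≤
      ENNReal.ofReal (2 * t * K ^ 2) * (∫⁻ r in Set.Icc (0 : ℝ) t, ENNReal.ofReal (e r.toNNReal ^ 2)) +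
        2 * ⨆ s ∈ Set.Iic t, ENNReal.ofReal (j s ^ 2) := by
  have hM0 : 0 ≤ M := (abs_nonneg _).trans (hM 0 zero_le)
  have he2 : ∀ r ≤ t, e r ^ 2 ≤ M ^ 2 := fun r hr ↦ by
    rw [← sq_abs]; exact pow_le_pow_left₀ (abs_nonneg _) (hM r hr) 2
  have hg2 : ∀ r ≤ t, g r ^ 2 ≤ (K * M) ^ 2 := fun r hr ↦ by
    rw [mul_pow]; exact (hg r).trans (mul_le_mul_of_nonneg_left (he2 r hr) (sq_nonneg K))
  have hgb : ∀ r ≤ t, |g r| ≤ K * M := fun r hr ↦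
    (pow_le_pow_iff_left₀ (abs_nonneg _) (by positivity) two_ne_zero).1 (by rw [sq_abs]; exact hg2 r hr)
  -- integrability of the bounded measurable paths on measurable subsets of `[0, t]`
  have hsub : ∀ r ∈ Set.Icc (0 : ℝ) t, r.toNNReal ≤ t := fun r hr ↦
    Real.toNNReal_le_iff_le_coe.2 hr.2
  have hInt : ∀ {f : ℝ → ℝ} {B : ℝ}, Measurable f → (∀ r ∈ Set.Icc (0 : ℝ) t, ‖f r‖ ≤ B) →
      ∀ S : Set ℝ, MeasurableSet S → S ⊆ Set.Icc (0 : ℝ) t → IntegrableOn f S := by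
    intro f B hf hB S hS hSt
    refine Measure.integrableOn_of_bounded (M := B) ?_ hf.aestronglyMeasurable ?_
    · exact (lt_of_le_of_lt (measure_mono hSt) measure_Icc_lt_top).ne
    · rw [ae_restrict_iff' hS]
      exact ae_of_all _ fun r hr ↦ hB r (hSt hr)
  have hgint : ∀ S : Set ℝ, MeasurableSet S → S ⊆ Set.Icc (0 : ℝ) t →
      IntegrableOn (fun r : ℝ ↦ g r.toNNReal) S :=
    hInt hgm fun r hr ↦ by rw [Real.norm_eq_abs]; exact hgb _ (hsub r hr)
  have hg2int : ∀ S : Set ℝ, MeasurableSet S → S ⊆ Set.Icc (0 : ℝ) t →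
      IntegrableOn (fun r : ℝ ↦ g r.toNNReal ^ 2) S :=
    hInt (hgm.pow_const 2) fun r hr ↦ by
      rw [Real.norm_eq_abs, abs_of_nonneg (sq_nonneg _)]; exact hg2 _ (hsub r hr)
  have he2int : ∀ S : Set ℝ, MeasurableSet S → S ⊆ Set.Icc (0 : ℝ) t →
      IntegrableOn (fun r : ℝ ↦ e r.toNNReal ^ 2) S :=
    hInt (hem.pow_const 2) fun r hr ↦ by
      rw [Real.norm_eq_abs, abs_of_nonneg (sq_nonneg _)]; exact he2 _ (hsub r hr)
  have hIcc_sub : Set.Icc (0 : ℝ) t ⊆ Set.Icc (0 : ℝ) t := subset_rfl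
  have hIoc_sub : ∀ {u : ℝ}, u ≤ t → Set.Ioc (0 : ℝ) u ⊆ Set.Icc (0 : ℝ) t := fun hu r hr ↦
    ⟨hr.1.le, hr.2.trans hu⟩
  have hInn : 0 ≤ ∫ r in (0 : ℝ)..t, e r.toNNReal ^ 2 :=
    intervalIntegral.integral_nonneg t.coe_nonneg fun r _ ↦ sq_nonneg _
  refine iSup₂_le fun s hs ↦ ?_
  have hs' : (s : ℝ) ≤ t := NNReal.coe_le_coe.2 hs
  -- Cauchy–Schwarz and the Lipschitz bound for the drift part
  have hA : (∫ r in (0 : ℝ)..s, g r.toNNReal) ^ 2 ≤ t * (K ^ 2 * ∫ r in (0 : ℝ)..t, e r.toNNReal ^ 2) := by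
    calc (∫ r in (0 : ℝ)..s, g r.toNNReal) ^ 2
        ≤ ((s : ℝ) - 0) * ∫ r in (0 : ℝ)..s, g r.toNNReal ^ 2 :=
          sq_integral_le_mul_integral_sq s.coe_nonneg (hgint _ measurableSet_Ioc (hIoc_sub hs'))
            (hg2int _ measurableSet_Ioc (hIoc_sub hs'))
      _ ≤ t * ∫ r in (0 : ℝ)..t, g r.toNNReal ^ 2 := by
          rw [sub_zero]
          refine mul_le_mul hs' ?_ (intervalIntegral.integral_nonneg s.coe_nonneg
            fun r _ ↦ sq_nonneg _) t.coe_nonneg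
          rw [intervalIntegral.integral_of_le s.coe_nonneg,
            intervalIntegral.integral_of_le t.coe_nonneg]
          exact setIntegral_mono_set (hg2int _ measurableSet_Ioc (hIoc_sub le_rfl))
            (ae_of_all _ fun r ↦ sq_nonneg _)
            (Set.Ioc_subset_Ioc_right hs').eventuallyLE
      _ ≤ t * (K ^ 2 * ∫ r in (0 : ℝ)..t, e r.toNNReal ^ 2) := by
          refine mul_le_mul_of_nonneg_left ?_ t.coe_nonneg
          rw [← intervalIntegral.integral_const_mul]
          have i1 : IntegrableOn (fun r : ℝ ↦ g r.toNNReal ^ 2) (Set.uIcc 0 t) := by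
            rw [Set.uIcc_of_le t.coe_nonneg]; exact hg2int _ measurableSet_Icc hIcc_sub
          have i2 : IntegrableOn (fun r : ℝ ↦ K ^ 2 * e r.toNNReal ^ 2) (Set.uIcc 0 t) := by
            rw [Set.uIcc_of_le t.coe_nonneg]; exact (he2int _ measurableSet_Icc hIcc_sub).const_mul _
          exact intervalIntegral.integral_mono_on t.coe_nonneg i1.intervalIntegrable
            i2.intervalIntegrable fun r _ ↦ hg _
  have h1 : d s ^ 2 ≤ 2 * (t * (K ^ 2 * ∫ r in (0 : ℝ)..t, e r.toNNReal ^ 2)) + 2 * j s ^ 2 := by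
    rw [hrepr s]
    nlinarith [hA, sq_nonneg ((∫ r in (0 : ℝ)..s, g r.toNNReal) - j s)]
  have hI : ENNReal.ofReal (∫ r in (0 : ℝ)..t, e r.toNNReal ^ 2) =
      ∫⁻ r in Set.Icc (0 : ℝ) t, ENNReal.ofReal (e r.toNNReal ^ 2) := by
    rw [intervalIntegral.integral_of_le t.coe_nonneg, ← integral_Icc_eq_integral_Ioc,
      ofReal_integral_eq_lintegral_ofReal (he2int _ measurableSet_Icc hIcc_sub)
        (ae_of_all _ fun r ↦ sq_nonneg _)]
  calc ENNReal.ofReal (d s ^ 2)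
      ≤ ENNReal.ofReal (2 * (t * (K ^ 2 * ∫ r in (0 : ℝ)..t, e r.toNNReal ^ 2)) + 2 * j s ^ 2) :=
        ENNReal.ofReal_le_ofReal h1
    _ = ENNReal.ofReal (2 * t * K ^ 2) * ENNReal.ofReal (∫ r in (0 : ℝ)..t, e r.toNNReal ^ 2) +
          2 * ENNReal.ofReal (j s ^ 2) := by
        have e1 : (2 : ℝ) * (t * (K ^ 2 * ∫ r in (0 : ℝ)..t, e r.toNNReal ^ 2)) =
            (2 * t * K ^ 2) * ∫ r in (0 : ℝ)..t, e r.toNNReal ^ 2 := by ring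
        have p1 : (0 : ℝ) ≤ 2 * (t * (K ^ 2 * ∫ r in (0 : ℝ)..t, e r.toNNReal ^ 2)) :=
          mul_nonneg (by norm_num) (mul_nonneg t.coe_nonneg (mul_nonneg (sq_nonneg _) hInn))
        rw [ENNReal.ofReal_add p1 (by positivity), e1, ENNReal.ofReal_mul (by positivity),
          ENNReal.ofReal_mul (by norm_num : (0 : ℝ) ≤ 2), ENNReal.ofReal_ofNat]
    _ ≤ _ := by
        rw [hI]
        gcongr
        exact le_iSup₂_of_le s hs le_rfl

end UniquenessPathwise

section UniquenessIntegrated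

variable {Ω : Type*} {m : MeasurableSpace Ω} {P : Measure Ω}

/-- **Integrated step of the `L²(sup)` estimates.** From the pathwise bound
(`iSup_sq_le_of_integral_repr`) almost everywhere, the Doob–Itô bound for the martingale part
(`E[sup_{s≤t} Jd_s²] ≤ 4 E∫₀ᵗ Hd²`, an instance of S2) and the Lipschitz bound `Hd² ≤ K² E²`,
the estimate `E[sup_{s≤t} D_s²] ≤ (2TK² + 8K²) E∫₀ᵗ E_r² dr` for `t ≤ T`
(the chain "≤ 8E[∫(f(U)-f(V))² d⟨M⟩] + 2tE[∫|f(U)-f(V)|²|dA|] ≤ 2K²(4+t) E∫ sup|U-V|²" of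
RY IX (2.1)). [folklore] -/
theorem lintegral_iSup_sq_le_of_bounds {D E Jd Hd : ℝ≥0 → Ω → ℝ} {K : ℝ} {T : ℝ≥0}
    (hEm : Measurable (fun p : ℝ≥0 × Ω ↦ E p.1 p.2))
    (hpath : ∀ᵐ ω ∂P, ∀ t : ℝ≥0, ⨆ s ∈ Set.Iic t, ENNReal.ofReal (D s ω ^ 2) ≤
      ENNReal.ofReal (2 * t * K ^ 2) *
          (∫⁻ r in Set.Icc (0 : ℝ) t, ENNReal.ofReal (E r.toNNReal ω ^ 2)) +
        2 * ⨆ s ∈ Set.Iic t, ENNReal.ofReal (Jd s ω ^ 2))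
    (hDoob : ∀ t : ℝ≥0, ∫⁻ ω, ⨆ s ∈ Set.Iic t, ENNReal.ofReal (Jd s ω ^ 2) ∂P ≤
      4 * ∫⁻ ω, (∫⁻ r in Set.Icc (0 : ℝ) t, ENNReal.ofReal (Hd r.toNNReal ω ^ 2)) ∂P)
    (hH : ∀ᵐ ω ∂P, ∀ r, Hd r ω ^ 2 ≤ K ^ 2 * E r ω ^ 2) :
    ∀ t ≤ T, ∫⁻ ω, ⨆ s ∈ Set.Iic t, ENNReal.ofReal (D s ω ^ 2) ∂P ≤
      (ENNReal.ofReal (2 * T * K ^ 2) + 8 * ENNReal.ofReal (K ^ 2)) *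
        ∫⁻ ω, (∫⁻ r in Set.Icc (0 : ℝ) t, ENNReal.ofReal (E r.toNNReal ω ^ 2)) ∂P := by
  intro t ht
  have hF : Measurable (fun q : Ω × ℝ ↦ ENNReal.ofReal (E q.2.toNNReal q.1 ^ 2)) :=
    ((hEm.comp ((measurable_real_toNNReal.comp measurable_snd).prodMk measurable_fst)).pow_const
      2).ennreal_ofReal
  have hIm : Measurable (fun ω ↦ ∫⁻ r in Set.Icc (0 : ℝ) t, ENNReal.ofReal (E r.toNNReal ω ^ 2)) :=
    hF.lintegral_prod_right
  have hHle : ∫⁻ ω, (∫⁻ r in Set.Icc (0 : ℝ) t, ENNReal.ofReal (Hd r.toNNReal ω ^ 2)) ∂P ≤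
      ENNReal.ofReal (K ^ 2) * ∫⁻ ω, (∫⁻ r in Set.Icc (0 : ℝ) t, ENNReal.ofReal (E r.toNNReal ω ^ 2)) ∂P := by
    rw [← lintegral_const_mul _ hIm]
    refine lintegral_mono_ae (hH.mono fun ω hω ↦ ?_)
    rw [← lintegral_const_mul' _ _ ENNReal.ofReal_ne_top]
    refine lintegral_mono fun r ↦ ?_
    rw [← ENNReal.ofReal_mul (sq_nonneg K)]
    exact ENNReal.ofReal_le_ofReal (hω _)
  calc ∫⁻ ω, ⨆ s ∈ Set.Iic t, ENNReal.ofReal (D s ω ^ 2) ∂P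
      ≤ ∫⁻ ω, (ENNReal.ofReal (2 * t * K ^ 2) *
            (∫⁻ r in Set.Icc (0 : ℝ) t, ENNReal.ofReal (E r.toNNReal ω ^ 2)) +
          2 * ⨆ s ∈ Set.Iic t, ENNReal.ofReal (Jd s ω ^ 2)) ∂P :=
        lintegral_mono_ae (hpath.mono fun ω h ↦ h t)
    _ = ENNReal.ofReal (2 * t * K ^ 2) *
            ∫⁻ ω, (∫⁻ r in Set.Icc (0 : ℝ) t, ENNReal.ofReal (E r.toNNReal ω ^ 2)) ∂P +
          2 * ∫⁻ ω, ⨆ s ∈ Set.Iic t, ENNReal.ofReal (Jd s ω ^ 2) ∂P := by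
        rw [lintegral_add_left (hIm.const_mul _), lintegral_const_mul _ hIm,
          lintegral_const_mul' _ _ (by norm_num)]
    _ ≤ ENNReal.ofReal (2 * t * K ^ 2) *
            ∫⁻ ω, (∫⁻ r in Set.Icc (0 : ℝ) t, ENNReal.ofReal (E r.toNNReal ω ^ 2)) ∂P +
          2 * (4 * (ENNReal.ofReal (K ^ 2) *
            ∫⁻ ω, (∫⁻ r in Set.Icc (0 : ℝ) t, ENNReal.ofReal (E r.toNNReal ω ^ 2)) ∂P)) := by
        gcongr
        exact (hDoob t).trans (mul_le_mul_right hHle 4)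
    _ = (ENNReal.ofReal (2 * t * K ^ 2) + 8 * ENNReal.ofReal (K ^ 2)) *
          ∫⁻ ω, (∫⁻ r in Set.Icc (0 : ℝ) t, ENNReal.ofReal (E r.toNNReal ω ^ 2)) ∂P := by
        ring
    _ ≤ _ := by
        gcongr

end UniquenessIntegrated

section UniquenessCanonical

/-- **Truncated Lipschitz integrands are square integrable**: if `|X_s| ≤ L` on `[0, ρ]` a.s.,
`σ` is Lipschitz in `x` and locally bounded at `x = 0`, then `E ∫₀ᵗ (σ(s, X_s) 1_{s ≤ ρ})² ds < ∞`
(bound `(C_t + K L)² t`). This is the square-integrability needed to stop the Itô integral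
`∫ σ(s,X_s) dB` at the optional time `ρ` inside the raw filtration. [folklore] -/
theorem lintegral_trunc_along_sq_ne_top {σ : ℝ → ℝ → ℝ} {K : ℝ≥0}
    (hL : ∀ t, LipschitzWith K (σ t)) (hbd : ∀ T : ℝ, ∃ C, ∀ t ∈ Set.Icc 0 T, |σ t 0| ≤ C)
    {X : ℝ≥0 → (ℝ≥0 → ℝ) → ℝ} {ρ : (ℝ≥0 → ℝ) → WithTop ℝ≥0} {L : ℝ}
    (hbound : ∀ᵐ ω ∂Literature.Probability.Process.preWienerMeasure, ∀ s : ℝ≥0, (s : WithTop ℝ≥0) ≤ ρ ω → |X s ω| ≤ L)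
    (t : ℝ≥0) :
    ∫⁻ ω, (∫⁻ s in Set.Icc (0 : ℝ) t,
      ENNReal.ofReal (trunc ρ (along σ X) s.toNNReal ω ^ 2)) ∂Literature.Probability.Process.preWienerMeasure ≠ ∞ := by
  obtain ⟨C, hC⟩ := hbd t
  have hC0 : 0 ≤ C := (abs_nonneg _).trans (hC 0 ⟨le_rfl, t.2⟩)
  have hpt : ∀ᵐ ω ∂Literature.Probability.Process.preWienerMeasure, ∫⁻ s in Set.Icc (0 : ℝ) t,
      ENNReal.ofReal (trunc ρ (along σ X) s.toNNReal ω ^ 2) ≤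
      ENNReal.ofReal ((C + K * |L|) ^ 2) * volume (Set.Icc (0 : ℝ) t) := by
    filter_upwards [hbound] with ω hω
    rw [← setLIntegral_const]
    refine setLIntegral_mono' measurableSet_Icc fun s hs ↦ ENNReal.ofReal_le_ofReal ?_
    rw [trunc_apply]
    split_ifs with h
    · have hsT : ((s.toNNReal : ℝ≥0) : ℝ) ∈ Set.Icc 0 (t : ℝ) :=
        ⟨NNReal.coe_nonneg _, by rw [Real.coe_toNNReal _ hs.1]; exact hs.2⟩
      have h1 : |σ (s.toNNReal) (X s.toNNReal ω)| ≤ C + K * |X s.toNNReal ω| := by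
        have hd := (hL (s.toNNReal : ℝ)).dist_le_mul (X s.toNNReal ω) 0
        rw [Real.dist_eq, Real.dist_eq, sub_zero] at hd
        have h0 := hC _ hsT
        calc |σ (s.toNNReal) (X s.toNNReal ω)|
            = |(σ (s.toNNReal) (X s.toNNReal ω) - σ (s.toNNReal) 0) + σ (s.toNNReal) 0| := by ring_nf
          _ ≤ |σ (s.toNNReal) (X s.toNNReal ω) - σ (s.toNNReal) 0| + |σ (s.toNNReal) 0| := abs_add_le _ _
          _ ≤ K * |X s.toNNReal ω| + C := add_le_add hd h0
          _ = C + K * |X s.toNNReal ω| := add_comm _ _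
      have h2 := hω s.toNNReal h
      have h3 : |along σ X s.toNNReal ω| ≤ C + K * |L| := by
        simp only [along]
        refine h1.trans ?_
        have hK : (0 : ℝ) ≤ K := K.2
        nlinarith [h2.trans (le_abs_self L)]
      rw [← sq_abs]
      exact pow_le_pow_left₀ (abs_nonneg _) h3 2
    · simp only [ne_eq, OfNat.ofNat_ne_zero, not_false_eq_true, zero_pow]
      positivity
  refine (lt_of_le_of_lt (lintegral_mono_ae hpt) ?_).ne
  rw [lintegral_const]
  exact ENNReal.mul_lt_top (ENNReal.mul_lt_top ENNReal.ofReal_lt_top measure_Icc_lt_top)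
    (measure_lt_top _ _)

/-- **Localised uniqueness.** On the canonical space, for two progressively measurable strong
solutions `X, Y` of the Lipschitz SDE and an optional time `ρ` before which both stay bounded
(a.s.), the stopped processes `X^ρ` and `Y^ρ` agree at every time almost surely — given the named
facts S2 and S4. This is "`Φ_t(X^{T_k}, Y^{T_k}) ≤ C∫₀ᵗ Φ_s ds`, hence `X = Y` on `[0, T_k ∧ T]`"
in the proof of RY IX (2.1), with the optional times of the raw filtration in place of `T_k`.
Revuz–Yor, *Continuous Martingales and Brownian Motion* (1999), Ch. IX, Thm (2.1) (uniqueness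
part of the proof). [cite: RevuzYor1999, Ch. IX Thm (2.1)] -/
theorem IsStrongSolution.stopped_ae_eq (hS2 : lintegral_iSup_itoIntegral_sub_sq_le)
    (hS4 : exists_itoIntegral_truncation_of_sq_integrable) {b σ : ℝ → ℝ → ℝ} {x₀ : ℝ} {K : ℝ≥0}
    (hbm : Measurable (Function.uncurry b)) (hσm : Measurable (Function.uncurry σ))
    (hLip : ∀ t, LipschitzWith K (b t) ∧ LipschitzWith K (σ t))
    (hσbd : ∀ T : ℝ, ∃ C, ∀ t ∈ Set.Icc 0 T, |σ t 0| ≤ C)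
    {X Y : ℝ≥0 → (ℝ≥0 → ℝ) → ℝ}
    (hXp : IsStronglyProgressive Literature.Probability.RandomPlanarGeometry.brownianFiltration X)
    (hYp : IsStronglyProgressive Literature.Probability.RandomPlanarGeometry.brownianFiltration Y)
    (hX : IsStrongSolution b σ x₀ X Literature.Probability.Process.brownian Literature.Probability.RandomPlanarGeometry.brownianFiltration Literature.Probability.Process.preWienerMeasure)
    (hY : IsStrongSolution b σ x₀ Y Literature.Probability.Process.brownian Literature.Probability.RandomPlanarGeometry.brownianFiltration Literature.Probability.Process.preWienerMeasure)
    {ρ : (ℝ≥0 → ℝ) → WithTop ℝ≥0}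
    (hρ : ∀ t : ℝ≥0, MeasurableSet[Literature.Probability.RandomPlanarGeometry.brownianFiltration t] {ω | ρ ω < t}) {L : ℝ}
    (hbound : ∀ᵐ ω ∂Literature.Probability.Process.preWienerMeasure, ∀ s : ℝ≥0, (s : WithTop ℝ≥0) ≤ ρ ω →
      |X s ω| ≤ L ∧ |Y s ω| ≤ L)
    (T : ℝ≥0) :
    ∀ s ≤ T, ∀ᵐ ω ∂Literature.Probability.Process.preWienerMeasure, stoppedProcess Y ρ s ω = stoppedProcess X ρ s ω := by
  obtain ⟨hX0, -, hXint, JX, hJX, hXeq⟩ := hX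
  obtain ⟨hY0, -, hYint, JY, hJY, hYeq⟩ := hY
  -- truncated Itô integrals (S4) and their progressive versions
  obtain ⟨J1, hJ1, hJ1eq⟩ := hS4
    (IsStronglyProgressive.comp_measurable₂ hXp hσm) hJX hρ
    (lintegral_trunc_along_sq_ne_top (fun t ↦ (hLip t).2) hσbd (hbound.mono fun ω h s hs ↦ (h s hs).1))
  obtain ⟨J2, hJ2, hJ2eq⟩ := hS4
    (IsStronglyProgressive.comp_measurable₂ hYp hσm) hJY hρ
    (lintegral_trunc_along_sq_ne_top (fun t ↦ (hLip t).2) hσbd (hbound.mono fun ω h s hs ↦ (h s hs).2))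
  obtain ⟨J1', hJ1', hJ1'p, -, hJ1'eq⟩ := hJ1.exists_isStronglyProgressive
  obtain ⟨J2', hJ2', hJ2'p, -, hJ2'eq⟩ := hJ2.exists_isStronglyProgressive
  -- Doob–Itô bound (S2) for the truncated diffusion coefficients
  have hDoob := hS2 (isStronglyProgressive_trunc (IsStronglyProgressive.comp_measurable₂ hYp hσm) hρ)
    (isStronglyProgressive_trunc (IsStronglyProgressive.comp_measurable₂ hXp hσm) hρ) hJ2' hJ1'
  -- the truncated drift difference and the difference process
  have hgDp : IsStronglyProgressive Literature.Probability.RandomPlanarGeometry.brownianFiltration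
      (trunc ρ (fun s ω ↦ along b Y s ω - along b X s ω)) :=
    isStronglyProgressive_trunc ((IsStronglyProgressive.comp_measurable₂ hYp hbm).sub
      (IsStronglyProgressive.comp_measurable₂ hXp hbm)) hρ
  have hDp : IsStronglyProgressive Literature.Probability.RandomPlanarGeometry.brownianFiltration (fun s ω ↦
      timeIntegral (trunc ρ (fun s ω ↦ along b Y s ω - along b X s ω)) s ω + (J2' s ω - J1' s ω)) :=
    (isStronglyProgressive_timeIntegral hgDp).add (hJ2'p.sub hJ1'p)
  have hDm := IsStronglyProgressive.measurable_uncurry hDp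
  have hgDm := IsStronglyProgressive.measurable_uncurry hgDp
  -- (i) the difference process is the stopped difference `Y^ρ - X^ρ`
  have hDeq : ∀ᵐ ω ∂Literature.Probability.Process.preWienerMeasure, ∀ s,
      timeIntegral (trunc ρ (fun s ω ↦ along b Y s ω - along b X s ω)) s ω + (J2' s ω - J1' s ω) =
        stoppedProcess Y ρ s ω - stoppedProcess X ρ s ω := by
    filter_upwards [hXeq, hYeq, hXint, hYint, hJ1'eq, hJ1eq, hJ2'eq, hJ2eq] with
      ω hxe hye hxi hyi h1' h1 h2' h2 s
    have hsub : timeIntegral (trunc ρ (fun s ω ↦ along b Y s ω - along b X s ω)) s ω =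
        timeIntegral (trunc ρ (along b Y)) s ω - timeIntegral (trunc ρ (along b X)) s ω := by
      simp only [timeIntegral]
      rw [← intervalIntegral.integral_sub]
      · congr 1
        funext r
        simp only [trunc_apply]
        split_ifs <;> ring
      · exact (intervalIntegrable_iff_integrableOn_Ioc_of_le s.coe_nonneg).2
          ((integrableOn_trunc (g := along b Y) (hyi s)).mono_set Set.Ioc_subset_Icc_self)
      · exact (intervalIntegrable_iff_integrableOn_Ioc_of_le s.coe_nonneg).2
          ((integrableOn_trunc (g := along b X) (hxi s)).mono_set Set.Ioc_subset_Icc_self)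
    rw [hsub, timeIntegral_trunc, timeIntegral_trunc, h1' s, h1 s, h2' s, h2 s]
    simp only [stoppedProcess]
    rw [hxe, hye, hX0 ω, hY0 ω]
    simp only [timeIntegral, along]
    ring
  -- (ii) the difference process is a.s. bounded by `2L`
  have hDbdd : ∀ᵐ ω ∂Literature.Probability.Process.preWienerMeasure, ∀ s,
      |timeIntegral (trunc ρ (fun s ω ↦ along b Y s ω - along b X s ω)) s ω + (J2' s ω - J1' s ω)| ≤
        2 * L := by
    filter_upwards [hDeq, hbound] with ω hde hb s
    rw [hde s]
    simp only [stoppedProcess]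
    obtain ⟨h1, h2⟩ := hb _ (coe_untopA_min_le s (ρ ω))
    calc |Y _ ω - X _ ω| ≤ |Y _ ω| + |X _ ω| := abs_sub _ _
      _ ≤ L + L := add_le_add h2 h1
      _ = 2 * L := by ring
  -- (iii) pointwise Lipschitz bounds on the truncated coefficient differences
  have hLipb : ∀ᵐ ω ∂Literature.Probability.Process.preWienerMeasure, ∀ r,
      (trunc ρ (fun s ω ↦ along b Y s ω - along b X s ω)) r ω ^ 2 ≤ (K : ℝ) ^ 2 *
        (timeIntegral (trunc ρ (fun s ω ↦ along b Y s ω - along b X s ω)) r ω +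
          (J2' r ω - J1' r ω)) ^ 2 := by
    filter_upwards [hDeq] with ω hde r
    rw [hde r]
    by_cases hr : (r : WithTop ℝ≥0) ≤ ρ ω
    · rw [trunc_of_le hr, stoppedProcess_eq_of_le hr, stoppedProcess_eq_of_le hr]
      simp only [along]
      have hb := (hLip r).1.dist_le_mul (Y r ω) (X r ω)
      rw [Real.dist_eq, Real.dist_eq] at hb
      calc (b r (Y r ω) - b r (X r ω)) ^ 2 = |b r (Y r ω) - b r (X r ω)| ^ 2 := (sq_abs _).symm
        _ ≤ (K * |Y r ω - X r ω|) ^ 2 := pow_le_pow_left₀ (abs_nonneg _) hb 2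
        _ = (K : ℝ) ^ 2 * (Y r ω - X r ω) ^ 2 := by rw [mul_pow, sq_abs]
    · rw [trunc_of_not_le hr]
      simp only [ne_eq, OfNat.ofNat_ne_zero, not_false_eq_true, zero_pow]
      positivity
  have hLipσ : ∀ᵐ ω ∂Literature.Probability.Process.preWienerMeasure, ∀ r,
      (trunc ρ (along σ Y) r ω - trunc ρ (along σ X) r ω) ^ 2 ≤ (K : ℝ) ^ 2 *
        (timeIntegral (trunc ρ (fun s ω ↦ along b Y s ω - along b X s ω)) r ω +
          (J2' r ω - J1' r ω)) ^ 2 := by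
    filter_upwards [hDeq] with ω hde r
    rw [hde r]
    by_cases hr : (r : WithTop ℝ≥0) ≤ ρ ω
    · rw [trunc_of_le hr, trunc_of_le hr, stoppedProcess_eq_of_le hr, stoppedProcess_eq_of_le hr]
      simp only [along]
      have hs := (hLip r).2.dist_le_mul (Y r ω) (X r ω)
      rw [Real.dist_eq, Real.dist_eq] at hs
      calc (σ r (Y r ω) - σ r (X r ω)) ^ 2 = |σ r (Y r ω) - σ r (X r ω)| ^ 2 := (sq_abs _).symm
        _ ≤ (K * |Y r ω - X r ω|) ^ 2 := pow_le_pow_left₀ (abs_nonneg _) hs 2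
        _ = (K : ℝ) ^ 2 * (Y r ω - X r ω) ^ 2 := by rw [mul_pow, sq_abs]
    · rw [trunc_of_not_le hr, trunc_of_not_le hr, sub_self]
      simp only [ne_eq, OfNat.ofNat_ne_zero, not_false_eq_true, zero_pow]
      positivity
  -- (iv) pathwise estimate, then the integrated estimate, then Gronwall
  have hpath : ∀ᵐ ω ∂Literature.Probability.Process.preWienerMeasure, ∀ t : ℝ≥0,
      ⨆ s ∈ Set.Iic t, ENNReal.ofReal
        ((timeIntegral (trunc ρ (fun s ω ↦ along b Y s ω - along b X s ω)) s ω +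
          (J2' s ω - J1' s ω)) ^ 2) ≤
      ENNReal.ofReal (2 * t * (K : ℝ) ^ 2) * (∫⁻ r in Set.Icc (0 : ℝ) t, ENNReal.ofReal
        ((timeIntegral (trunc ρ (fun s ω ↦ along b Y s ω - along b X s ω)) r.toNNReal ω +
          (J2' r.toNNReal ω - J1' r.toNNReal ω)) ^ 2)) +
        2 * ⨆ s ∈ Set.Iic t, ENNReal.ofReal ((J2' s ω - J1' s ω) ^ 2) := by
    filter_upwards [hLipb, hDbdd] with ω hlip hbd t
    refine iSup_sq_le_of_integral_repr (K := (K : ℝ)) (M := 2 * L)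
      (d := fun s ↦ timeIntegral (trunc ρ (fun s ω ↦ along b Y s ω - along b X s ω)) s ω +
        (J2' s ω - J1' s ω))
      (e := fun s ↦ timeIntegral (trunc ρ (fun s ω ↦ along b Y s ω - along b X s ω)) s ω +
        (J2' s ω - J1' s ω))
      (j := fun s ↦ J2' s ω - J1' s ω)
      (g := fun s ↦ trunc ρ (fun s ω ↦ along b Y s ω - along b X s ω) s ω) K.coe_nonneg t
      (fun s ↦ rfl) hlip (fun s _ ↦ hbd s) ?_ ?_
    · exact hgDm.comp (measurable_real_toNNReal.prodMk measurable_const)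
    · exact hDm.comp (measurable_real_toNNReal.prodMk measurable_const)
  have hest := lintegral_iSup_sq_le_of_bounds (P := Literature.Probability.Process.preWienerMeasure) (K := (K : ℝ)) (T := T)
    (D := fun s ω ↦ timeIntegral (trunc ρ (fun s ω ↦ along b Y s ω - along b X s ω)) s ω +
      (J2' s ω - J1' s ω))
    (E := fun s ω ↦ timeIntegral (trunc ρ (fun s ω ↦ along b Y s ω - along b X s ω)) s ω +
      (J2' s ω - J1' s ω))
    (Jd := fun s ω ↦ J2' s ω - J1' s ω)
    (Hd := fun s ω ↦ trunc ρ (along σ Y) s ω - trunc ρ (along σ X) s ω) hDm hpath hDoob hLipσ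
  have hCfin : ENNReal.ofReal (2 * T * (K : ℝ) ^ 2) + 8 * ENNReal.ofReal ((K : ℝ) ^ 2) ≠ ∞ := by
    simp only [ne_eq, ENNReal.add_eq_top, ENNReal.ofReal_ne_top, false_or]
    exact ENNReal.mul_ne_top (by norm_num) ENNReal.ofReal_ne_top
  have hzero := ae_eq_zero_of_lintegral_iSup_sq_le (P := Literature.Probability.Process.preWienerMeasure)
    (D := fun s ω ↦ timeIntegral (trunc ρ (fun s ω ↦ along b Y s ω - along b X s ω)) s ω +
      (J2' s ω - J1' s ω)) hDm hDbdd hCfin hest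
  intro s hs
  filter_upwards [hzero s hs, hDeq] with ω h0 hde
  have := hde s
  rw [h0] at this
  linarith

/-- **Pathwise uniqueness, progressive case.** On the canonical space, two progressively
measurable strong solutions of `dX = b(t,X)dt + σ(t,X)dB`, `X₀ = x₀`, with `b, σ` jointly Borel
and Lipschitz in `x` uniformly in `t`, are indistinguishable — given the named facts S2
(Doob–Itô `L²` bound) and S4 (truncation of Itô integrals at optional times). Proof as in
Revuz–Yor IX (2.1): localise at the optional times `ρ_k` (first rational time at which
`|X| ∨ |Y|` exceeds `|x₀| + k`, `IsStrongSolution.stopped_ae_eq`), and let `k → ∞` along the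
a.s. continuous paths.
Revuz–Yor, *Continuous Martingales and Brownian Motion* (1999), Ch. IX, Thm (2.1)
(uniqueness part of the proof). [cite: RevuzYor1999, Ch. IX Thm (2.1)] -/
theorem IsStrongSolution.unique_of_isStronglyProgressive (hS2 : lintegral_iSup_itoIntegral_sub_sq_le)
    (hS4 : exists_itoIntegral_truncation_of_sq_integrable)
    {b σ : ℝ → ℝ → ℝ} {x₀ : ℝ} {K : ℝ≥0}
    (hbm : Measurable (Function.uncurry b)) (hσm : Measurable (Function.uncurry σ))
    (hLip : ∀ t, LipschitzWith K (b t) ∧ LipschitzWith K (σ t))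
    (hσbd : ∀ T : ℝ, ∃ C, ∀ t ∈ Set.Icc 0 T, |σ t 0| ≤ C)
    {X Y : ℝ≥0 → (ℝ≥0 → ℝ) → ℝ}
    (hXp : IsStronglyProgressive Literature.Probability.RandomPlanarGeometry.brownianFiltration X)
    (hYp : IsStronglyProgressive Literature.Probability.RandomPlanarGeometry.brownianFiltration Y)
    (hX : IsStrongSolution b σ x₀ X Literature.Probability.Process.brownian Literature.Probability.RandomPlanarGeometry.brownianFiltration Literature.Probability.Process.preWienerMeasure)
    (hY : IsStrongSolution b σ x₀ Y Literature.Probability.Process.brownian Literature.Probability.RandomPlanarGeometry.brownianFiltration Literature.Probability.Process.preWienerMeasure) :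
    ∀ᵐ ω ∂Literature.Probability.Process.preWienerMeasure, ∀ t, X t ω = Y t ω := by
  have hXc := hX.ae_continuous
  have hYc := hY.ae_continuous
  have hXa : Adapted Literature.Probability.RandomPlanarGeometry.brownianFiltration X := hX.2.1
  have hYa : Adapted Literature.Probability.RandomPlanarGeometry.brownianFiltration Y := hY.2.1
  -- the level process `U = |X| ∨ |Y|` and the optional times `ρ k`
  have hUa : Adapted Literature.Probability.RandomPlanarGeometry.brownianFiltration (fun t ω ↦ max |X t ω| |Y t ω|) := fun t ↦
    (continuous_abs.measurable.comp (hXa t)).max (continuous_abs.measurable.comp (hYa t))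
  have hUc : ∀ᵐ ω ∂Literature.Probability.Process.preWienerMeasure, Continuous (fun t ↦ max |X t ω| |Y t ω|) := by
    filter_upwards [hXc, hYc] with ω h1 h2
    exact (continuous_abs.comp h1).max (continuous_abs.comp h2)
  have hρopt : ∀ (k : ℕ) (t : ℝ≥0), MeasurableSet[Literature.Probability.RandomPlanarGeometry.brownianFiltration t]
      {ω | ratHitting (fun t ω ↦ max |X t ω| |Y t ω|) (|x₀| + k) ω < t} :=
    fun k t ↦ measurableSet_ratHitting_lt hUa t
  have hbound : ∀ k : ℕ, ∀ᵐ ω ∂Literature.Probability.Process.preWienerMeasure, ∀ s : ℝ≥0,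
      (s : WithTop ℝ≥0) ≤ ratHitting (fun t ω ↦ max |X t ω| |Y t ω|) (|x₀| + k) ω →
        |X s ω| ≤ |x₀| + k ∧ |Y s ω| ≤ |x₀| + k := by
    intro k
    filter_upwards [hUc] with ω hu s hs
    have := le_of_le_ratHitting (U := fun t ω ↦ max |X t ω| |Y t ω|) hu
      (by simp only [hX.1 ω, hY.1 ω, max_self]; exact le_add_of_nonneg_right k.cast_nonneg) hs
    exact ⟨(le_max_left _ _).trans this, (le_max_right _ _).trans this⟩
  -- localised uniqueness at every rational time, for every `k`
  have hall : ∀ᵐ ω ∂Literature.Probability.Process.preWienerMeasure, ∀ (k : ℕ) (q : ℚ),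
      stoppedProcess Y (ratHitting (fun t ω ↦ max |X t ω| |Y t ω|) (|x₀| + k)) (q : ℝ).toNNReal ω =
        stoppedProcess X (ratHitting (fun t ω ↦ max |X t ω| |Y t ω|) (|x₀| + k))
          (q : ℝ).toNNReal ω := by
    rw [ae_all_iff]; intro k
    rw [ae_all_iff]; intro q
    refine IsStrongSolution.stopped_ae_eq hS2 hS4 hbm hσm hLip hσbd hXp hYp hX hY (hρopt k) (hbound k)
      (⌈(q : ℝ)⌉₊ : ℝ≥0) _ ?_
    exact Real.toNNReal_le_iff_le_coe.2 (by rw [NNReal.coe_natCast]; exact Nat.le_ceil _)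
  filter_upwards [hall, hXc, hYc, hUc] with ω h hx hy hu t
  have hev : ∀ᶠ k : ℕ in atTop, (t : WithTop ℝ≥0) <
      ratHitting (fun t ω ↦ max |X t ω| |Y t ω|) (|x₀| + k) ω :=
    (tendsto_atTop_add_const_left atTop |x₀| tendsto_natCast_atTop_atTop).eventually
      (eventually_lt_ratHitting hu t)
  obtain ⟨k, hk⟩ := hev.exists
  -- the stopped difference is continuous and vanishes at the dense rational times
  have hcont : Continuous (fun s ↦
      stoppedProcess Y (ratHitting (fun t ω ↦ max |X t ω| |Y t ω|) (|x₀| + k)) s ω -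
        stoppedProcess X (ratHitting (fun t ω ↦ max |X t ω| |Y t ω|) (|x₀| + k)) s ω) :=
    (continuous_stoppedProcess_apply hy _).sub (continuous_stoppedProcess_apply hx _)
  have hzero : (fun s ↦
      stoppedProcess Y (ratHitting (fun t ω ↦ max |X t ω| |Y t ω|) (|x₀| + k)) s ω -
        stoppedProcess X (ratHitting (fun t ω ↦ max |X t ω| |Y t ω|) (|x₀| + k)) s ω) =
      fun _ ↦ (0 : ℝ) :=
    Continuous.ext_on denseRange_toNNReal_ratCast hcont continuous_const (by
      rintro _ ⟨q, rfl⟩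
      simp only [h k q, sub_self])
  have := congrFun hzero t
  rw [stoppedProcess_eq_of_le hk.le, stoppedProcess_eq_of_le hk.le] at this
  linarith

/-- **Progressive modification of a strong solution.** The left regularisation `dyadicReg X` of a
strong solution (raw filtration) is again a strong solution with the same Itô integral, is
progressively measurable, and is indistinguishable from `X` (the paths of `X` are a.s.
continuous). [folklore] -/
theorem IsStrongSolution.dyadicReg_spec {Ω : Type*} {m : MeasurableSpace Ω} {𝓕 : Filtration ℝ≥0 m}
    {P : Measure Ω} {b σ : ℝ → ℝ → ℝ} {x₀ : ℝ} {X B : ℝ≥0 → Ω → ℝ}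
    (h : IsStrongSolution b σ x₀ X B 𝓕 P) :
    IsStrongSolution b σ x₀ (dyadicReg X) B 𝓕 P ∧ IsStronglyProgressive 𝓕 (dyadicReg X) ∧
      ∀ᵐ ω ∂P, ∀ t, dyadicReg X t ω = X t ω := by
  have hc := h.ae_continuous
  obtain ⟨h0, ha, hint, J, hJ, heq⟩ := h
  have hae : ∀ᵐ ω ∂P, ∀ t, dyadicReg X t ω = X t ω :=
    hc.mono fun ω hω t ↦ dyadicReg_apply_of_continuous hω t
  refine ⟨⟨fun ω ↦ by rw [dyadicReg_apply_zero, h0], adapted_dyadicReg ha, ?_, J, ?_, ?_⟩,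
    isStronglyProgressive_dyadicReg ha, hae⟩
  · filter_upwards [hint, hae] with ω hi hω t
    have : (fun s : ℝ ↦ (fun (s : ℝ≥0) (ω : Ω) ↦ b s (dyadicReg X s ω)) s.toNNReal ω) =
        fun s : ℝ ↦ (fun (s : ℝ≥0) (ω : Ω) ↦ b s (X s ω)) s.toNNReal ω := by
      funext s; simp only [hω]
    rw [this]
    exact hi t
  · exact hJ.congr_integrand_ae (by filter_upwards [hae] with ω hω t; simp only [hω])
  · filter_upwards [heq, hae] with ω he hω t
    have : (fun s : ℝ ↦ (fun (s : ℝ≥0) (ω : Ω) ↦ b s (dyadicReg X s ω)) s.toNNReal ω) =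
        fun s : ℝ ↦ (fun (s : ℝ≥0) (ω : Ω) ↦ b s (X s ω)) s.toNNReal ω := by
      funext s; simp only [hω]
    rw [hω t, he t, hω 0, this]

/-- **Pathwise uniqueness for Lipschitz SDEs** (RY IX Thm (2.1), uniqueness half), on the
canonical space with the raw Brownian filtration, *conditional on the named facts* S2
(`lintegral_iSup_itoIntegral_sub_sq_le`) and S4 (`exists_itoIntegral_truncation_of_sq_integrable`): two strong
solutions of `dX = b(t,X)dt + σ(t,X)dB`, `X₀ = x₀`, with `b, σ` jointly Borel and Lipschitz in
`x` uniformly in `t`, are indistinguishable. (Reduce to progressively measurable solutions by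
left regularisation, `IsStrongSolution.dyadicReg_spec`, then
`IsStrongSolution.unique_of_isStronglyProgressive`.) No local boundedness of `b(·,0), σ(·,0)` is
needed for this half.
Revuz–Yor, *Continuous Martingales and Brownian Motion* (1999), Ch. IX, Thm (2.1)
(uniqueness). [cite: RevuzYor1999, Ch. IX Thm (2.1)] -/
theorem IsStrongSolution.unique_of_lipschitz (hS2 : lintegral_iSup_itoIntegral_sub_sq_le)
    (hS4 : exists_itoIntegral_truncation_of_sq_integrable)
    {b σ : ℝ → ℝ → ℝ} {x₀ : ℝ} {K : ℝ≥0}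
    (hbm : Measurable (Function.uncurry b)) (hσm : Measurable (Function.uncurry σ))
    (hLip : ∀ t, LipschitzWith K (b t) ∧ LipschitzWith K (σ t))
    (hσbd : ∀ T : ℝ, ∃ C, ∀ t ∈ Set.Icc 0 T, |σ t 0| ≤ C)
    {X Y : ℝ≥0 → (ℝ≥0 → ℝ) → ℝ}
    (hX : IsStrongSolution b σ x₀ X Literature.Probability.Process.brownian Literature.Probability.RandomPlanarGeometry.brownianFiltration Literature.Probability.Process.preWienerMeasure)
    (hY : IsStrongSolution b σ x₀ Y Literature.Probability.Process.brownian Literature.Probability.RandomPlanarGeometry.brownianFiltration Literature.Probability.Process.preWienerMeasure) :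
    ∀ᵐ ω ∂Literature.Probability.Process.preWienerMeasure, ∀ t, X t ω = Y t ω := by
  obtain ⟨hX', hX'p, hXe⟩ := hX.dyadicReg_spec
  obtain ⟨hY', hY'p, hYe⟩ := hY.dyadicReg_spec
  filter_upwards [IsStrongSolution.unique_of_isStronglyProgressive hS2 hS4 hbm hσm hLip hσbd hX'p hY'p
    hX' hY', hXe, hYe] with ω h hx hy t
  rw [← hx t, ← hy t, h t]

end UniquenessCanonical

end Literature.Analysis.FunctionSpaces

namespace Literature.Analysis.FunctionSpaces

/-! ### Picard iteration (RY IX Thm (2.1), existence half): infrastructure -/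

section SupMeasurable

variable {Ω : Type*} {m : MeasurableSpace Ω} {P : Measure Ω}

/-- For a real process with measurable marginals and a.s. continuous paths, the functional
`ω ↦ sup_{s ≤ t} φ(Z_s(ω))` (`φ` continuous, e.g. `x ↦ x²` read in `ℝ≥0∞`) is a.e. measurable:
along a continuous path it is the supremum over the countably many rational times below `t`
and `t` itself. [folklore] -/
theorem aemeasurable_biSup_Iic {Z : ℝ≥0 → Ω → ℝ} {φ : ℝ → ℝ≥0∞} (hφ : Continuous φ)
    (hZ : ∀ s, Measurable (Z s)) (hc : ∀ᵐ ω ∂P, Continuous (Z · ω)) (t : ℝ≥0) :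
    AEMeasurable (fun ω ↦ ⨆ s ∈ Set.Iic t, φ (Z s ω)) P := by
  let g : Ω → ℝ≥0∞ := fun ω ↦
    (⨆ q : ℚ, if ((q : ℝ).toNNReal) ≤ t then φ (Z (q : ℝ).toNNReal ω) else ⊥) ⊔ φ (Z t ω)
  have hg : Measurable g := by
    refine Measurable.sup (Measurable.iSup fun q ↦ ?_) (hφ.measurable.comp (hZ t))
    by_cases h : ((q : ℝ).toNNReal) ≤ t
    · simp only [if_pos h]; exact hφ.measurable.comp (hZ _)
    · simp only [if_neg h]; exact measurable_const
  refine ⟨g, hg, ?_⟩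
  filter_upwards [hc] with ω hω
  apply le_antisymm
  · refine iSup₂_le fun s hs ↦ ?_
    rcases eq_or_lt_of_le (Set.mem_Iic.1 hs) with rfl | hlt
    · exact le_sup_right
    · refine le_of_forall_lt fun c hc' ↦ ?_
      have hopen : IsOpen ({r : ℝ≥0 | c < φ (Z r ω)} ∩ Set.Iio t) :=
        (isOpen_lt continuous_const (hφ.comp hω)).inter isOpen_Iio
      obtain ⟨q, hq1, hq2⟩ := denseRange_toNNReal_ratCast.exists_mem_open hopen ⟨s, hc', hlt⟩
      refine hq1.trans_le (le_sup_of_le_left (le_iSup_of_le q ?_))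
      rw [if_pos (le_of_lt hq2)]
  · refine sup_le (iSup_le fun q ↦ ?_) (le_iSup₂_of_le t (Set.mem_Iic.2 le_rfl) le_rfl)
    by_cases h : ((q : ℝ).toNNReal) ≤ t
    · rw [if_pos h]; exact le_iSup₂_of_le _ (Set.mem_Iic.2 h) le_rfl
    · rw [if_neg h]; exact bot_le

end SupMeasurable

section PicardStep

variable {b σ : ℝ → ℝ → ℝ} {K : ℝ≥0}

/-- Linear growth of a coefficient which is Lipschitz in `x` and bounded at `x = 0`. [folklore] -/
theorem abs_le_of_lipschitz {F : ℝ → ℝ → ℝ} {K : ℝ≥0} {t C : ℝ} (hL : LipschitzWith K (F t))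
    (hC : |F t 0| ≤ C) (x : ℝ) : |F t x| ≤ C + K * |x| := by
  have h := hL.dist_le_mul x 0
  rw [Real.dist_eq, Real.dist_eq, sub_zero] at h
  calc |F t x| = |F t 0 + (F t x - F t 0)| := by ring_nf
    _ ≤ |F t 0| + |F t x - F t 0| := abs_add_le _ _
    _ ≤ C + K * |x| := add_le_add hC h

variable {Ω : Type*} {m : MeasurableSpace Ω} {𝓕 : Filtration ℝ≥0 m} {P : Measure Ω}

/-- Along a continuous path, a jointly Borel coefficient which is Lipschitz in `x` uniformly in
`t` and locally bounded in `t` at `x = 0` is bounded on bounded time intervals; with joint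
measurability of the process this gives local integrability of all powers of
`s ↦ F(s, U_s(ω))` (the standing integrability of drift and diffusion coefficient along the
Picard iterates). [folklore] -/
theorem integrableOn_along_pow {F : ℝ → ℝ → ℝ} {K : ℝ≥0} (hFm : Measurable (Function.uncurry F))
    (hL : ∀ t, LipschitzWith K (F t)) (hbd : ∀ T : ℝ, ∃ C, ∀ t ∈ Set.Icc 0 T, |F t 0| ≤ C)
    {U : ℝ≥0 → Ω → ℝ} (hUm : Measurable (fun p : ℝ≥0 × Ω ↦ U p.1 p.2)) {ω : Ω}
    (hc : Continuous (U · ω)) (t : ℝ≥0) (n : ℕ) :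
    IntegrableOn (fun s : ℝ ↦ along F U s.toNNReal ω ^ n) (Set.Icc 0 t) := by
  obtain ⟨C, hC⟩ := hbd t
  -- bound of the continuous path on `[0, t]`
  obtain ⟨M, hM⟩ : ∃ M, ∀ r ∈ Set.Icc (0 : ℝ≥0) t, |U r ω| ≤ M := by
    have hK : IsCompact (Set.Icc (0 : ℝ≥0) t) := isCompact_Icc
    obtain ⟨M, hM⟩ :=
      (hK.image_of_continuousOn (continuous_abs.comp hc).continuousOn).isBounded.bddAbove
    exact ⟨M, fun r hr ↦ hM ⟨r, hr, rfl⟩⟩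
  have hmeas : Measurable (fun s : ℝ ↦ along F U s.toNNReal ω) := by
    have h1 : Measurable (fun s : ℝ ↦ U s.toNNReal ω) :=
      hUm.comp (measurable_real_toNNReal.prodMk measurable_const)
    exact hFm.comp ((measurable_coe_nnreal_real.comp measurable_real_toNNReal).prodMk h1)
  have hC0 : 0 ≤ C := (abs_nonneg _).trans (hC 0 ⟨le_rfl, t.coe_nonneg⟩)
  refine Measure.integrableOn_of_bounded (M := (C + K * |M|) ^ n) measure_Icc_lt_top.ne
    (hmeas.pow_const n).aestronglyMeasurable ?_
  rw [ae_restrict_iff' measurableSet_Icc]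
  refine ae_of_all _ fun s hs ↦ ?_
  rw [norm_pow, Real.norm_eq_abs]
  refine pow_le_pow_left₀ (abs_nonneg _) ?_ n
  have hs' : (s.toNNReal : ℝ) ∈ Set.Icc 0 (t : ℝ) :=
    ⟨NNReal.coe_nonneg _, by rw [Real.coe_toNNReal _ hs.1]; exact hs.2⟩
  have h1 := abs_le_of_lipschitz (hL _) (hC _ hs') (U s.toNNReal ω)
  have h2 : |U s.toNNReal ω| ≤ |M| :=
    (hM _ ⟨zero_le, Real.toNNReal_le_iff_le_coe.2 hs.2⟩).trans (le_abs_self M)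
  have h3 : (K : ℝ) * |U s.toNNReal ω| ≤ K * |M| := mul_le_mul_of_nonneg_left h2 K.coe_nonneg
  show |F (s.toNNReal : ℝ) (U s.toNNReal ω)| ≤ C + K * |M|
  linarith

end PicardStep

end Literature.Analysis.FunctionSpaces

namespace Literature.Analysis.FunctionSpaces

/-! ### Picard iteration: the scheme -/

section PicardScheme

/-- The hypotheses of `existsUnique_strongSolution_of_lipschitz` on the coefficients, bundled:
`b, σ` jointly Borel, Lipschitz in `x` with constant `K` uniformly in `t`, and locally bounded in
`t` at `x = 0` (Revuz–Yor's "f satisfies the Lipschitz condition and f(·, ȳ) is locally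
bounded"). Revuz–Yor, *Continuous Martingales and Brownian Motion* (1999), Ch. IX, §2
(hypotheses of Thm (2.1)). [cite: RevuzYor1999, Ch. IX §2 (hypotheses of Thm (2.1))] -/
structure LipschitzCoeffs (b σ : ℝ → ℝ → ℝ) (K : ℝ≥0) : Prop where
  /-- The drift is jointly Borel. -/
  measurable_b : Measurable (Function.uncurry b)
  /-- The diffusion coefficient is jointly Borel. -/
  measurable_σ : Measurable (Function.uncurry σ)
  /-- Both coefficients are `K`-Lipschitz in the state variable, for every time. -/
  lipschitz : ∀ t, LipschitzWith K (b t) ∧ LipschitzWith K (σ t)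
  /-- Both coefficients are locally bounded in time at the state `0`. -/
  bdd : ∀ T : ℝ, ∃ C, ∀ t ∈ Set.Icc 0 T, |b t 0| + |σ t 0| ≤ C

namespace LipschitzCoeffs

variable {b σ : ℝ → ℝ → ℝ} {K : ℝ≥0}

/-- Local bound of the drift at `0`. [folklore] -/
theorem bdd_b (h : LipschitzCoeffs b σ K) : ∀ T : ℝ, ∃ C, ∀ t ∈ Set.Icc 0 T, |b t 0| ≤ C :=
  fun T ↦ (h.bdd T).imp fun _ hC t ht ↦ ((le_add_of_nonneg_right (abs_nonneg _)).trans (hC t ht))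

/-- Local bound of the diffusion coefficient at `0`. [folklore] -/
theorem bdd_σ (h : LipschitzCoeffs b σ K) : ∀ T : ℝ, ∃ C, ∀ t ∈ Set.Icc 0 T, |σ t 0| ≤ C :=
  fun T ↦ (h.bdd T).imp fun _ hC t ht ↦ ((le_add_of_nonneg_left (abs_nonneg _)).trans (hC t ht))

end LipschitzCoeffs

variable {b σ : ℝ → ℝ → ℝ} {K : ℝ≥0} {x₀ : ℝ}

/-- The invariant of the Picard scheme on the canonical space: progressively measurable for the
raw Brownian filtration, with almost surely continuous paths, and in `L²(sup)` on every bounded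
interval (`E[sup_{s ≤ t} U_s²] < ∞`, so that `σ(s, U_s)` is a square-integrable integrand and
its Itô integral a true martingale). [folklore] -/
def PicardInv (U : ℝ≥0 → (ℝ≥0 → ℝ) → ℝ) : Prop :=
  IsStronglyProgressive Literature.Probability.RandomPlanarGeometry.brownianFiltration U ∧ (∀ᵐ ω ∂Literature.Probability.Process.preWienerMeasure, Continuous (U · ω)) ∧
    ∀ t : ℝ≥0, ∫⁻ ω, ⨆ s ∈ Set.Iic t, ENNReal.ofReal (U s ω ^ 2) ∂Literature.Probability.Process.preWienerMeasure < ∞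

/-- Constant processes satisfy the Picard invariant (`X⁰ ≡ x`). [folklore] -/
theorem picardInv_const (x : ℝ) : PicardInv (fun _ _ ↦ x) := by
  refine ⟨isStronglyProgressive_const _ x, ae_of_all _ fun _ ↦ continuous_const, fun t ↦ ?_⟩
  calc ∫⁻ ω, ⨆ s ∈ Set.Iic t, ENNReal.ofReal ((fun (_ : ℝ≥0) (_ : ℝ≥0 → ℝ) ↦ x) s ω ^ 2)
        ∂Literature.Probability.Process.preWienerMeasure
      ≤ ∫⁻ _, ENNReal.ofReal (x ^ 2) ∂Literature.Probability.Process.preWienerMeasure :=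
        lintegral_mono fun ω ↦ iSup₂_le fun s _ ↦ le_rfl
    _ < ∞ := by rw [lintegral_const]; exact ENNReal.mul_lt_top ENNReal.ofReal_lt_top (measure_lt_top _ _)

/-- **Linear growth makes `σ(s, U_s)` square integrable**: along a Picard-invariant process the
integrand `σ(s, U_s)` (jointly Borel `σ`, Lipschitz in `x`, locally bounded at `x = 0`) has
`E ∫₀ᵗ σ(s, U_s)² ds < ∞` for every `t` (`σ² ≤ 2C_t² + 2K² sup U²`). [folklore] -/
theorem PicardInv.lintegral_along_sq_lt_top {F : ℝ → ℝ → ℝ} {K : ℝ≥0}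
    (hL : ∀ t, LipschitzWith K (F t)) (hbd : ∀ T : ℝ, ∃ C, ∀ t ∈ Set.Icc 0 T, |F t 0| ≤ C)
    {U : ℝ≥0 → (ℝ≥0 → ℝ) → ℝ} (hU : PicardInv U) (t : ℝ≥0) :
    ∫⁻ ω, (∫⁻ s in Set.Icc (0 : ℝ) t, ENNReal.ofReal (along F U s.toNNReal ω ^ 2))
      ∂Literature.Probability.Process.preWienerMeasure < ∞ := by
  obtain ⟨C, hC⟩ := hbd t
  have hC0 : 0 ≤ C := (abs_nonneg _).trans (hC 0 ⟨le_rfl, t.2⟩)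
  -- pointwise bound by the running supremum
  have hpt : ∀ ω, ∫⁻ s in Set.Icc (0 : ℝ) t, ENNReal.ofReal (along F U s.toNNReal ω ^ 2) ≤
      (ENNReal.ofReal (2 * C ^ 2) + ENNReal.ofReal (2 * (K : ℝ) ^ 2) *
        ⨆ s ∈ Set.Iic t, ENNReal.ofReal (U s ω ^ 2)) * volume (Set.Icc (0 : ℝ) t) := by
    intro ω
    rw [← setLIntegral_const]
    refine setLIntegral_mono' measurableSet_Icc fun s hs ↦ ?_
    have hst : s.toNNReal ∈ Set.Iic t := Real.toNNReal_le_iff_le_coe.2 hs.2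
    have hsT : ((s.toNNReal : ℝ≥0) : ℝ) ∈ Set.Icc 0 (t : ℝ) :=
      ⟨NNReal.coe_nonneg _, by rw [Real.coe_toNNReal _ hs.1]; exact hs.2⟩
    have h1 := abs_le_of_lipschitz (hL _) (hC _ hsT) (U s.toNNReal ω)
    have h2 : along F U s.toNNReal ω ^ 2 ≤ 2 * C ^ 2 + 2 * (K : ℝ) ^ 2 * U s.toNNReal ω ^ 2 := by
      simp only [along]
      rw [← sq_abs, ← sq_abs (U s.toNNReal ω)]
      have hK : (0 : ℝ) ≤ K := K.2
      nlinarith [abs_nonneg (F (s.toNNReal) (U s.toNNReal ω)), abs_nonneg (U s.toNNReal ω),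
        sq_nonneg (C - K * |U s.toNNReal ω|)]
    calc ENNReal.ofReal (along F U s.toNNReal ω ^ 2)
        ≤ ENNReal.ofReal (2 * C ^ 2 + 2 * (K : ℝ) ^ 2 * U s.toNNReal ω ^ 2) := ENNReal.ofReal_le_ofReal h2
      _ = ENNReal.ofReal (2 * C ^ 2) + ENNReal.ofReal (2 * (K : ℝ) ^ 2) *
            ENNReal.ofReal (U s.toNNReal ω ^ 2) := by
          rw [ENNReal.ofReal_add (by positivity) (by positivity),
            ENNReal.ofReal_mul (p := 2 * (K : ℝ) ^ 2) (by positivity)]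
      _ ≤ _ := by
          gcongr
          exact le_iSup₂_of_le s.toNNReal hst le_rfl
  calc ∫⁻ ω, (∫⁻ s in Set.Icc (0 : ℝ) t, ENNReal.ofReal (along F U s.toNNReal ω ^ 2)) ∂Literature.Probability.Process.preWienerMeasure
      ≤ ∫⁻ ω, (ENNReal.ofReal (2 * C ^ 2) + ENNReal.ofReal (2 * (K : ℝ) ^ 2) *
          ⨆ s ∈ Set.Iic t, ENNReal.ofReal (U s ω ^ 2)) * volume (Set.Icc (0 : ℝ) t)
            ∂Literature.Probability.Process.preWienerMeasure := lintegral_mono hpt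
    _ = (ENNReal.ofReal (2 * C ^ 2) * Literature.Probability.Process.preWienerMeasure Set.univ + ENNReal.ofReal (2 * (K : ℝ) ^ 2) *
          ∫⁻ ω, ⨆ s ∈ Set.Iic t, ENNReal.ofReal (U s ω ^ 2) ∂Literature.Probability.Process.preWienerMeasure) *
            volume (Set.Icc (0 : ℝ) t) := by
        rw [lintegral_mul_const' _ _ measure_Icc_lt_top.ne, lintegral_add_left measurable_const,
          lintegral_const, lintegral_const_mul' _ _ ENNReal.ofReal_ne_top]
    _ < ∞ := by
        refine ENNReal.mul_lt_top (ENNReal.add_lt_top.2 ⟨?_, ?_⟩) measure_Icc_lt_top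
        · exact ENNReal.mul_lt_top ENNReal.ofReal_lt_top (measure_lt_top _ _)
        · exact ENNReal.mul_lt_top ENNReal.ofReal_lt_top (hU.2.2 t)

/-- Along a Picard iterate the diffusion coefficient admits an Itô integral which is a
square-integrable martingale (the `L²` existence theorem
`exists_isItoIntegral_of_sq_integrable`, i.e. fact S1 in its square-integrable form: the
integrand `σ(s, U_s)` is progressive with `E ∫₀ᵗ σ(s,U_s)² ds < ∞`). [folklore] -/
theorem PicardInv.exists_isItoIntegral (hc : LipschitzCoeffs b σ K)
    {U : ℝ≥0 → (ℝ≥0 → ℝ) → ℝ} (hU : PicardInv U) :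
    ∃ J, Literature.Probability.Process.IsItoIntegral (along σ U) Literature.Probability.Process.brownian J Literature.Probability.RandomPlanarGeometry.brownianFiltration Literature.Probability.Process.preWienerMeasure :=
  (Literature.Probability.Process.exists_isItoIntegral_of_sq_integrable (IsStronglyProgressive.comp_measurable₂ hU.1 hc.measurable_σ)
    fun t ↦ (hU.lintegral_along_sq_lt_top (fun t ↦ (hc.lipschitz t).2) hc.bdd_σ t).ne).imp
    fun _ h ↦ h.1

/-- The Itô integral `∫₀ σ(s, U_s) dB_s` used by the Picard step: the progressive version of an
integral chosen (classically) from fact S1. [folklore] -/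
def picardIto (hc : LipschitzCoeffs b σ K)
    {U : ℝ≥0 → (ℝ≥0 → ℝ) → ℝ} (hU : PicardInv U) : ℝ≥0 → (ℝ≥0 → ℝ) → ℝ :=
  progVersion (hU.exists_isItoIntegral hc).choose_spec.isLocalMartingale

/-- Specification of `picardIto`: an Itô integral of `σ(s, U_s)`, progressive, vanishing at `0`.
[folklore] -/
theorem picardIto_spec (hc : LipschitzCoeffs b σ K)
    {U : ℝ≥0 → (ℝ≥0 → ℝ) → ℝ} (hU : PicardInv U) :
    Literature.Probability.Process.IsItoIntegral (along σ U) Literature.Probability.Process.brownian (picardIto hc hU) Literature.Probability.RandomPlanarGeometry.brownianFiltration Literature.Probability.Process.preWienerMeasure ∧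
      IsStronglyProgressive Literature.Probability.RandomPlanarGeometry.brownianFiltration (picardIto hc hU) ∧
      ∀ ω, picardIto hc hU 0 ω = 0 :=
  ⟨(hU.exists_isItoIntegral hc).choose_spec.progVersion.1,
    isStronglyProgressive_progVersion _,
    progVersion_apply_zero _ (hU.exists_isItoIntegral hc).choose_spec.apply_zero⟩

/-- **One Picard step** `(S U)_t = x₀ + ∫₀ᵗ b(s, U_s) ds + ∫₀ᵗ σ(s, U_s) dB_s` on the canonical
space (the map `S` of the proof of RY IX (2.1), for `Z = (B, t)`).
Revuz–Yor, *Continuous Martingales and Brownian Motion* (1999), Ch. IX, proof of Thm (2.1).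
[folklore] -/
def picardStep (hc : LipschitzCoeffs b σ K) (x₀ : ℝ)
    {U : ℝ≥0 → (ℝ≥0 → ℝ) → ℝ} (hU : PicardInv U) : ℝ≥0 → (ℝ≥0 → ℝ) → ℝ :=
  fun t ω ↦ x₀ + timeIntegral (along b U) t ω + picardIto hc hU t ω

/-- The Picard step starts at `x₀`. [folklore] -/
theorem picardStep_apply_zero (hc : LipschitzCoeffs b σ K) (x₀ : ℝ)
    {U : ℝ≥0 → (ℝ≥0 → ℝ) → ℝ} (hU : PicardInv U) (ω : ℝ≥0 → ℝ) :
    picardStep hc x₀ hU 0 ω = x₀ := by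
  simp [picardStep, (picardIto_spec hc hU).2.2 ω]

end PicardScheme

end Literature.Analysis.FunctionSpaces

namespace Literature.Analysis.FunctionSpaces

section PicardEstimates

variable {b σ : ℝ → ℝ → ℝ} {K : ℝ≥0} {x₀ : ℝ}

/-- Measurability of the marginals of a Picard-invariant process. [folklore] -/
theorem PicardInv.measurable {U : ℝ≥0 → (ℝ≥0 → ℝ) → ℝ} (hU : PicardInv U) (s : ℝ≥0) :
    Measurable (U s) :=
  (IsStronglyProgressive.measurable_uncurry hU.1).comp (measurable_const.prodMk measurable_id)

/-- **The contraction estimate of the Picard step** (RY IX (2.1):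
`Φ_t(SU, SV) ≤ 2K²(4+T) E∫₀ᵗ |U_r - V_r|² dr ≤ 2K²(4+T) ∫₀ᵗ Φ_r(U,V) dr`), in the form
`E[sup_{s≤t} (SU_s - SV_s)²] ≤ (2TK² + 8K²) E∫₀ᵗ (U_r - V_r)² dr` for `t ≤ T`, from the pathwise
Cauchy–Schwarz step and the Doob–Itô bound S2 for `∫ (σ(U) - σ(V)) dB`.
Revuz–Yor, *Continuous Martingales and Brownian Motion* (1999), Ch. IX, proof of Thm (2.1).
[folklore] -/
theorem lintegral_iSup_picardStep_sub_sq_le (hS2 : lintegral_iSup_itoIntegral_sub_sq_le) (hc : LipschitzCoeffs b σ K) (x₀ : ℝ)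
    {U V : ℝ≥0 → (ℝ≥0 → ℝ) → ℝ} (hU : PicardInv U) (hV : PicardInv V) (T : ℝ≥0) :
    ∀ t ≤ T, ∫⁻ ω, ⨆ s ∈ Set.Iic t, ENNReal.ofReal
        ((picardStep hc x₀ hU s ω - picardStep hc x₀ hV s ω) ^ 2) ∂Literature.Probability.Process.preWienerMeasure ≤
      (ENNReal.ofReal (2 * T * (K : ℝ) ^ 2) + 8 * ENNReal.ofReal ((K : ℝ) ^ 2)) *
        ∫⁻ ω, (∫⁻ r in Set.Icc (0 : ℝ) t, ENNReal.ofReal ((U r.toNNReal ω - V r.toNNReal ω) ^ 2))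
          ∂Literature.Probability.Process.preWienerMeasure := by
  obtain ⟨hJU, hJUp, hJU0⟩ := picardIto_spec hc hU
  obtain ⟨hJV, hJVp, hJV0⟩ := picardIto_spec hc hV
  have hUm := IsStronglyProgressive.measurable_uncurry hU.1
  have hVm := IsStronglyProgressive.measurable_uncurry hV.1
  have hEm : Measurable (fun p : ℝ≥0 × (ℝ≥0 → ℝ) ↦ (fun s ω ↦ U s ω - V s ω) p.1 p.2) :=
    hUm.sub hVm
  have hgm : Measurable (fun p : ℝ≥0 × (ℝ≥0 → ℝ) ↦ (fun s ω ↦ along b U s ω - along b V s ω) p.1 p.2) :=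
    IsStronglyProgressive.measurable_uncurry ((IsStronglyProgressive.comp_measurable₂ hU.1
      hc.measurable_b).sub (IsStronglyProgressive.comp_measurable₂ hV.1 hc.measurable_b))
  -- Doob–Itô bound (S2)
  have hDoob := hS2 (IsStronglyProgressive.comp_measurable₂ hU.1 hc.measurable_σ)
    (IsStronglyProgressive.comp_measurable₂ hV.1 hc.measurable_σ) hJU hJV
  -- Lipschitz bounds
  have hLip : ∀ (F : ℝ → ℝ → ℝ), (∀ t, LipschitzWith K (F t)) → ∀ r ω,
      (along F U r ω - along F V r ω) ^ 2 ≤ (K : ℝ) ^ 2 * (U r ω - V r ω) ^ 2 := by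
    intro F hF r ω
    have h := (hF r).dist_le_mul (U r ω) (V r ω)
    rw [Real.dist_eq, Real.dist_eq] at h
    calc (along F U r ω - along F V r ω) ^ 2 = |F r (U r ω) - F r (V r ω)| ^ 2 := (sq_abs _).symm
      _ ≤ (K * |U r ω - V r ω|) ^ 2 := pow_le_pow_left₀ (abs_nonneg _) h 2
      _ = (K : ℝ) ^ 2 * (U r ω - V r ω) ^ 2 := by rw [mul_pow, sq_abs]
  -- pathwise step
  have hpath : ∀ᵐ ω ∂Literature.Probability.Process.preWienerMeasure, ∀ t : ℝ≥0, ⨆ s ∈ Set.Iic t, ENNReal.ofReal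
      ((picardStep hc x₀ hU s ω - picardStep hc x₀ hV s ω) ^ 2) ≤
      ENNReal.ofReal (2 * t * (K : ℝ) ^ 2) *
          (∫⁻ r in Set.Icc (0 : ℝ) t, ENNReal.ofReal
            ((fun s ω ↦ U s ω - V s ω) r.toNNReal ω ^ 2)) +
        2 * ⨆ s ∈ Set.Iic t, ENNReal.ofReal
          ((picardIto hc hU s ω - picardIto hc hV s ω) ^ 2) := by
    filter_upwards [hU.2.1, hV.2.1] with ω hUc hVc t
    -- bound of the continuous path `U - V` on `[0, t]`
    obtain ⟨M, hM⟩ : ∃ M, ∀ s ≤ t, |U s ω - V s ω| ≤ M := by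
      have hK : IsCompact (Set.Icc (0 : ℝ≥0) t) := isCompact_Icc
      obtain ⟨M, hM⟩ := (hK.image_of_continuousOn
        (continuous_abs.comp (hUc.sub hVc)).continuousOn).isBounded.bddAbove
      exact ⟨M, fun s hs ↦ hM ⟨s, ⟨zero_le, hs⟩, rfl⟩⟩
    have hintU : ∀ u : ℝ≥0, IntegrableOn (fun r : ℝ ↦ along b U r.toNNReal ω) (Set.Icc 0 u) := by
      intro u
      simpa using integrableOn_along_pow hc.measurable_b (fun t ↦ (hc.lipschitz t).1) hc.bdd_b
                    hUm hUc u 1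
    have hintV : ∀ u : ℝ≥0, IntegrableOn (fun r : ℝ ↦ along b V r.toNNReal ω) (Set.Icc 0 u) := by
      intro u
      simpa using integrableOn_along_pow hc.measurable_b (fun t ↦ (hc.lipschitz t).1) hc.bdd_b
                    hVm hVc u 1
    refine iSup_sq_le_of_integral_repr (K := (K : ℝ)) (M := M)
      (d := fun s ↦ picardStep hc x₀ hU s ω - picardStep hc x₀ hV s ω)
      (e := fun s ↦ U s ω - V s ω)
      (j := fun s ↦ picardIto hc hU s ω - picardIto hc hV s ω)
      (g := fun s ↦ along b U s ω - along b V s ω) K.coe_nonneg t (fun s ↦ ?_)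
      (fun r ↦ hLip b (fun t ↦ (hc.lipschitz t).1) r ω) hM ?_ ?_
    · simp only [picardStep, timeIntegral]
      rw [intervalIntegral.integral_sub]
      · ring
      · exact (intervalIntegrable_iff_integrableOn_Ioc_of_le s.coe_nonneg).2
          ((hintU s).mono_set Set.Ioc_subset_Icc_self)
      · exact (intervalIntegrable_iff_integrableOn_Ioc_of_le s.coe_nonneg).2
          ((hintV s).mono_set Set.Ioc_subset_Icc_self)
    · exact hgm.comp (measurable_real_toNNReal.prodMk measurable_const)
    · exact hEm.comp (measurable_real_toNNReal.prodMk measurable_const)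
  exact lintegral_iSup_sq_le_of_bounds (P := Literature.Probability.Process.preWienerMeasure) (K := (K : ℝ)) (T := T)
    (D := fun s ω ↦ picardStep hc x₀ hU s ω - picardStep hc x₀ hV s ω)
    (E := fun s ω ↦ U s ω - V s ω)
    (Jd := fun s ω ↦ picardIto hc hU s ω - picardIto hc hV s ω)
    (Hd := fun s ω ↦ along σ U s ω - along σ V s ω) hEm hpath hDoob
    (ae_of_all _ fun ω r ↦ hLip σ (fun t ↦ (hc.lipschitz t).2) r ω)

end PicardEstimates

end Literature.Analysis.FunctionSpaces

namespace Literature.Analysis.FunctionSpaces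

section PicardStepBound

variable {b σ : ℝ → ℝ → ℝ} {K : ℝ≥0} {x₀ : ℝ}

/-- An Itô integral of the zero integrand exists (the square-integrable existence theorem) and
vanishes (T4); used to bound `E[sup (J⁰)²]` through the difference form of S2. [folklore] -/
theorem exists_isItoIntegral_zero :
    ∃ Jz, Literature.Probability.Process.IsItoIntegral (fun _ _ ↦ (0 : ℝ)) Literature.Probability.Process.brownian Jz Literature.Probability.RandomPlanarGeometry.brownianFiltration Literature.Probability.Process.preWienerMeasure ∧
      ∀ᵐ ω ∂Literature.Probability.Process.preWienerMeasure, ∀ t, Jz t ω = 0 := by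
  obtain ⟨Jz, hJz, -⟩ := Literature.Probability.Process.exists_isItoIntegral_of_sq_integrable
    (isStronglyProgressive_const _ (0 : ℝ)) fun t ↦ by simp
  exact ⟨Jz, hJz, Literature.Probability.Process.IsItoIntegral.ae_forall_eq_zero_of_integrand hJz⟩

/-- **Finiteness of `Φ_T(x₀, S x₀)`** ("using the properties of f it is easy to check that
`D = Φ_T(X⁰, X¹)` is finite", RY IX (2.1)): `S x₀ - x₀ = ∫₀ b(s,x₀) ds + ∫₀ σ(s,x₀) dB` with
bounded integrands on `[0, T]`; the drift part is bounded by `T(C + K|x₀|)` and the martingale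
part is controlled by S2 (against the zero integrand).
Revuz–Yor, *Continuous Martingales and Brownian Motion* (1999), Ch. IX, proof of Thm (2.1).
[folklore] -/
theorem lintegral_iSup_const_sub_picardStep_sq_lt_top (hS2 : lintegral_iSup_itoIntegral_sub_sq_le) (hc : LipschitzCoeffs b σ K) (x₀ : ℝ)
    (T : ℝ≥0) :
    ∫⁻ ω, ⨆ s ∈ Set.Iic T, ENNReal.ofReal
      ((x₀ - picardStep hc x₀ (picardInv_const x₀) s ω) ^ 2) ∂Literature.Probability.Process.preWienerMeasure < ∞ := by
  obtain ⟨Cb, hCb⟩ := hc.bdd_b T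
  obtain ⟨Cs, hCs⟩ := hc.bdd_σ T
  set Mb : ℝ := Cb + K * |x₀| with hMb
  set Ms : ℝ := Cs + K * |x₀| with hMs
  have hU : PicardInv (fun (_ : ℝ≥0) (_ : ℝ≥0 → ℝ) ↦ x₀) := picardInv_const x₀
  obtain ⟨hJ, hJp, hJ0⟩ := picardIto_spec hc hU
  obtain ⟨Jz, hJz, hJz0⟩ := exists_isItoIntegral_zero
  -- S2 against the zero integrand
  have hDoob := hS2 (IsStronglyProgressive.comp_measurable₂ hU.1 hc.measurable_σ)
    (isStronglyProgressive_const _ (0 : ℝ)) hJ hJz T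
  -- pointwise bound of the drift part
  have hdrift : ∀ (ω : ℝ≥0 → ℝ), ∀ s ∈ Set.Iic T,
      |timeIntegral (along b (fun (_ : ℝ≥0) (_ : ℝ≥0 → ℝ) ↦ x₀)) s ω| ≤ T * Mb := by
    intro ω s hs
    have h1 : ∀ x ∈ Set.uIoc (0 : ℝ) s, ‖along b (fun (_ : ℝ≥0) (_ : ℝ≥0 → ℝ) ↦ x₀) x.toNNReal ω‖ ≤ Mb := by
      intro x hx
      rw [Set.uIoc_of_le s.coe_nonneg] at hx
      rw [Real.norm_eq_abs]
      have hxT : (x.toNNReal : ℝ) ∈ Set.Icc 0 (T : ℝ) :=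
        ⟨NNReal.coe_nonneg _, by
          rw [Real.coe_toNNReal _ hx.1.le]; exact hx.2.trans (NNReal.coe_le_coe.2 hs)⟩
      exact abs_le_of_lipschitz (hc.lipschitz _).1 (hCb _ hxT) x₀
    have h2 := intervalIntegral.norm_integral_le_of_norm_le_const h1
    rw [Real.norm_eq_abs, sub_zero, abs_of_nonneg s.coe_nonneg] at h2
    refine h2.trans ?_
    rw [mul_comm]
    exact mul_le_mul_of_nonneg_right (NNReal.coe_le_coe.2 hs)
      ((abs_nonneg _).trans (abs_le_of_lipschitz (hc.lipschitz 0).1 (hCb 0 ⟨le_rfl, T.coe_nonneg⟩) x₀))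
  -- pointwise bound of the supremum
  have hpt : ∀ᵐ ω ∂Literature.Probability.Process.preWienerMeasure, ⨆ s ∈ Set.Iic T, ENNReal.ofReal
      ((x₀ - picardStep hc x₀ hU s ω) ^ 2) ≤
      2 * ENNReal.ofReal ((T * Mb) ^ 2) + 2 * ⨆ s ∈ Set.Iic T, ENNReal.ofReal
        ((picardIto hc hU s ω - Jz s ω) ^ 2) := by
    filter_upwards [hJz0] with ω hz
    refine iSup₂_le fun s hs ↦ ?_
    have hd := hdrift ω s hs
    have heq : x₀ - picardStep hc x₀ hU s ω =
        -(timeIntegral (along b (fun (_ : ℝ≥0) (_ : ℝ≥0 → ℝ) ↦ x₀)) s ω + (picardIto hc hU s ω - Jz s ω)) := by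
      simp only [picardStep, hz s]
      ring
    rw [heq, neg_sq]
    have hA : (timeIntegral (along b (fun (_ : ℝ≥0) (_ : ℝ≥0 → ℝ) ↦ x₀)) s ω) ^ 2 ≤ (T * Mb) ^ 2 := by
      rw [← sq_abs]; exact pow_le_pow_left₀ (abs_nonneg _) hd 2
    calc ENNReal.ofReal ((timeIntegral (along b (fun (_ : ℝ≥0) (_ : ℝ≥0 → ℝ) ↦ x₀)) s ω +
          (picardIto hc hU s ω - Jz s ω)) ^ 2)
        ≤ ENNReal.ofReal (2 * (T * Mb) ^ 2 + 2 * (picardIto hc hU s ω - Jz s ω) ^ 2) := by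
          refine ENNReal.ofReal_le_ofReal ?_
          nlinarith [sq_nonneg (timeIntegral (along b (fun (_ : ℝ≥0) (_ : ℝ≥0 → ℝ) ↦ x₀)) s ω -
            (picardIto hc hU s ω - Jz s ω))]
      _ = 2 * ENNReal.ofReal ((T * Mb) ^ 2) +
            2 * ENNReal.ofReal ((picardIto hc hU s ω - Jz s ω) ^ 2) := by
          rw [ENNReal.ofReal_add (by positivity) (by positivity),
            ENNReal.ofReal_mul (by norm_num : (0 : ℝ) ≤ 2),
            ENNReal.ofReal_mul (by norm_num : (0 : ℝ) ≤ 2), ENNReal.ofReal_ofNat]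
      _ ≤ _ := by
          gcongr
          exact le_iSup₂_of_le s hs le_rfl
  -- bound of the martingale part via S2
  have hσbd : ∫⁻ ω, (∫⁻ r in Set.Icc (0 : ℝ) T, ENNReal.ofReal
      ((along σ (fun (_ : ℝ≥0) (_ : ℝ≥0 → ℝ) ↦ x₀) r.toNNReal ω - (fun _ _ ↦ (0 : ℝ)) r.toNNReal ω) ^ 2))
        ∂Literature.Probability.Process.preWienerMeasure ≤ ENNReal.ofReal (Ms ^ 2) * volume (Set.Icc (0 : ℝ) T) * Literature.Probability.Process.preWienerMeasure Set.univ := by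
    calc _ ≤ ∫⁻ _, ENNReal.ofReal (Ms ^ 2) * volume (Set.Icc (0 : ℝ) T) ∂Literature.Probability.Process.preWienerMeasure := by
          refine lintegral_mono fun ω ↦ ?_
          rw [← setLIntegral_const]
          refine setLIntegral_mono' measurableSet_Icc fun r hr ↦ ENNReal.ofReal_le_ofReal ?_
          simp only [along, sub_zero]
          have hrT : (r.toNNReal : ℝ) ∈ Set.Icc 0 (T : ℝ) :=
            ⟨NNReal.coe_nonneg _, by rw [Real.coe_toNNReal _ hr.1]; exact hr.2⟩
          have h := abs_le_of_lipschitz (hc.lipschitz _).2 (hCs _ hrT) x₀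
          rw [← sq_abs]
          exact pow_le_pow_left₀ (abs_nonneg _) h 2
      _ = _ := lintegral_const _
  calc ∫⁻ ω, ⨆ s ∈ Set.Iic T, ENNReal.ofReal ((x₀ - picardStep hc x₀ hU s ω) ^ 2) ∂Literature.Probability.Process.preWienerMeasure
      ≤ ∫⁻ ω, (2 * ENNReal.ofReal ((T * Mb) ^ 2) + 2 * ⨆ s ∈ Set.Iic T, ENNReal.ofReal
          ((picardIto hc hU s ω - Jz s ω) ^ 2)) ∂Literature.Probability.Process.preWienerMeasure := lintegral_mono_ae hpt
    _ = 2 * ENNReal.ofReal ((T * Mb) ^ 2) * Literature.Probability.Process.preWienerMeasure Set.univ +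
          2 * ∫⁻ ω, ⨆ s ∈ Set.Iic T, ENNReal.ofReal
            ((picardIto hc hU s ω - Jz s ω) ^ 2) ∂Literature.Probability.Process.preWienerMeasure := by
        rw [lintegral_add_left measurable_const, lintegral_const,
          lintegral_const_mul' _ _ (by norm_num)]
    _ < ∞ := by
        refine ENNReal.add_lt_top.2 ⟨ENNReal.mul_lt_top (ENNReal.mul_lt_top (by norm_num)
          ENNReal.ofReal_lt_top) (measure_lt_top _ _), ENNReal.mul_lt_top (by norm_num) ?_⟩
        refine lt_of_le_of_lt (hDoob.trans (mul_le_mul_right hσbd 4)) ?_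
        refine ENNReal.mul_lt_top (by norm_num) (ENNReal.mul_lt_top (ENNReal.mul_lt_top
          ENNReal.ofReal_lt_top measure_Icc_lt_top) (measure_lt_top _ _))


/-- The Picard step of an invariant process is progressive (T1/T2). [folklore] -/
theorem isStronglyProgressive_picardStep (hc : LipschitzCoeffs b σ K) (x₀ : ℝ)
    {U : ℝ≥0 → (ℝ≥0 → ℝ) → ℝ} (hU : PicardInv U) :
    IsStronglyProgressive Literature.Probability.RandomPlanarGeometry.brownianFiltration (picardStep hc x₀ hU) :=
  ((isStronglyProgressive_const _ x₀).add (isStronglyProgressive_timeIntegral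
    (IsStronglyProgressive.comp_measurable₂ hU.1 hc.measurable_b))).add (picardIto_spec hc hU).2.1

/-- The Picard step of an invariant process has a.s. continuous paths. [folklore] -/
theorem ae_continuous_picardStep (hc : LipschitzCoeffs b σ K) (x₀ : ℝ)
    {U : ℝ≥0 → (ℝ≥0 → ℝ) → ℝ} (hU : PicardInv U) :
    ∀ᵐ ω ∂Literature.Probability.Process.preWienerMeasure, Continuous (picardStep hc x₀ hU · ω) := by
  obtain ⟨hJ, hJp, -⟩ := picardIto_spec hc hU
  filter_upwards [hU.2.1, hJ.continuous] with ω hω hJc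
  refine (continuous_const.add (continuous_timeIntegral fun t ↦ ?_)).add hJc
  simpa using integrableOn_along_pow hc.measurable_b (fun t ↦ (hc.lipschitz t).1) hc.bdd_b
    (IsStronglyProgressive.measurable_uncurry hU.1) hω t 1

/-- Measurability of the marginals of a Picard step. [folklore] -/
theorem measurable_picardStep (hc : LipschitzCoeffs b σ K) (x₀ : ℝ)
    {U : ℝ≥0 → (ℝ≥0 → ℝ) → ℝ} (hU : PicardInv U) (s : ℝ≥0) : Measurable (picardStep hc x₀ hU s) :=
  (IsStronglyProgressive.measurable_uncurry (isStronglyProgressive_picardStep hc x₀ hU)).comp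
    (measurable_const.prodMk measurable_id)

/-- A.e. measurability of `sup_{s ≤ t} (SU_s - SV_s)²`. [folklore] -/
theorem aemeasurable_biSup_picardStep_sub (hc : LipschitzCoeffs b σ K) (x₀ : ℝ)
    {U V : ℝ≥0 → (ℝ≥0 → ℝ) → ℝ} (hU : PicardInv U) (hV : PicardInv V) (t : ℝ≥0) :
    AEMeasurable (fun ω ↦ ⨆ s ∈ Set.Iic t, ENNReal.ofReal
      ((picardStep hc x₀ hU s ω - picardStep hc x₀ hV s ω) ^ 2)) Literature.Probability.Process.preWienerMeasure := by
  refine aemeasurable_biSup_Iic (Z := fun s ω ↦ picardStep hc x₀ hU s ω - picardStep hc x₀ hV s ω)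
    (φ := fun x ↦ ENNReal.ofReal (x ^ 2)) (ENNReal.continuous_ofReal.comp (continuous_pow 2))
    (fun s ↦ (measurable_picardStep hc x₀ hU s).sub (measurable_picardStep hc x₀ hV s)) ?_ _
  filter_upwards [ae_continuous_picardStep hc x₀ hU, ae_continuous_picardStep hc x₀ hV] with ω h1 h2
  exact h1.sub h2

/-- **The Picard step preserves the invariant**: progressivity from T1/T2, a.s. continuity of
the time integral along a.s. continuous paths and of the Itô integral, and the `L²(sup)` bound
`E[sup_{s≤t} (SU)_s²] ≤ 3x₀² + 3Φ_t(SU, Sx₀) + 3Φ_t(Sx₀, x₀) < ∞` (contraction estimate against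
the constant process and `lintegral_iSup_const_sub_picardStep_sq_lt_top`). [folklore] -/
theorem picardInv_picardStep (hS2 : lintegral_iSup_itoIntegral_sub_sq_le) (hc : LipschitzCoeffs b σ K) (x₀ : ℝ)
    {U : ℝ≥0 → (ℝ≥0 → ℝ) → ℝ} (hU : PicardInv U) : PicardInv (picardStep hc x₀ hU) := by
  refine ⟨isStronglyProgressive_picardStep hc x₀ hU, ae_continuous_picardStep hc x₀ hU, fun t ↦ ?_⟩
  -- `SU = x₀ + (SU - Sx₀) + (Sx₀ - x₀)`
  have hV : PicardInv (fun (_ : ℝ≥0) (_ : ℝ≥0 → ℝ) ↦ x₀) := picardInv_const x₀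
  have h1 := lintegral_iSup_picardStep_sub_sq_le hS2 hc x₀ hU hV t t le_rfl
  have h2 := lintegral_iSup_const_sub_picardStep_sq_lt_top hS2 hc x₀ t
  -- pointwise decomposition
  have hpt : ∀ ω, ⨆ s ∈ Set.Iic t, ENNReal.ofReal (picardStep hc x₀ hU s ω ^ 2) ≤
      3 * ENNReal.ofReal (x₀ ^ 2) +
      3 * (⨆ s ∈ Set.Iic t, ENNReal.ofReal ((picardStep hc x₀ hU s ω - picardStep hc x₀ hV s ω) ^ 2)) +
      3 * ⨆ s ∈ Set.Iic t, ENNReal.ofReal ((x₀ - picardStep hc x₀ hV s ω) ^ 2) := by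
    intro ω
    refine iSup₂_le fun s hs ↦ ?_
    set p := picardStep hc x₀ hU s ω
    set q := picardStep hc x₀ hV s ω
    have hle : p ^ 2 ≤ 3 * x₀ ^ 2 + 3 * (p - q) ^ 2 + 3 * (x₀ - q) ^ 2 := by
      nlinarith [sq_nonneg (x₀ - (p - q)), sq_nonneg (x₀ + (x₀ - q)), sq_nonneg ((p - q) + (x₀ - q))]
    calc ENNReal.ofReal (p ^ 2) ≤ ENNReal.ofReal (3 * x₀ ^ 2 + 3 * (p - q) ^ 2 + 3 * (x₀ - q) ^ 2) :=
          ENNReal.ofReal_le_ofReal hle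
      _ = 3 * ENNReal.ofReal (x₀ ^ 2) + 3 * ENNReal.ofReal ((p - q) ^ 2) +
            3 * ENNReal.ofReal ((x₀ - q) ^ 2) := by
          rw [ENNReal.ofReal_add (by positivity) (by positivity),
            ENNReal.ofReal_add (by positivity) (by positivity),
            ENNReal.ofReal_mul (by norm_num), ENNReal.ofReal_mul (by norm_num),
            ENNReal.ofReal_mul (by norm_num), ENNReal.ofReal_ofNat]
      _ ≤ _ := by
          gcongr
          · exact le_iSup₂_of_le s hs le_rfl
          · exact le_iSup₂_of_le s hs le_rfl
  -- the contraction bound is finite: `∫∫ (U - x₀)² ≤ vol · E sup (2U² + 2x₀²)`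
  have h1' : ∫⁻ ω, ⨆ s ∈ Set.Iic t, ENNReal.ofReal
      ((picardStep hc x₀ hU s ω - picardStep hc x₀ hV s ω) ^ 2) ∂Literature.Probability.Process.preWienerMeasure < ∞ := by
    refine lt_of_le_of_lt h1 (ENNReal.mul_lt_top ?_ ?_)
    · exact ENNReal.add_lt_top.2 ⟨ENNReal.ofReal_lt_top,
        ENNReal.mul_lt_top (by norm_num) ENNReal.ofReal_lt_top⟩
    have hin : ∀ ω, ∫⁻ r in Set.Icc (0 : ℝ) t, ENNReal.ofReal
        ((U r.toNNReal ω - (fun (_ : ℝ≥0) (_ : ℝ≥0 → ℝ) ↦ x₀) r.toNNReal ω) ^ 2) ≤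
        (2 * ENNReal.ofReal (x₀ ^ 2) + 2 * ⨆ s ∈ Set.Iic t, ENNReal.ofReal (U s ω ^ 2)) *
          volume (Set.Icc (0 : ℝ) t) := by
      intro ω
      rw [← setLIntegral_const]
      refine setLIntegral_mono' measurableSet_Icc fun r hr ↦ ?_
      have hrt : r.toNNReal ∈ Set.Iic t := Real.toNNReal_le_iff_le_coe.2 hr.2
      have hle : (U r.toNNReal ω - x₀) ^ 2 ≤ 2 * x₀ ^ 2 + 2 * U r.toNNReal ω ^ 2 := by
        nlinarith [sq_nonneg (U r.toNNReal ω + x₀)]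
      calc ENNReal.ofReal ((U r.toNNReal ω - x₀) ^ 2)
          ≤ ENNReal.ofReal (2 * x₀ ^ 2 + 2 * U r.toNNReal ω ^ 2) := ENNReal.ofReal_le_ofReal hle
        _ = 2 * ENNReal.ofReal (x₀ ^ 2) + 2 * ENNReal.ofReal (U r.toNNReal ω ^ 2) := by
            rw [ENNReal.ofReal_add (by positivity) (by positivity), ENNReal.ofReal_mul (by norm_num),
              ENNReal.ofReal_mul (by norm_num), ENNReal.ofReal_ofNat]
        _ ≤ _ := by
            gcongr
            exact le_iSup₂_of_le r.toNNReal hrt le_rfl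
    calc ∫⁻ ω, (∫⁻ r in Set.Icc (0 : ℝ) t, ENNReal.ofReal
          ((U r.toNNReal ω - (fun (_ : ℝ≥0) (_ : ℝ≥0 → ℝ) ↦ x₀) r.toNNReal ω) ^ 2)) ∂Literature.Probability.Process.preWienerMeasure
        ≤ ∫⁻ ω, (2 * ENNReal.ofReal (x₀ ^ 2) + 2 * ⨆ s ∈ Set.Iic t, ENNReal.ofReal (U s ω ^ 2)) *
            volume (Set.Icc (0 : ℝ) t) ∂Literature.Probability.Process.preWienerMeasure := lintegral_mono hin
      _ = (2 * ENNReal.ofReal (x₀ ^ 2) * Literature.Probability.Process.preWienerMeasure Set.univ +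
            2 * ∫⁻ ω, ⨆ s ∈ Set.Iic t, ENNReal.ofReal (U s ω ^ 2) ∂Literature.Probability.Process.preWienerMeasure) *
              volume (Set.Icc (0 : ℝ) t) := by
          rw [lintegral_mul_const' _ _ measure_Icc_lt_top.ne, lintegral_add_left measurable_const,
            lintegral_const, lintegral_const_mul' _ _ (by norm_num)]
      _ < ∞ := by
          refine ENNReal.mul_lt_top (ENNReal.add_lt_top.2 ⟨?_, ?_⟩) measure_Icc_lt_top
          · exact ENNReal.mul_lt_top (ENNReal.mul_lt_top (by norm_num) ENNReal.ofReal_lt_top)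
              (measure_lt_top _ _)
          · exact ENNReal.mul_lt_top (by norm_num) (hU.2.2 t)
  have hm : AEMeasurable (fun ω ↦ 3 * ENNReal.ofReal (x₀ ^ 2) +
      3 * ⨆ s ∈ Set.Iic t, ENNReal.ofReal ((picardStep hc x₀ hU s ω - picardStep hc x₀ hV s ω) ^ 2))
      Literature.Probability.Process.preWienerMeasure :=
    aemeasurable_const.add ((aemeasurable_biSup_picardStep_sub hc x₀ hU hV t).const_mul _)
  calc ∫⁻ ω, ⨆ s ∈ Set.Iic t, ENNReal.ofReal (picardStep hc x₀ hU s ω ^ 2) ∂Literature.Probability.Process.preWienerMeasure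
      ≤ ∫⁻ ω, (3 * ENNReal.ofReal (x₀ ^ 2) +
          3 * (⨆ s ∈ Set.Iic t, ENNReal.ofReal ((picardStep hc x₀ hU s ω - picardStep hc x₀ hV s ω) ^ 2)) +
          3 * ⨆ s ∈ Set.Iic t, ENNReal.ofReal ((x₀ - picardStep hc x₀ hV s ω) ^ 2)) ∂Literature.Probability.Process.preWienerMeasure :=
        lintegral_mono hpt
    _ = 3 * ENNReal.ofReal (x₀ ^ 2) * Literature.Probability.Process.preWienerMeasure Set.univ +
          3 * ∫⁻ ω, ⨆ s ∈ Set.Iic t, ENNReal.ofReal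
            ((picardStep hc x₀ hU s ω - picardStep hc x₀ hV s ω) ^ 2) ∂Literature.Probability.Process.preWienerMeasure +
          3 * ∫⁻ ω, ⨆ s ∈ Set.Iic t, ENNReal.ofReal ((x₀ - picardStep hc x₀ hV s ω) ^ 2)
            ∂Literature.Probability.Process.preWienerMeasure := by
        rw [lintegral_add_left' hm, lintegral_add_left measurable_const, lintegral_const,
          lintegral_const_mul' _ _ (by norm_num), lintegral_const_mul' _ _ (by norm_num)]
    _ < ∞ := by
        refine ENNReal.add_lt_top.2 ⟨ENNReal.add_lt_top.2 ⟨?_, ?_⟩, ?_⟩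
        · exact ENNReal.mul_lt_top (ENNReal.mul_lt_top (by norm_num) ENNReal.ofReal_lt_top)
            (measure_lt_top _ _)
        · exact ENNReal.mul_lt_top (by norm_num) h1'
        · exact ENNReal.mul_lt_top (by norm_num) h2

/-- **The Picard sequence** `X⁰ ≡ x₀`, `Xⁿ⁺¹ = S Xⁿ`, carried with the proof of its invariant.
Revuz–Yor, *Continuous Martingales and Brownian Motion* (1999), Ch. IX, proof of Thm (2.1).
[folklore] -/
def picardSeq (hS2 : lintegral_iSup_itoIntegral_sub_sq_le) (hc : LipschitzCoeffs b σ K) (x₀ : ℝ) :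
    ℕ → {U : ℝ≥0 → (ℝ≥0 → ℝ) → ℝ // PicardInv U}
  | 0 => ⟨fun _ _ ↦ x₀, picardInv_const x₀⟩
  | n + 1 => ⟨picardStep hc x₀ (picardSeq hS2 hc x₀ n).2,
      picardInv_picardStep hS2 hc x₀ (picardSeq hS2 hc x₀ n).2⟩

/-- Every Picard iterate starts at `x₀`. [folklore] -/
theorem picardSeq_apply_zero (hS2 : lintegral_iSup_itoIntegral_sub_sq_le) (hc : LipschitzCoeffs b σ K) (x₀ : ℝ)
    (n : ℕ) (ω : ℝ≥0 → ℝ) : (picardSeq hS2 hc x₀ n).1 0 ω = x₀ := by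
  cases n with
  | zero => rfl
  | succ n => exact picardStep_apply_zero hc x₀ _ ω

end PicardStepBound

end Literature.Analysis.FunctionSpaces

namespace Literature.Analysis.FunctionSpaces

section PicardBounds

variable {b σ : ℝ → ℝ → ℝ} {K : ℝ≥0} {x₀ : ℝ}

/-- Unfolding of the successor Picard iterate. [folklore] -/
theorem picardSeq_succ (hS2 : lintegral_iSup_itoIntegral_sub_sq_le) (hc : LipschitzCoeffs b σ K) (x₀ : ℝ) (n : ℕ) :
    (picardSeq hS2 hc x₀ (n + 1)).1 = picardStep hc x₀ (picardSeq hS2 hc x₀ n).2 := rfl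

/-- The `L²(sup)` distance `Φ_t(Xⁿ, Xⁿ⁺¹) = E[sup_{s ≤ t} (Xⁿ_s - Xⁿ⁺¹_s)²]` between consecutive
Picard iterates (the quantity `Φ_t(X^{n-1}, Xⁿ)` of RY IX (2.1)), in `ℝ≥0∞`. [folklore] -/
def picardDist (hS2 : lintegral_iSup_itoIntegral_sub_sq_le) (hc : LipschitzCoeffs b σ K) (x₀ : ℝ) (n : ℕ)
    (t : ℝ≥0) : ℝ≥0∞ :=
  ∫⁻ ω, ⨆ s ∈ Set.Iic t, ENNReal.ofReal
    (((picardSeq hS2 hc x₀ n).1 s ω - (picardSeq hS2 hc x₀ (n + 1)).1 s ω) ^ 2) ∂Literature.Probability.Process.preWienerMeasure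

/-- `Φ_t` is monotone in `t`. [folklore] -/
theorem picardDist_mono (hS2 : lintegral_iSup_itoIntegral_sub_sq_le) (hc : LipschitzCoeffs b σ K) (x₀ : ℝ) (n : ℕ) :
    Monotone (picardDist hS2 hc x₀ n) := fun _ _ h ↦
  lintegral_mono fun _ ↦ biSup_mono fun _ (hs : _ ∈ Set.Iic _) ↦ Set.mem_Iic.2 (hs.trans h)

/-- `∫₀ᵗ rⁿ/n! dr = tⁿ⁺¹/(n+1)!` in `ℝ≥0∞`. [folklore] -/
theorem lintegral_Icc_pow_div_factorial (t : ℝ≥0) (n : ℕ) :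
    ∫⁻ r in Set.Icc (0 : ℝ) t, ENNReal.ofReal (r ^ n / n.factorial) =
      ENNReal.ofReal ((t : ℝ) ^ (n + 1) / (n + 1).factorial) := by
  have hint : IntegrableOn (fun r : ℝ ↦ r ^ n / n.factorial) (Set.Icc (0 : ℝ) t) :=
    ((continuous_pow n).div_const _).integrableOn_Icc
  rw [← ofReal_integral_eq_lintegral_ofReal hint]
  · congr 1
    rw [integral_Icc_eq_integral_Ioc, ← intervalIntegral.integral_of_le t.coe_nonneg,
      intervalIntegral.integral_div, integral_pow, Nat.factorial_succ]
    push_cast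
    field_simp
    ring
  · rw [EventuallyLE, ae_restrict_iff' measurableSet_Icc]
    exact ae_of_all _ fun r hr ↦ by positivity [hr.1]

/-- **The factorial bound** `Φ_t(Xⁿ, Xⁿ⁺¹) ≤ D Cⁿ tⁿ/n!` for `t ≤ T`, with `D = Φ_T(X⁰, X¹)` and
`C = 2TK² + 8K²` (RY IX (2.1): "it then follows … that for every `t ≤ T` and every `n`,
`Φ_t(X^{n-1}, Xⁿ) ≤ DCⁿTⁿ/n!`"), by induction using the contraction estimate and Tonelli.
Revuz–Yor, *Continuous Martingales and Brownian Motion* (1999), Ch. IX, proof of Thm (2.1).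
[folklore] -/
theorem picardDist_le (hS2 : lintegral_iSup_itoIntegral_sub_sq_le) (hc : LipschitzCoeffs b σ K) (x₀ : ℝ) (T : ℝ≥0) (n : ℕ) :
    ∀ t ≤ T, picardDist hS2 hc x₀ n t ≤ picardDist hS2 hc x₀ 0 T *
      (ENNReal.ofReal (2 * T * (K : ℝ) ^ 2) + 8 * ENNReal.ofReal ((K : ℝ) ^ 2)) ^ n *
        ENNReal.ofReal ((t : ℝ) ^ n / n.factorial) := by
  induction n with
  | zero =>
    intro t ht
    simpa using picardDist_mono hS2 hc x₀ 0 ht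
  | succ n ih =>
    intro t ht
    have hU := (picardSeq hS2 hc x₀ n).2
    have hV := (picardSeq hS2 hc x₀ (n + 1)).2
    -- contraction estimate
    have h1 := lintegral_iSup_picardStep_sub_sq_le hS2 hc x₀ hU hV T t ht
    -- Tonelli and the inductive hypothesis under the time integral
    have hmeas : Measurable (fun q : (ℝ≥0 → ℝ) × ℝ ↦ ENNReal.ofReal
        (((picardSeq hS2 hc x₀ n).1 q.2.toNNReal q.1 -
          (picardSeq hS2 hc x₀ (n + 1)).1 q.2.toNNReal q.1) ^ 2)) := by
      have hu := (IsStronglyProgressive.measurable_uncurry hU.1).sub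
        (IsStronglyProgressive.measurable_uncurry hV.1)
      exact ((hu.comp ((measurable_real_toNNReal.comp measurable_snd).prodMk
        measurable_fst)).pow_const 2).ennreal_ofReal
    have h2 : ∫⁻ ω, (∫⁻ r in Set.Icc (0 : ℝ) t, ENNReal.ofReal
        (((picardSeq hS2 hc x₀ n).1 r.toNNReal ω - (picardSeq hS2 hc x₀ (n + 1)).1 r.toNNReal ω) ^ 2))
          ∂Literature.Probability.Process.preWienerMeasure ≤
        ∫⁻ r in Set.Icc (0 : ℝ) t, picardDist hS2 hc x₀ 0 T *
          (ENNReal.ofReal (2 * T * (K : ℝ) ^ 2) + 8 * ENNReal.ofReal ((K : ℝ) ^ 2)) ^ n *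
            ENNReal.ofReal (r ^ n / n.factorial) := by
      rw [lintegral_lintegral_swap hmeas.aemeasurable]
      refine setLIntegral_mono' measurableSet_Icc fun r hr ↦ ?_
      have hr' : r.toNNReal ≤ T := (Real.toNNReal_le_iff_le_coe.2 hr.2).trans ht
      refine (lintegral_mono fun ω ↦ ?_).trans ((ih _ hr').trans_eq ?_)
      · exact le_iSup₂_of_le r.toNNReal (Set.mem_Iic.2 le_rfl) le_rfl
      · rw [Real.coe_toNNReal _ hr.1]
    have hmeas2 : Measurable (fun r : ℝ ↦ ENNReal.ofReal (r ^ n / n.factorial)) :=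
      ((measurable_id.pow_const n).div_const _).ennreal_ofReal
    calc picardDist hS2 hc x₀ (n + 1) t
        = ∫⁻ ω, ⨆ s ∈ Set.Iic t, ENNReal.ofReal
            ((picardStep hc x₀ hU s ω - picardStep hc x₀ hV s ω) ^ 2) ∂Literature.Probability.Process.preWienerMeasure := rfl
      _ ≤ (ENNReal.ofReal (2 * T * (K : ℝ) ^ 2) + 8 * ENNReal.ofReal ((K : ℝ) ^ 2)) *
          ∫⁻ ω, (∫⁻ r in Set.Icc (0 : ℝ) t, ENNReal.ofReal
            (((picardSeq hS2 hc x₀ n).1 r.toNNReal ω -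
              (picardSeq hS2 hc x₀ (n + 1)).1 r.toNNReal ω) ^ 2)) ∂Literature.Probability.Process.preWienerMeasure := h1
      _ ≤ (ENNReal.ofReal (2 * T * (K : ℝ) ^ 2) + 8 * ENNReal.ofReal ((K : ℝ) ^ 2)) *
          ∫⁻ r in Set.Icc (0 : ℝ) t, picardDist hS2 hc x₀ 0 T *
            (ENNReal.ofReal (2 * T * (K : ℝ) ^ 2) + 8 * ENNReal.ofReal ((K : ℝ) ^ 2)) ^ n *
              ENNReal.ofReal (r ^ n / n.factorial) := by
          gcongr
      _ = picardDist hS2 hc x₀ 0 T *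
          (ENNReal.ofReal (2 * T * (K : ℝ) ^ 2) + 8 * ENNReal.ofReal ((K : ℝ) ^ 2)) ^ (n + 1) *
            ENNReal.ofReal ((t : ℝ) ^ (n + 1) / (n + 1).factorial) := by
          rw [lintegral_const_mul _ hmeas2, lintegral_Icc_pow_div_factorial, pow_succ]
          ring

/-- **Finiteness of `D = Φ_T(X⁰, X¹)`** ("using the properties of f it is easy to check that
`D = Φ_T(X⁰, X¹)` is finite", RY IX (2.1)); corollary of
`lintegral_iSup_const_sub_picardStep_sq_lt_top` (`X¹ = S x₀`).
Revuz–Yor, *Continuous Martingales and Brownian Motion* (1999), Ch. IX, proof of Thm (2.1).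
[folklore] -/
theorem picardDist_zero_lt_top (hS2 : lintegral_iSup_itoIntegral_sub_sq_le) (hc : LipschitzCoeffs b σ K) (x₀ : ℝ) (T : ℝ≥0) :
    picardDist hS2 hc x₀ 0 T < ∞ :=
  lintegral_iSup_const_sub_picardStep_sq_lt_top hS2 hc x₀ T

end PicardBounds

end Literature.Analysis.FunctionSpaces

namespace Literature.Analysis.FunctionSpaces

section PicardConvergence

variable {b σ : ℝ → ℝ → ℝ} {K : ℝ≥0} {x₀ : ℝ}

/-- The constant of the contraction estimate, read in `ℝ≥0∞`, is `ofReal` of the real constant.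
[folklore] -/
theorem picardConst_eq (T : ℝ≥0) (K : ℝ≥0) :
    ENNReal.ofReal (2 * T * (K : ℝ) ^ 2) + 8 * ENNReal.ofReal ((K : ℝ) ^ 2) =
      ENNReal.ofReal (2 * T * (K : ℝ) ^ 2 + 8 * (K : ℝ) ^ 2) := by
  rw [ENNReal.ofReal_add (by positivity) (by positivity), ENNReal.ofReal_mul (by norm_num) (p := 8),
    ENNReal.ofReal_ofNat]

/-- **Geometric decay of the Picard increments**: `Φ_T(Xⁿ, Xⁿ⁺¹) ≤ D e^{16cT} 16⁻ⁿ` with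
`c = 2TK² + 8K²`, from the factorial bound and `xⁿ/n! ≤ eˣ` (so that
`Σ ‖sup|Xⁿ - Xⁿ⁻¹|‖₂ < ∞`, RY IX (2.1)). [folklore] -/
theorem picardDist_le_geometric (hS2 : lintegral_iSup_itoIntegral_sub_sq_le) (hc : LipschitzCoeffs b σ K) (x₀ : ℝ) (T : ℝ≥0)
    (n : ℕ) :
    picardDist hS2 hc x₀ n T ≤ picardDist hS2 hc x₀ 0 T *
      ENNReal.ofReal (Real.exp (16 * ((2 * T * (K : ℝ) ^ 2 + 8 * (K : ℝ) ^ 2) * T))) *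
        (1 / 16) ^ n := by
  set c : ℝ := 2 * T * (K : ℝ) ^ 2 + 8 * (K : ℝ) ^ 2 with hcdef
  have hc0 : 0 ≤ c := by positivity
  have h1 := picardDist_le hS2 hc x₀ T n T le_rfl
  rw [picardConst_eq, ← hcdef] at h1
  refine h1.trans ?_
  rw [mul_assoc, mul_assoc]
  refine mul_le_mul_right ?_ _
  rw [← ENNReal.ofReal_pow hc0, ← ENNReal.ofReal_mul (pow_nonneg hc0 n)]
  have h16 : ((1 : ℝ≥0∞) / 16) ^ n = ENNReal.ofReal ((1 / 16) ^ n) := by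
    rw [ENNReal.ofReal_pow (by norm_num), ENNReal.ofReal_div_of_pos (by norm_num)]
    simp
  rw [h16, ← ENNReal.ofReal_mul (Real.exp_nonneg _)]
  refine ENNReal.ofReal_le_ofReal ?_
  have key := Real.pow_div_factorial_le_exp (x := 16 * (c * T)) (by positivity) n
  calc c ^ n * ((T : ℝ) ^ n / n.factorial) = (16 * (c * T)) ^ n / n.factorial * (1 / 16) ^ n := by
        rw [mul_pow, mul_pow, div_pow, one_pow]
        field_simp
    _ ≤ Real.exp (16 * (c * T)) * (1 / 16) ^ n :=
        mul_le_mul_of_nonneg_right key (by positivity)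

/-- **Almost sure geometric convergence of the Picard increments** on bounded intervals:
by Markov's inequality and the Borel–Cantelli lemma, almost surely, for every `T ∈ ℕ`,
eventually `sup_{s ≤ T} (Xⁿ_s - Xⁿ⁺¹_s)² < 4⁻ⁿ` ("the series `Σ sup|Xⁿ_s - Xⁿ⁻¹_s|` converges
a.s.", RY IX (2.1)). [folklore] -/
theorem ae_eventually_iSup_picard_lt (hS2 : lintegral_iSup_itoIntegral_sub_sq_le) (hc : LipschitzCoeffs b σ K) (x₀ : ℝ) :
    ∀ᵐ ω ∂Literature.Probability.Process.preWienerMeasure, ∀ T : ℕ, ∀ᶠ n in atTop,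
      ⨆ s ∈ Set.Iic (T : ℝ≥0), ENNReal.ofReal
        (((picardSeq hS2 hc x₀ n).1 s ω - (picardSeq hS2 hc x₀ (n + 1)).1 s ω) ^ 2) <
          (1 / 4) ^ n := by
  rw [ae_all_iff]
  intro T
  -- a.e. measurability of the suprema
  have hmeas : ∀ n, AEMeasurable (fun ω ↦ ⨆ s ∈ Set.Iic (T : ℝ≥0), ENNReal.ofReal
      (((picardSeq hS2 hc x₀ n).1 s ω - (picardSeq hS2 hc x₀ (n + 1)).1 s ω) ^ 2))
        Literature.Probability.Process.preWienerMeasure := by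
    intro n
    refine aemeasurable_biSup_Iic (Z := fun s ω ↦ (picardSeq hS2 hc x₀ n).1 s ω -
      (picardSeq hS2 hc x₀ (n + 1)).1 s ω) (φ := fun x ↦ ENNReal.ofReal (x ^ 2))
      (ENNReal.continuous_ofReal.comp (continuous_pow 2)) (fun s ↦ ?_) ?_ _
    · exact ((picardSeq hS2 hc x₀ n).2.measurable s).sub ((picardSeq hS2 hc x₀ (n + 1)).2.measurable s)
    · filter_upwards [(picardSeq hS2 hc x₀ n).2.2.1, (picardSeq hS2 hc x₀ (n + 1)).2.2.1] with ω h1 h2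
      exact h1.sub h2
  -- Markov
  set D' : ℝ≥0∞ := picardDist hS2 hc x₀ 0 T *
    ENNReal.ofReal (Real.exp (16 * ((2 * ((T : ℝ≥0) : ℝ) * (K : ℝ) ^ 2 + 8 * (K : ℝ) ^ 2) *
      ((T : ℝ≥0) : ℝ)))) with hD'
  have hD'fin : D' ≠ ∞ := ENNReal.mul_ne_top (picardDist_zero_lt_top hS2 hc x₀ T).ne
    ENNReal.ofReal_ne_top
  have h16 : ∀ n : ℕ, ((1 : ℝ≥0∞) / 16) ^ n = (1 / 4) ^ n * (1 / 4) ^ n := by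
    intro n
    have : ((1 : ℝ≥0∞) / 4) * (1 / 4) = 1 / 16 := by
      norm_num [div_eq_mul_inv, ← ENNReal.mul_inv]
    rw [← mul_pow, this]
  have h4 : ∀ n : ℕ, ((1 : ℝ≥0∞) / 4) ^ n ≠ 0 := fun n ↦ pow_ne_zero _ (by norm_num)
  have h4' : ∀ n : ℕ, ((1 : ℝ≥0∞) / 4) ^ n ≠ ∞ := fun n ↦
    ENNReal.pow_ne_top (ENNReal.div_ne_top ENNReal.one_ne_top (by norm_num))
  have hmarkov : ∀ n, Literature.Probability.Process.preWienerMeasure {ω | ((1 : ℝ≥0∞) / 4) ^ n ≤ ⨆ s ∈ Set.Iic (T : ℝ≥0),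
      ENNReal.ofReal (((picardSeq hS2 hc x₀ n).1 s ω - (picardSeq hS2 hc x₀ (n + 1)).1 s ω) ^ 2)} ≤
        D' * (1 / 4) ^ n := by
    intro n
    have h := mul_meas_ge_le_lintegral₀ (hmeas n) (((1 : ℝ≥0∞) / 4) ^ n)
    change _ ≤ picardDist hS2 hc x₀ n T at h
    have h3 := h.trans ((picardDist_le_geometric hS2 hc x₀ T n).trans_eq
      (show D' * (1 / 16) ^ n = (1 / 4) ^ n * (D' * (1 / 4) ^ n) by rw [h16]; ring))
    exact (ENNReal.mul_le_mul_iff_right (h4 n) (h4' n)).1 h3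
  -- Borel–Cantelli
  have hsum : ∑' n, Literature.Probability.Process.preWienerMeasure {ω | ((1 : ℝ≥0∞) / 4) ^ n ≤ ⨆ s ∈ Set.Iic (T : ℝ≥0),
      ENNReal.ofReal (((picardSeq hS2 hc x₀ n).1 s ω - (picardSeq hS2 hc x₀ (n + 1)).1 s ω) ^ 2)} ≠
        ∞ := by
    refine ne_top_of_le_ne_top ?_ (ENNReal.tsum_le_tsum hmarkov)
    rw [ENNReal.tsum_mul_left, ENNReal.tsum_geometric]
    refine ENNReal.mul_ne_top hD'fin (ENNReal.inv_ne_top.2 ?_)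
    exact (tsub_pos_iff_lt.2 (by norm_num)).ne'
  filter_upwards [ae_eventually_notMem hsum] with ω hω
  refine hω.mono fun n hn ↦ ?_
  simpa only [Set.mem_setOf_eq, not_le] using hn

end PicardConvergence

end Literature.Analysis.FunctionSpaces

namespace Literature.Analysis.FunctionSpaces

section GeometricCauchy

/-- **Uniform limits from geometric increments.** If a sequence of real functions has, from some
index on, increments bounded by `2⁻ⁿ` uniformly on a set `S`, then it converges at every point
of `S` (to its `limUnder`) and the convergence is uniform on `S`. [folklore] -/
theorem tendstoUniformlyOn_of_geometric {α : Type*} {f : ℕ → α → ℝ} {S : Set α}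
    (h : ∀ᶠ n in atTop, ∀ s ∈ S, |f n s - f (n + 1) s| ≤ (1 / 2) ^ n) :
    (∀ s ∈ S, Tendsto (fun n ↦ f n s) atTop (𝓝 (limUnder atTop fun n ↦ f n s))) ∧
      TendstoUniformlyOn f (fun s ↦ limUnder atTop fun n ↦ f n s) atTop S := by
  obtain ⟨N, hN⟩ := eventually_atTop.1 h
  -- telescoping estimate
  have key : ∀ s ∈ S, ∀ n, N ≤ n → ∀ m, n ≤ m →
      |f n s - f m s| ≤ 2 * (1 / 2) ^ n - 2 * (1 / 2) ^ m := by
    intro s hs n hn m hm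
    induction m, hm using Nat.le_induction with
    | base => simp
    | succ m hnm ih =>
      have h1 := hN m (hn.trans hnm) s hs
      calc |f n s - f (m + 1) s| ≤ |f n s - f m s| + |f m s - f (m + 1) s| := abs_sub_le _ _ _
        _ ≤ (2 * (1 / 2) ^ n - 2 * (1 / 2) ^ m) + (1 / 2) ^ m := add_le_add ih h1
        _ = 2 * (1 / 2) ^ n - 2 * (1 / 2) ^ (m + 1) := by rw [pow_succ]; ring
  have key' : ∀ s ∈ S, ∀ n, N ≤ n → ∀ m, n ≤ m → |f n s - f m s| ≤ 2 * (1 / 2) ^ n :=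
    fun s hs n hn m hm ↦ (key s hs n hn m hm).trans (by linarith [pow_pos (by norm_num : (0:ℝ) < 1/2) m])
  have hgeo : Tendsto (fun n : ℕ ↦ (2 : ℝ) * (1 / 2) ^ n) atTop (𝓝 0) := by
    simpa using (tendsto_pow_atTop_nhds_zero_of_lt_one (r := (1 / 2 : ℝ)) (by norm_num)
      (by norm_num)).const_mul 2
  -- pointwise Cauchy, hence convergent
  have hcauchy : ∀ s ∈ S, CauchySeq fun n ↦ f n s := by
    intro s hs
    refine Metric.cauchySeq_iff'.2 fun ε hε ↦ ?_
    obtain ⟨N', hN'⟩ := eventually_atTop.1 (hgeo.eventually (gt_mem_nhds hε))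
    refine ⟨max N N', fun n hn ↦ ?_⟩
    rw [Real.dist_eq, abs_sub_comm]
    exact (key' s hs _ (le_max_left _ _) n hn).trans_lt (hN' _ (le_max_right _ _))
  have hlim : ∀ s ∈ S, Tendsto (fun n ↦ f n s) atTop (𝓝 (limUnder atTop fun n ↦ f n s)) :=
    fun s hs ↦ (hcauchy s hs).tendsto_limUnder
  refine ⟨hlim, Metric.tendstoUniformlyOn_iff.2 fun ε hε ↦ ?_⟩
  obtain ⟨N', hN'⟩ := eventually_atTop.1 (hgeo.eventually (gt_mem_nhds hε))
  refine eventually_atTop.2 ⟨max N N', fun n hn s hs ↦ ?_⟩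
  have hle : |f n s - limUnder atTop (fun n ↦ f n s)| ≤ 2 * (1 / 2) ^ n := by
    refine le_of_tendsto ((tendsto_const_nhds.sub (hlim s hs)).abs) ?_
    exact eventually_atTop.2 ⟨n, fun m hm ↦ key' s hs n ((le_max_left _ _).trans hn) m hm⟩
  rw [Real.dist_eq, abs_sub_comm]
  exact hle.trans_lt (hN' n ((le_max_right _ _).trans hn))

end GeometricCauchy

section PicardLimit

variable {b σ : ℝ → ℝ → ℝ} {K : ℝ≥0} {x₀ : ℝ}

/-- **The limit of the Picard scheme** `X_t(ω) = limₙ Xⁿ_t(ω)` (pointwise `limUnder`; the limit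
exists almost surely, locally uniformly in `t`).
Revuz–Yor, *Continuous Martingales and Brownian Motion* (1999), Ch. IX, proof of Thm (2.1)
("`Xⁿ` converges a.s., uniformly on every bounded interval, to a continuous process `X`").
[folklore] -/
def picardLimit (hS2 : lintegral_iSup_itoIntegral_sub_sq_le) (hc : LipschitzCoeffs b σ K) (x₀ : ℝ) :
    ℝ≥0 → (ℝ≥0 → ℝ) → ℝ :=
  fun t ω ↦ limUnder atTop fun n ↦ (picardSeq hS2 hc x₀ n).1 t ω

/-- The Picard limit is progressively measurable (pointwise `limUnder` of progressive processes).
[folklore] -/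
theorem isStronglyProgressive_picardLimit (hS2 : lintegral_iSup_itoIntegral_sub_sq_le) (hc : LipschitzCoeffs b σ K)
    (x₀ : ℝ) : IsStronglyProgressive Literature.Probability.RandomPlanarGeometry.brownianFiltration (picardLimit hS2 hc x₀) := fun i ↦
  @MeasureTheory.StronglyMeasurable.limUnder ℕ (Set.Iic i × (ℝ≥0 → ℝ)) ℝ
    (Subtype.instMeasurableSpace.prod (Literature.Probability.RandomPlanarGeometry.brownianFiltration i)) _ _ atTop _
    (fun n p ↦ (picardSeq hS2 hc x₀ n).1 p.1 p.2) _ _ (fun n ↦ (picardSeq hS2 hc x₀ n).2.1 i)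

/-- The Picard limit starts at `x₀`. [folklore] -/
theorem picardLimit_apply_zero (hS2 : lintegral_iSup_itoIntegral_sub_sq_le) (hc : LipschitzCoeffs b σ K) (x₀ : ℝ)
    (ω : ℝ≥0 → ℝ) : picardLimit hS2 hc x₀ 0 ω = x₀ := by
  simp only [picardLimit, picardSeq_apply_zero]
  exact tendsto_const_nhds.limUnder_eq

/-- **Almost sure locally uniform convergence of the Picard scheme**: almost surely, the Picard
iterates converge to the Picard limit at every time, and the limit has continuous paths.
Revuz–Yor, *Continuous Martingales and Brownian Motion* (1999), Ch. IX, proof of Thm (2.1).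
[folklore] -/
theorem ae_tendsto_picardLimit (hS2 : lintegral_iSup_itoIntegral_sub_sq_le) (hc : LipschitzCoeffs b σ K) (x₀ : ℝ) :
    ∀ᵐ ω ∂Literature.Probability.Process.preWienerMeasure, Continuous (picardLimit hS2 hc x₀ · ω) ∧
      ∀ s, Tendsto (fun n ↦ (picardSeq hS2 hc x₀ n).1 s ω) atTop (𝓝 (picardLimit hS2 hc x₀ s ω)) := by
  have hcont : ∀ᵐ ω ∂Literature.Probability.Process.preWienerMeasure, ∀ n, Continuous ((picardSeq hS2 hc x₀ n).1 · ω) := by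
    rw [ae_all_iff]; exact fun n ↦ (picardSeq hS2 hc x₀ n).2.2.1
  filter_upwards [ae_eventually_iSup_picard_lt hS2 hc x₀, hcont] with ω hω hc'
  -- real form of the increment bound on `[0, T]`
  have hreal : ∀ T : ℕ, ∀ᶠ n in atTop, ∀ s ∈ Set.Iic (T : ℝ≥0),
      |(picardSeq hS2 hc x₀ n).1 s ω - (picardSeq hS2 hc x₀ (n + 1)).1 s ω| ≤ (1 / 2) ^ n := by
    intro T
    refine (hω T).mono fun n hn s hs ↦ ?_
    have h1 := lt_of_le_of_lt (le_iSup₂_of_le s hs le_rfl) hn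
    have h4 : ((1 : ℝ≥0∞) / 4) ^ n = ENNReal.ofReal (((1 / 2 : ℝ) ^ n) ^ 2) := by
      have e1 : (((1 / 2 : ℝ) ^ n) ^ 2) = (1 / 4) ^ n := by
        rw [← pow_mul, mul_comm, pow_mul]; norm_num
      rw [e1, ENNReal.ofReal_pow (by norm_num), ENNReal.ofReal_div_of_pos (by norm_num),
        ENNReal.ofReal_one, ENNReal.ofReal_ofNat]
    rw [h4, ENNReal.ofReal_lt_ofReal_iff_of_nonneg (sq_nonneg _)] at h1
    have h2 := sq_lt_sq.1 h1
    rw [abs_of_pos (by positivity : (0 : ℝ) < (1 / 2) ^ n)] at h2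
    exact h2.le
  have hconv := fun T : ℕ ↦
    tendstoUniformlyOn_of_geometric (f := fun n s ↦ (picardSeq hS2 hc x₀ n).1 s ω) (hreal T)
  refine ⟨?_, fun s ↦ ?_⟩
  · have hT : ∀ T : ℕ, ContinuousOn (picardLimit hS2 hc x₀ · ω) (Set.Iic (T : ℝ≥0)) := fun T ↦
      (hconv T).2.continuousOn (Eventually.of_forall fun n ↦ (hc' n).continuousOn).frequently
    refine continuous_iff_continuousAt.2 fun t ↦ ?_
    obtain ⟨T, hT'⟩ := exists_nat_gt t
    exact (hT T).continuousAt (Iic_mem_nhds hT')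
  · obtain ⟨T, hT'⟩ := exists_nat_ge s
    exact (hconv T).1 s hT'

end PicardLimit

end Literature.Analysis.FunctionSpaces

namespace Literature.Analysis.FunctionSpaces

section PicardL2

variable {b σ : ℝ → ℝ → ℝ} {K : ℝ≥0} {x₀ : ℝ}

/-- A.e. measurability of the suprema of squared Picard increments. [folklore] -/
theorem aemeasurable_iSup_picard_sub (hS2 : lintegral_iSup_itoIntegral_sub_sq_le) (hc : LipschitzCoeffs b σ K)
    (x₀ : ℝ) (T : ℝ≥0) (k : ℕ) :
    AEMeasurable (fun ω ↦ ⨆ s ∈ Set.Iic T, ENNReal.ofReal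
      (((picardSeq hS2 hc x₀ k).1 s ω - (picardSeq hS2 hc x₀ (k + 1)).1 s ω) ^ 2))
        Literature.Probability.Process.preWienerMeasure := by
  refine aemeasurable_biSup_Iic (Z := fun s ω ↦ (picardSeq hS2 hc x₀ k).1 s ω -
    (picardSeq hS2 hc x₀ (k + 1)).1 s ω) (φ := fun x ↦ ENNReal.ofReal (x ^ 2))
    (ENNReal.continuous_ofReal.comp (continuous_pow 2)) (fun s ↦ ?_) ?_ _
  · exact ((picardSeq hS2 hc x₀ k).2.measurable s).sub ((picardSeq hS2 hc x₀ (k + 1)).2.measurable s)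
  · filter_upwards [(picardSeq hS2 hc x₀ k).2.2.1, (picardSeq hS2 hc x₀ (k + 1)).2.2.1] with ω h1 h2
    exact h1.sub h2

/-- **Pathwise tail bound for the Picard scheme** (weighted Cauchy–Schwarz on the telescoping
sum): if `Xᵐ_s → X_s`, then
`(Xⁿ_s - X_s)² ≤ 2·2⁻ⁿ Σ_{k ≥ n} 2ᵏ sup_{r ≤ T} (Xᵏ_r - Xᵏ⁺¹_r)²` for `s ≤ T`. [folklore] -/
theorem ofReal_picard_sub_limit_sq_le {f : ℕ → ℝ≥0 → ℝ} {g : ℝ≥0 → ℝ} {T : ℝ≥0} {s : ℝ≥0}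
    (hs : s ≤ T) (hlim : Tendsto (fun m ↦ f m s) atTop (𝓝 (g s))) (n : ℕ) :
    ENNReal.ofReal ((f n s - g s) ^ 2) ≤ ENNReal.ofReal (2 * (1 / 2) ^ n) *
      ∑' k, (if n ≤ k then 2 ^ k * ⨆ r ∈ Set.Iic T, ENNReal.ofReal ((f k r - f (k + 1) r) ^ 2)
        else 0) := by
  -- telescoping
  have htel : ∀ m, n ≤ m → |f n s - f m s| ≤ ∑ k ∈ Finset.Ico n m, |f k s - f (k + 1) s| := by
    intro m hm
    induction m, hm using Nat.le_induction with
    | base => simp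
    | succ m hnm ih =>
      rw [Finset.sum_Ico_succ_top hnm]
      exact (abs_sub_le _ (f m s) _).trans (by linarith)
  -- weighted Cauchy–Schwarz for each `m`
  have hCS : ∀ m, n ≤ m → (f n s - f m s) ^ 2 ≤ (2 * (1 / 2) ^ n) *
      ∑ k ∈ Finset.Ico n m, 2 ^ k * (f k s - f (k + 1) s) ^ 2 := by
    intro m hm
    have h1 : (f n s - f m s) ^ 2 ≤ (∑ k ∈ Finset.Ico n m, |f k s - f (k + 1) s|) ^ 2 := by
      rw [← sq_abs]; exact pow_le_pow_left₀ (abs_nonneg _) (htel m hm) 2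
    have h2 := Finset.sum_sq_le_sum_mul_sum_of_sq_le_mul (Finset.Ico n m)
      (f := fun k ↦ (1 / 2 : ℝ) ^ k) (g := fun k ↦ 2 ^ k * (f k s - f (k + 1) s) ^ 2)
      (r := fun k ↦ |f k s - f (k + 1) s|) (fun _ _ ↦ by positivity) (fun _ _ ↦ by positivity)
      (fun k _ ↦ by
        rw [sq_abs, ← mul_assoc, ← mul_pow]
        norm_num)
    have h3 : ∑ k ∈ Finset.Ico n m, (1 / 2 : ℝ) ^ k ≤ 2 * (1 / 2) ^ n := by
      rw [Finset.sum_Ico_eq_sum_range]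
      simp_rw [pow_add, ← Finset.mul_sum]
      rw [mul_comm]
      exact mul_le_mul_of_nonneg_right (sum_geometric_two_le _) (by positivity)
    exact h1.trans (h2.trans (mul_le_mul_of_nonneg_right h3 (Finset.sum_nonneg fun _ _ ↦ by positivity)))
  -- in `ℝ≥0∞`, bounded by the tail series, uniformly in `m`
  have hENN : ∀ m, n ≤ m → ENNReal.ofReal ((f n s - f m s) ^ 2) ≤ ENNReal.ofReal (2 * (1 / 2) ^ n) *
      ∑' k, (if n ≤ k then 2 ^ k * ⨆ r ∈ Set.Iic T, ENNReal.ofReal ((f k r - f (k + 1) r) ^ 2)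
        else 0) := by
    intro m hm
    refine (ENNReal.ofReal_le_ofReal (hCS m hm)).trans ?_
    rw [ENNReal.ofReal_mul (by positivity), ENNReal.ofReal_sum_of_nonneg (fun _ _ ↦ by positivity)]
    refine mul_le_mul_right ((Finset.sum_le_sum fun k hk ↦ ?_).trans (ENNReal.sum_le_tsum _)) _
    rw [if_pos (Finset.mem_Ico.1 hk).1, ENNReal.ofReal_mul (by positivity), ENNReal.ofReal_pow
      (by norm_num), ENNReal.ofReal_ofNat]
    refine mul_le_mul_right ?_ _
    exact le_iSup₂_of_le (f := fun r (_ : r ∈ Set.Iic T) ↦ ENNReal.ofReal ((f k r - f (k + 1) r) ^ 2))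
      s (Set.mem_Iic.2 hs) le_rfl
  -- pass to the limit `m → ∞`
  have hT : Tendsto (fun m ↦ ENNReal.ofReal ((f n s - f m s) ^ 2)) atTop
      (𝓝 (ENNReal.ofReal ((f n s - g s) ^ 2))) :=
    (ENNReal.continuous_ofReal.tendsto _).comp
      (((tendsto_const_nhds.sub hlim).pow 2))
  exact le_of_tendsto hT (eventually_atTop.2 ⟨n, hENN⟩)

/-- **`L²(sup)` convergence of the Picard scheme to its limit**:
`E[sup_{s≤T}(Xⁿ_s - X_s)²] ≤ 2·2⁻ⁿ · Σ_{k≥n} 2ᵏ Φ_T(Xᵏ, Xᵏ⁺¹) ≤ 2·2⁻ⁿ · D e^{16cT} (1 - 1/8)⁻¹`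
(the tail of the convergent series `Σ ‖sup|Xᵏ - Xᵏ⁺¹|‖₂`, RY IX (2.1)). [folklore] -/
theorem lintegral_iSup_picard_sub_limit_sq_le (hS2 : lintegral_iSup_itoIntegral_sub_sq_le) (hc : LipschitzCoeffs b σ K) (x₀ : ℝ) (T : ℝ≥0)
    (n : ℕ) :
    ∫⁻ ω, ⨆ s ∈ Set.Iic T, ENNReal.ofReal
        (((picardSeq hS2 hc x₀ n).1 s ω - picardLimit hS2 hc x₀ s ω) ^ 2) ∂Literature.Probability.Process.preWienerMeasure ≤
      ENNReal.ofReal (2 * (1 / 2) ^ n) * (picardDist hS2 hc x₀ 0 T *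
        ENNReal.ofReal (Real.exp (16 * ((2 * T * (K : ℝ) ^ 2 + 8 * (K : ℝ) ^ 2) * T))) *
          (1 - 1 / 8)⁻¹) := by
  -- pathwise bound, a.e.
  have hpt : ∀ᵐ ω ∂Literature.Probability.Process.preWienerMeasure, ⨆ s ∈ Set.Iic T, ENNReal.ofReal
      (((picardSeq hS2 hc x₀ n).1 s ω - picardLimit hS2 hc x₀ s ω) ^ 2) ≤
      ENNReal.ofReal (2 * (1 / 2) ^ n) * ∑' k, (if n ≤ k then 2 ^ k * ⨆ r ∈ Set.Iic T,
        ENNReal.ofReal (((picardSeq hS2 hc x₀ k).1 r ω - (picardSeq hS2 hc x₀ (k + 1)).1 r ω) ^ 2)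
          else 0) := by
    filter_upwards [ae_tendsto_picardLimit hS2 hc x₀] with ω hω
    exact iSup₂_le fun s hs ↦ ofReal_picard_sub_limit_sq_le
      (f := fun m s ↦ (picardSeq hS2 hc x₀ m).1 s ω) (g := fun s ↦ picardLimit hS2 hc x₀ s ω)
      (Set.mem_Iic.1 hs) (hω.2 s) n
  -- a.e. measurability of the terms
  have hmeas : ∀ k, AEMeasurable (fun ω ↦ if n ≤ k then 2 ^ k * ⨆ r ∈ Set.Iic T,
      ENNReal.ofReal (((picardSeq hS2 hc x₀ k).1 r ω - (picardSeq hS2 hc x₀ (k + 1)).1 r ω) ^ 2)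
        else 0) Literature.Probability.Process.preWienerMeasure := by
    intro k
    by_cases hk : n ≤ k
    · simp only [if_pos hk]
      exact (aemeasurable_iSup_picard_sub hS2 hc x₀ T k).const_mul _
    · simp only [if_neg hk]
      exact aemeasurable_const
  -- term-wise integrals
  have hterm : ∀ k, ∫⁻ ω, (if n ≤ k then 2 ^ k * ⨆ r ∈ Set.Iic T,
      ENNReal.ofReal (((picardSeq hS2 hc x₀ k).1 r ω - (picardSeq hS2 hc x₀ (k + 1)).1 r ω) ^ 2)
        else 0) ∂Literature.Probability.Process.preWienerMeasure ≤
      2 ^ k * (picardDist hS2 hc x₀ 0 T *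
        ENNReal.ofReal (Real.exp (16 * ((2 * T * (K : ℝ) ^ 2 + 8 * (K : ℝ) ^ 2) * T))) *
          (1 / 16) ^ k) := by
    intro k
    by_cases hk : n ≤ k
    · simp only [if_pos hk]
      rw [lintegral_const_mul' _ _ (ENNReal.pow_ne_top (by norm_num))]
      exact mul_le_mul_right (picardDist_le_geometric hS2 hc x₀ T k) _
    · simp only [if_neg hk, lintegral_const, zero_mul]
      exact zero_le
  calc _ ≤ ∫⁻ ω, ENNReal.ofReal (2 * (1 / 2) ^ n) * ∑' k, (if n ≤ k then 2 ^ k * ⨆ r ∈ Set.Iic T,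
        ENNReal.ofReal (((picardSeq hS2 hc x₀ k).1 r ω - (picardSeq hS2 hc x₀ (k + 1)).1 r ω) ^ 2)
          else 0) ∂Literature.Probability.Process.preWienerMeasure := lintegral_mono_ae hpt
    _ = ENNReal.ofReal (2 * (1 / 2) ^ n) * ∑' k, ∫⁻ ω, (if n ≤ k then 2 ^ k * ⨆ r ∈ Set.Iic T,
        ENNReal.ofReal (((picardSeq hS2 hc x₀ k).1 r ω - (picardSeq hS2 hc x₀ (k + 1)).1 r ω) ^ 2)
          else 0) ∂Literature.Probability.Process.preWienerMeasure := by
        rw [lintegral_const_mul' _ _ ENNReal.ofReal_ne_top, lintegral_tsum hmeas]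
    _ ≤ ENNReal.ofReal (2 * (1 / 2) ^ n) * ∑' k : ℕ, 2 ^ k * (picardDist hS2 hc x₀ 0 T *
        ENNReal.ofReal (Real.exp (16 * ((2 * T * (K : ℝ) ^ 2 + 8 * (K : ℝ) ^ 2) * T))) *
          (1 / 16) ^ k) := by
        gcongr with k
        exact hterm k
    _ = _ := by
        congr 1
        have h8 : ∀ k : ℕ, (2 : ℝ≥0∞) ^ k * (1 / 16) ^ k = (1 / 8) ^ k := by
          intro k
          rw [← mul_pow]
          congr 1
          rw [show (16 : ℝ≥0∞) = 2 * 8 by norm_num, one_div, one_div,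
            ENNReal.mul_inv (Or.inl (by norm_num)) (Or.inl (by norm_num)), ← mul_assoc,
            ENNReal.mul_inv_cancel (by norm_num) (by norm_num), one_mul]
        simp_rw [show ∀ k : ℕ, (2 : ℝ≥0∞) ^ k * (picardDist hS2 hc x₀ 0 T *
          ENNReal.ofReal (Real.exp (16 * ((2 * T * (K : ℝ) ^ 2 + 8 * (K : ℝ) ^ 2) * T))) *
            (1 / 16) ^ k) = (picardDist hS2 hc x₀ 0 T *
          ENNReal.ofReal (Real.exp (16 * ((2 * T * (K : ℝ) ^ 2 + 8 * (K : ℝ) ^ 2) * T)))) *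
            ((2 : ℝ≥0∞) ^ k * (1 / 16) ^ k) from fun k ↦ by ring, h8, ENNReal.tsum_mul_left,
          ENNReal.tsum_geometric]

/-- The `L²(sup)` distance between the Picard iterates and the Picard limit is finite and tends
to `0`. [folklore] -/
theorem tendsto_lintegral_iSup_picard_sub_limit_sq (hS2 : lintegral_iSup_itoIntegral_sub_sq_le) (hc : LipschitzCoeffs b σ K) (x₀ : ℝ) (T : ℝ≥0) :
    Tendsto (fun n ↦ ∫⁻ ω, ⨆ s ∈ Set.Iic T, ENNReal.ofReal
        (((picardSeq hS2 hc x₀ n).1 s ω - picardLimit hS2 hc x₀ s ω) ^ 2) ∂Literature.Probability.Process.preWienerMeasure)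
      atTop (𝓝 0) ∧
    ∀ n, ∫⁻ ω, ⨆ s ∈ Set.Iic T, ENNReal.ofReal
        (((picardSeq hS2 hc x₀ n).1 s ω - picardLimit hS2 hc x₀ s ω) ^ 2) ∂Literature.Probability.Process.preWienerMeasure < ∞ := by
  set M : ℝ≥0∞ := picardDist hS2 hc x₀ 0 T *
    ENNReal.ofReal (Real.exp (16 * ((2 * T * (K : ℝ) ^ 2 + 8 * (K : ℝ) ^ 2) * T))) *
      (1 - 1 / 8)⁻¹ with hM
  have hMfin : M ≠ ∞ := by
    refine ENNReal.mul_ne_top (ENNReal.mul_ne_top (picardDist_zero_lt_top hS2 hc x₀ T).ne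
      ENNReal.ofReal_ne_top) (ENNReal.inv_ne_top.2 ?_)
    exact (tsub_pos_iff_lt.2 (by norm_num)).ne'
  have hb := lintegral_iSup_picard_sub_limit_sq_le hS2 hc x₀ T
  refine ⟨?_, fun n ↦ (hb n).trans_lt (ENNReal.mul_lt_top ENNReal.ofReal_lt_top hMfin.lt_top)⟩
  have h0 : Tendsto (fun n : ℕ ↦ ENNReal.ofReal (2 * (1 / 2) ^ n) * M) atTop (𝓝 0) := by
    have h1 : Tendsto (fun n : ℕ ↦ (2 : ℝ) * (1 / 2) ^ n) atTop (𝓝 0) := by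
      simpa using (tendsto_pow_atTop_nhds_zero_of_lt_one (r := (1 / 2 : ℝ)) (by norm_num)
        (by norm_num)).const_mul 2
    have h2 : Tendsto (fun n : ℕ ↦ ENNReal.ofReal (2 * (1 / 2) ^ n)) atTop (𝓝 0) := by
      simpa using ENNReal.tendsto_ofReal h1
    simpa using ENNReal.Tendsto.mul_const h2 (Or.inr hMfin)
  exact tendsto_of_tendsto_of_tendsto_of_le_of_le tendsto_const_nhds h0 (fun n ↦ zero_le) hb

end PicardL2

end Literature.Analysis.FunctionSpaces

namespace Literature.Analysis.FunctionSpaces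

section PicardSolution

variable {b σ : ℝ → ℝ → ℝ} {K : ℝ≥0} {x₀ : ℝ}

/-- The Picard limit satisfies the Picard invariant (progressive, a.s. continuous, and in
`L²(sup)`: `E sup X² ≤ 2 E sup (X⁰)² + 2 E sup (X⁰ - X)² < ∞`). [folklore] -/
theorem picardInv_picardLimit (hS2 : lintegral_iSup_itoIntegral_sub_sq_le) (hc : LipschitzCoeffs b σ K) (x₀ : ℝ) :
    PicardInv (picardLimit hS2 hc x₀) := by
  have hprog := isStronglyProgressive_picardLimit hS2 hc x₀
  have hcts : ∀ᵐ ω ∂Literature.Probability.Process.preWienerMeasure, Continuous (picardLimit hS2 hc x₀ · ω) :=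
    (ae_tendsto_picardLimit hS2 hc x₀).mono fun _ h ↦ h.1
  refine ⟨hprog, hcts, fun t ↦ ?_⟩
  have h0 := (picardSeq hS2 hc x₀ 0).2
  have hfin := (tendsto_lintegral_iSup_picard_sub_limit_sq hS2 hc x₀ t).2 0
  have hpt : ∀ ω, ⨆ s ∈ Set.Iic t, ENNReal.ofReal (picardLimit hS2 hc x₀ s ω ^ 2) ≤
      2 * (⨆ s ∈ Set.Iic t, ENNReal.ofReal ((picardSeq hS2 hc x₀ 0).1 s ω ^ 2)) +
      2 * ⨆ s ∈ Set.Iic t, ENNReal.ofReal (((picardSeq hS2 hc x₀ 0).1 s ω - picardLimit hS2 hc x₀ s ω) ^ 2) := by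
    intro ω
    refine iSup₂_le fun s hs ↦ ?_
    set a := (picardSeq hS2 hc x₀ 0).1 s ω
    set x := picardLimit hS2 hc x₀ s ω
    have hle : x ^ 2 ≤ 2 * a ^ 2 + 2 * (a - x) ^ 2 := by nlinarith [sq_nonneg (a + (a - x))]
    calc ENNReal.ofReal (x ^ 2) ≤ ENNReal.ofReal (2 * a ^ 2 + 2 * (a - x) ^ 2) :=
          ENNReal.ofReal_le_ofReal hle
      _ = 2 * ENNReal.ofReal (a ^ 2) + 2 * ENNReal.ofReal ((a - x) ^ 2) := by
          rw [ENNReal.ofReal_add (by positivity) (by positivity), ENNReal.ofReal_mul (by norm_num),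
            ENNReal.ofReal_mul (by norm_num), ENNReal.ofReal_ofNat]
      _ ≤ _ := by
          gcongr
          · exact le_iSup₂_of_le s hs le_rfl
          · exact le_iSup₂_of_le s hs le_rfl
  have hm : AEMeasurable (fun ω ↦ 2 * ⨆ s ∈ Set.Iic t, ENNReal.ofReal ((picardSeq hS2 hc x₀ 0).1 s ω ^ 2))
      Literature.Probability.Process.preWienerMeasure := by
    refine (aemeasurable_biSup_Iic (Z := fun s ω ↦ (picardSeq hS2 hc x₀ 0).1 s ω)
      (φ := fun x ↦ ENNReal.ofReal (x ^ 2)) (ENNReal.continuous_ofReal.comp (continuous_pow 2))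
      (fun s ↦ h0.measurable s) h0.2.1 t).const_mul _
  calc ∫⁻ ω, ⨆ s ∈ Set.Iic t, ENNReal.ofReal (picardLimit hS2 hc x₀ s ω ^ 2) ∂Literature.Probability.Process.preWienerMeasure
      ≤ ∫⁻ ω, (2 * (⨆ s ∈ Set.Iic t, ENNReal.ofReal ((picardSeq hS2 hc x₀ 0).1 s ω ^ 2)) +
          2 * ⨆ s ∈ Set.Iic t, ENNReal.ofReal (((picardSeq hS2 hc x₀ 0).1 s ω - picardLimit hS2 hc x₀ s ω) ^ 2))
            ∂Literature.Probability.Process.preWienerMeasure := lintegral_mono hpt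
    _ = 2 * ∫⁻ ω, ⨆ s ∈ Set.Iic t, ENNReal.ofReal ((picardSeq hS2 hc x₀ 0).1 s ω ^ 2) ∂Literature.Probability.Process.preWienerMeasure +
          2 * ∫⁻ ω, ⨆ s ∈ Set.Iic t, ENNReal.ofReal
            (((picardSeq hS2 hc x₀ 0).1 s ω - picardLimit hS2 hc x₀ s ω) ^ 2) ∂Literature.Probability.Process.preWienerMeasure := by
        rw [lintegral_add_left' hm, lintegral_const_mul' _ _ (by norm_num),
          lintegral_const_mul' _ _ (by norm_num)]
    _ < ∞ := ENNReal.add_lt_top.2 ⟨ENNReal.mul_lt_top (by norm_num) (h0.2.2 t),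
        ENNReal.mul_lt_top (by norm_num) hfin⟩

/-- **The Picard limit is a fixed point of the Picard step**, up to indistinguishability
("by Theorem (2.12) Chap. IV, `X = SX`", RY IX (2.1); here through the `L²(sup)` estimates:
`Φ_T(X, SX) ≤ 2Φ_T(Xⁿ⁺¹, X) + 2 C T Φ_T(Xⁿ, X) → 0`). [folklore] -/
theorem ae_picardLimit_eq_picardStep (hS2 : lintegral_iSup_itoIntegral_sub_sq_le) (hc : LipschitzCoeffs b σ K) (x₀ : ℝ) :
    ∀ᵐ ω ∂Literature.Probability.Process.preWienerMeasure, ∀ t, picardLimit hS2 hc x₀ t ω =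
      picardStep hc x₀ (picardInv_picardLimit hS2 hc x₀) t ω := by
  have hX := picardInv_picardLimit hS2 hc x₀
  have hSX := picardInv_picardStep hS2 hc x₀ hX
  -- `Φ_T(X, SX) = 0` for every `T`
  have hzero : ∀ T : ℝ≥0, ∫⁻ ω, ⨆ s ∈ Set.Iic T, ENNReal.ofReal ((picardLimit hS2 hc x₀ s ω -
      picardStep hc x₀ hX s ω) ^ 2) ∂Literature.Probability.Process.preWienerMeasure = 0 := by
    intro T
    obtain ⟨hlim, hfin⟩ := tendsto_lintegral_iSup_picard_sub_limit_sq hS2 hc x₀ T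
    -- a.e. measurability of `sup (Xⁿ⁺¹ - X)²`
    have hmeas : ∀ n, AEMeasurable (fun ω ↦ ⨆ s ∈ Set.Iic T, ENNReal.ofReal
        (((picardSeq hS2 hc x₀ (n + 1)).1 s ω - picardLimit hS2 hc x₀ s ω) ^ 2)) Literature.Probability.Process.preWienerMeasure := by
      intro n
      refine aemeasurable_biSup_Iic (Z := fun s ω ↦ (picardSeq hS2 hc x₀ (n + 1)).1 s ω -
        picardLimit hS2 hc x₀ s ω) (φ := fun x ↦ ENNReal.ofReal (x ^ 2))
        (ENNReal.continuous_ofReal.comp (continuous_pow 2)) (fun s ↦ ?_) ?_ _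
      · exact ((picardSeq hS2 hc x₀ (n + 1)).2.measurable s).sub (hX.measurable s)
      · filter_upwards [hX.2.1, (picardSeq hS2 hc x₀ (n + 1)).2.2.1] with ω h1 h2
        exact h2.sub h1
    -- the bound for every `n`
    have hbound : ∀ n, ∫⁻ ω, ⨆ s ∈ Set.Iic T, ENNReal.ofReal ((picardLimit hS2 hc x₀ s ω -
        picardStep hc x₀ hX s ω) ^ 2) ∂Literature.Probability.Process.preWienerMeasure ≤
        2 * ∫⁻ ω, ⨆ s ∈ Set.Iic T, ENNReal.ofReal
          (((picardSeq hS2 hc x₀ (n + 1)).1 s ω - picardLimit hS2 hc x₀ s ω) ^ 2) ∂Literature.Probability.Process.preWienerMeasure +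
        2 * ((ENNReal.ofReal (2 * T * (K : ℝ) ^ 2) + 8 * ENNReal.ofReal ((K : ℝ) ^ 2)) *
          (volume (Set.Icc (0 : ℝ) T) * ∫⁻ ω, ⨆ s ∈ Set.Iic T, ENNReal.ofReal
            (((picardSeq hS2 hc x₀ n).1 s ω - picardLimit hS2 hc x₀ s ω) ^ 2) ∂Literature.Probability.Process.preWienerMeasure)) := by
      intro n
      have hcontr : ∫⁻ ω, ⨆ s ∈ Set.Iic T, ENNReal.ofReal
          (((picardSeq hS2 hc x₀ (n + 1)).1 s ω - picardStep hc x₀ hX s ω) ^ 2) ∂Literature.Probability.Process.preWienerMeasure ≤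
          (ENNReal.ofReal (2 * T * (K : ℝ) ^ 2) + 8 * ENNReal.ofReal ((K : ℝ) ^ 2)) *
            ∫⁻ ω, (∫⁻ r in Set.Icc (0 : ℝ) T, ENNReal.ofReal
              (((picardSeq hS2 hc x₀ n).1 r.toNNReal ω - picardLimit hS2 hc x₀ r.toNNReal ω) ^ 2))
                ∂Literature.Probability.Process.preWienerMeasure :=
        lintegral_iSup_picardStep_sub_sq_le hS2 hc x₀ (picardSeq hS2 hc x₀ n).2 hX T T le_rfl
      -- pointwise splitting
      have hpt : ∀ ω, ⨆ s ∈ Set.Iic T, ENNReal.ofReal ((picardLimit hS2 hc x₀ s ω -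
          picardStep hc x₀ hX s ω) ^ 2) ≤
          (2 * ⨆ s ∈ Set.Iic T, ENNReal.ofReal
            (((picardSeq hS2 hc x₀ (n + 1)).1 s ω - picardLimit hS2 hc x₀ s ω) ^ 2)) +
          2 * ⨆ s ∈ Set.Iic T, ENNReal.ofReal
            (((picardSeq hS2 hc x₀ (n + 1)).1 s ω - picardStep hc x₀ hX s ω) ^ 2) := by
        intro ω
        refine iSup₂_le fun s hs ↦ ?_
        have h1 : (picardLimit hS2 hc x₀ s ω - picardStep hc x₀ hX s ω) ^ 2 ≤
            2 * ((picardSeq hS2 hc x₀ (n + 1)).1 s ω - picardLimit hS2 hc x₀ s ω) ^ 2 +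
            2 * ((picardSeq hS2 hc x₀ (n + 1)).1 s ω - picardStep hc x₀ hX s ω) ^ 2 := by
          nlinarith [sq_nonneg (((picardSeq hS2 hc x₀ (n + 1)).1 s ω - picardLimit hS2 hc x₀ s ω) +
            ((picardSeq hS2 hc x₀ (n + 1)).1 s ω - picardStep hc x₀ hX s ω))]
        calc _ ≤ ENNReal.ofReal (2 * ((picardSeq hS2 hc x₀ (n + 1)).1 s ω - picardLimit hS2 hc x₀ s ω) ^ 2 +
            2 * ((picardSeq hS2 hc x₀ (n + 1)).1 s ω - picardStep hc x₀ hX s ω) ^ 2) :=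
              ENNReal.ofReal_le_ofReal h1
          _ = 2 * ENNReal.ofReal (((picardSeq hS2 hc x₀ (n + 1)).1 s ω - picardLimit hS2 hc x₀ s ω) ^ 2) +
              2 * ENNReal.ofReal (((picardSeq hS2 hc x₀ (n + 1)).1 s ω -
                picardStep hc x₀ hX s ω) ^ 2) := by
              rw [ENNReal.ofReal_add (by positivity) (by positivity),
                ENNReal.ofReal_mul (by norm_num : (0 : ℝ) ≤ 2),
                ENNReal.ofReal_mul (by norm_num : (0 : ℝ) ≤ 2), ENNReal.ofReal_ofNat]
          _ ≤ _ := add_le_add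
              (mul_le_mul_right (le_iSup₂_of_le (f := fun s (_ : s ∈ Set.Iic T) ↦ ENNReal.ofReal
                (((picardSeq hS2 hc x₀ (n + 1)).1 s ω - picardLimit hS2 hc x₀ s ω) ^ 2)) s hs le_rfl) _)
              (mul_le_mul_right (le_iSup₂_of_le (f := fun s (_ : s ∈ Set.Iic T) ↦ ENNReal.ofReal
                (((picardSeq hS2 hc x₀ (n + 1)).1 s ω - picardStep hc x₀ hX s ω) ^ 2)) s hs le_rfl) _)
      -- the time integral is bounded by the supremum
      have hIT : ∫⁻ ω, (∫⁻ r in Set.Icc (0 : ℝ) T, ENNReal.ofReal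
          (((picardSeq hS2 hc x₀ n).1 r.toNNReal ω - picardLimit hS2 hc x₀ r.toNNReal ω) ^ 2))
            ∂Literature.Probability.Process.preWienerMeasure ≤
          volume (Set.Icc (0 : ℝ) T) * ∫⁻ ω, ⨆ s ∈ Set.Iic T, ENNReal.ofReal
            (((picardSeq hS2 hc x₀ n).1 s ω - picardLimit hS2 hc x₀ s ω) ^ 2) ∂Literature.Probability.Process.preWienerMeasure := by
        rw [← lintegral_const_mul' _ _ measure_Icc_lt_top.ne]
        refine lintegral_mono fun ω ↦ ?_
        rw [mul_comm, ← setLIntegral_const]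
        refine setLIntegral_mono' measurableSet_Icc fun r hr ↦ ?_
        exact le_iSup₂_of_le (f := fun s (_ : s ∈ Set.Iic T) ↦ ENNReal.ofReal
          (((picardSeq hS2 hc x₀ n).1 s ω - picardLimit hS2 hc x₀ s ω) ^ 2)) r.toNNReal
          (Set.mem_Iic.2 (Real.toNNReal_le_iff_le_coe.2 hr.2)) le_rfl
      calc _ ≤ ∫⁻ ω, ((2 * ⨆ s ∈ Set.Iic T, ENNReal.ofReal
              (((picardSeq hS2 hc x₀ (n + 1)).1 s ω - picardLimit hS2 hc x₀ s ω) ^ 2)) +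
            2 * ⨆ s ∈ Set.Iic T, ENNReal.ofReal
              (((picardSeq hS2 hc x₀ (n + 1)).1 s ω - picardStep hc x₀ hX s ω) ^ 2))
                ∂Literature.Probability.Process.preWienerMeasure := lintegral_mono hpt
        _ = (∫⁻ ω, 2 * ⨆ s ∈ Set.Iic T, ENNReal.ofReal
              (((picardSeq hS2 hc x₀ (n + 1)).1 s ω - picardLimit hS2 hc x₀ s ω) ^ 2) ∂Literature.Probability.Process.preWienerMeasure) +
            ∫⁻ ω, 2 * ⨆ s ∈ Set.Iic T, ENNReal.ofReal
              (((picardSeq hS2 hc x₀ (n + 1)).1 s ω - picardStep hc x₀ hX s ω) ^ 2)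
                ∂Literature.Probability.Process.preWienerMeasure := lintegral_add_left' ((hmeas n).const_mul _) _
        _ = 2 * ∫⁻ ω, ⨆ s ∈ Set.Iic T, ENNReal.ofReal
              (((picardSeq hS2 hc x₀ (n + 1)).1 s ω - picardLimit hS2 hc x₀ s ω) ^ 2) ∂Literature.Probability.Process.preWienerMeasure +
            2 * ∫⁻ ω, ⨆ s ∈ Set.Iic T, ENNReal.ofReal
              (((picardSeq hS2 hc x₀ (n + 1)).1 s ω - picardStep hc x₀ hX s ω) ^ 2)
                ∂Literature.Probability.Process.preWienerMeasure :=
            congrArg₂ (· + ·) (lintegral_const_mul'' _ (hmeas n)) (lintegral_const_mul' _ _ (by norm_num))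
        _ ≤ _ := add_le_add le_rfl (mul_le_mul_right (hcontr.trans (mul_le_mul_right hIT _)) _)
    -- let `n → ∞`
    have hT0 : Tendsto (fun n : ℕ ↦
        2 * ∫⁻ ω, ⨆ s ∈ Set.Iic T, ENNReal.ofReal
          (((picardSeq hS2 hc x₀ (n + 1)).1 s ω - picardLimit hS2 hc x₀ s ω) ^ 2) ∂Literature.Probability.Process.preWienerMeasure +
        2 * ((ENNReal.ofReal (2 * T * (K : ℝ) ^ 2) + 8 * ENNReal.ofReal ((K : ℝ) ^ 2)) *
          (volume (Set.Icc (0 : ℝ) T) * ∫⁻ ω, ⨆ s ∈ Set.Iic T, ENNReal.ofReal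
            (((picardSeq hS2 hc x₀ n).1 s ω - picardLimit hS2 hc x₀ s ω) ^ 2) ∂Literature.Probability.Process.preWienerMeasure)))
        atTop (𝓝 0) := by
      have h1 : Tendsto (fun n : ℕ ↦ 2 * ∫⁻ ω, ⨆ s ∈ Set.Iic T, ENNReal.ofReal
          (((picardSeq hS2 hc x₀ (n + 1)).1 s ω - picardLimit hS2 hc x₀ s ω) ^ 2) ∂Literature.Probability.Process.preWienerMeasure)
          atTop (𝓝 0) := by
        simpa using ENNReal.Tendsto.const_mul (hlim.comp (tendsto_add_atTop_nat 1)) (Or.inr (by norm_num))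
      have h2 : Tendsto (fun n : ℕ ↦ 2 * ((ENNReal.ofReal (2 * T * (K : ℝ) ^ 2) +
          8 * ENNReal.ofReal ((K : ℝ) ^ 2)) * (volume (Set.Icc (0 : ℝ) T) *
            ∫⁻ ω, ⨆ s ∈ Set.Iic T, ENNReal.ofReal
              (((picardSeq hS2 hc x₀ n).1 s ω - picardLimit hS2 hc x₀ s ω) ^ 2) ∂Literature.Probability.Process.preWienerMeasure)))
          atTop (𝓝 0) := by
        have h3 := ENNReal.Tendsto.const_mul hlim (a := volume (Set.Icc (0 : ℝ) T))
          (Or.inr measure_Icc_lt_top.ne)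
        have h4 := ENNReal.Tendsto.const_mul h3
          (a := ENNReal.ofReal (2 * T * (K : ℝ) ^ 2) + 8 * ENNReal.ofReal ((K : ℝ) ^ 2))
          (Or.inr (by simp [ENNReal.add_eq_top, ENNReal.mul_eq_top]))
        have h5 := ENNReal.Tendsto.const_mul h4 (a := 2) (Or.inr (by norm_num))
        simpa using h5
      simpa using h1.add h2
    exact le_antisymm (ge_of_tendsto' hT0 hbound) bot_le
  -- from `Φ_T = 0` to indistinguishability
  have hae : ∀ T : ℕ, ∀ s ≤ (T : ℝ≥0), ∀ᵐ ω ∂Literature.Probability.Process.preWienerMeasure,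
      picardLimit hS2 hc x₀ s ω = picardStep hc x₀ hX s ω := by
    intro T s hs
    have h1 : ∫⁻ ω, ENNReal.ofReal ((picardLimit hS2 hc x₀ s ω - picardStep hc x₀ hX s ω) ^ 2)
        ∂Literature.Probability.Process.preWienerMeasure = 0 :=
      le_antisymm ((lintegral_mono fun ω ↦ le_iSup₂_of_le (f := fun s (_ : s ∈ Set.Iic (T : ℝ≥0)) ↦
        ENNReal.ofReal ((picardLimit hS2 hc x₀ s ω - picardStep hc x₀ hX s ω) ^ 2)) s
          (Set.mem_Iic.2 hs) le_rfl).trans (hzero T).le) bot_le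
    have hmeas : Measurable (fun ω ↦ ENNReal.ofReal
        ((picardLimit hS2 hc x₀ s ω - picardStep hc x₀ hX s ω) ^ 2)) :=
      (((hX.measurable s).sub (hSX.measurable s)).pow_const 2).ennreal_ofReal
    filter_upwards [(lintegral_eq_zero_iff hmeas).1 h1] with ω hω
    simp only [Pi.zero_apply, ENNReal.ofReal_eq_zero] at hω
    have := pow_eq_zero_iff (n := 2) two_ne_zero |>.1 (le_antisymm hω (sq_nonneg _))
    linarith
  have hall : ∀ᵐ ω ∂Literature.Probability.Process.preWienerMeasure, ∀ q : ℚ,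
      picardLimit hS2 hc x₀ (q : ℝ).toNNReal ω = picardStep hc x₀ hX (q : ℝ).toNNReal ω := by
    rw [ae_all_iff]; intro q
    exact hae ⌈(q : ℝ)⌉₊ _ (Real.toNNReal_le_iff_le_coe.2 (by rw [NNReal.coe_natCast]; exact Nat.le_ceil _))
  filter_upwards [hall, hX.2.1, hSX.2.1] with ω h h1 h2
  have := Continuous.ext_on denseRange_toNNReal_ratCast h1 h2 (by rintro _ ⟨q, rfl⟩; exact h q)
  exact fun t ↦ congrFun this t

/-- **Existence of a strong solution** (RY IX Thm (2.1), existence half), on the canonical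
space with the raw Brownian filtration, *conditional on the named facts* S1
(`exists_isItoIntegral`) and S2 (`lintegral_iSup_itoIntegral_sub_sq_le`): the Picard limit is a
strong solution of `dX = b(t,X)dt + σ(t,X)dB`, `X₀ = x₀`.
Revuz–Yor, *Continuous Martingales and Brownian Motion* (1999), Ch. IX, Thm (2.1)
(existence). [cite: RevuzYor1999, Ch. IX Thm (2.1)] -/
theorem isStrongSolution_picardLimit (hS2 : lintegral_iSup_itoIntegral_sub_sq_le) (hc : LipschitzCoeffs b σ K) (x₀ : ℝ) :
    IsStrongSolution b σ x₀ (picardLimit hS2 hc x₀) Literature.Probability.Process.brownian Literature.Probability.RandomPlanarGeometry.brownianFiltration Literature.Probability.Process.preWienerMeasure := by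
  have hX := picardInv_picardLimit hS2 hc x₀
  obtain ⟨hJ, -, hJ0⟩ := picardIto_spec hc hX
  refine ⟨picardLimit_apply_zero hS2 hc x₀, fun i ↦ ((hX.1.stronglyAdapted i).measurable), ?_,
    picardIto hc hX, hJ, ?_⟩
  · filter_upwards [hX.2.1] with ω hω t
    simpa only [pow_one, along] using integrableOn_along_pow hc.measurable_b
                  (fun t ↦ (hc.lipschitz t).1) hc.bdd_b (IsStronglyProgressive.measurable_uncurry hX.1) hω t 1
  · filter_upwards [ae_picardLimit_eq_picardStep hS2 hc x₀] with ω hω t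
    rw [hω t, picardLimit_apply_zero]
    rfl

/-- **Existence of a strong solution for Lipschitz SDEs**, conditional on S1 and S2: for
`b, σ` jointly Borel, Lipschitz in `x` uniformly in `t` and locally bounded in `t` at `0`, the
SDE `dX = b(t,X)dt + σ(t,X)dB`, `X₀ = x₀` driven by the canonical Brownian motion has a strong
solution adapted to the raw Brownian filtration.
Revuz–Yor, *Continuous Martingales and Brownian Motion* (1999), Ch. IX, Thm (2.1)
(existence). [cite: RevuzYor1999, Ch. IX Thm (2.1)] -/
theorem exists_isStrongSolution_of_lipschitz {b σ : ℝ → ℝ → ℝ} {K : ℝ≥0}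
    (hS2 : lintegral_iSup_itoIntegral_sub_sq_le) (hc : LipschitzCoeffs b σ K) (x₀ : ℝ) :
    ∃ X : ℝ≥0 → (ℝ≥0 → ℝ) → ℝ, IsStrongSolution b σ x₀ X Literature.Probability.Process.brownian Literature.Probability.RandomPlanarGeometry.brownianFiltration Literature.Probability.Process.preWienerMeasure :=
  ⟨picardLimit hS2 hc x₀, isStrongSolution_picardLimit hS2 hc x₀⟩

end PicardSolution

/-! ### Assembly: Itô's theorem modulo the two Itô-integral facts S2, S4 -/

/-- **Itô's existence and pathwise-uniqueness theorem for Lipschitz SDEs**, i.e. the named fact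
`Literature.Analysis.FunctionSpaces.existsUnique_strongSolution_of_lipschitz` (canonical Brownian motion, raw Brownian
filtration), **reduced to the two named facts on the Itô integral** S2
(`lintegral_iSup_itoIntegral_sub_sq_le`, the Doob–Itô `L²` maximal inequality) and S4
(`exists_itoIntegral_truncation_of_sq_integrable`, stopping = truncating, square-integrable form);
both are proved from the construction of the integral in
`Literature/Probability/Process/ItoIntegralStopping.lean`, which imports this file, and the
hypothesis-free discharge `existsUnique_strongSolution_of_lipschitz_holds` is assembled downstream
of it. Existence by the Picard scheme (`exists_isStrongSolution_of_lipschitz`): the iterates are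
progressive, a.s. continuous and in `L²(sup)`, so every Itô integral involved is that of a
square-integrable progressive integrand — a true martingale of the raw filtration
(`exists_isItoIntegral_of_sq_integrable`: density of simple processes, Itô's isometry, u.c.p.
limits, `L¹` limits of martingales); the contraction estimate is S2. Uniqueness by the localised
Gronwall argument (`IsStrongSolution.unique_of_lipschitz`) with the optional times `ρ_k` of the
raw filtration and the stopped integrals `∫ σ(X)1_{[0,ρ_k]} dB = (∫ σ(X) dB)^{ρ_k}` (S4).
Revuz–Yor, *Continuous Martingales and Brownian Motion* (1999), Ch. IX, Thm (2.1). [cite: RevuzYor1999, Ch. IX Thm (2.1)] -/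
theorem existsUnique_strongSolution_of_lipschitz_of_facts
    (hS2 : lintegral_iSup_itoIntegral_sub_sq_le)
    (hS4 : exists_itoIntegral_truncation_of_sq_integrable) :
    existsUnique_strongSolution_of_lipschitz := by
  intro b σ x₀ hbm hσm hK hbd
  obtain ⟨K, hK⟩ := hK
  have hc : LipschitzCoeffs b σ K := ⟨hbm, hσm, hK, hbd⟩
  obtain ⟨X, hX⟩ := exists_isStrongSolution_of_lipschitz hS2 hc x₀
  exact ⟨X, hX, fun X' hX' ↦
    IsStrongSolution.unique_of_lipschitz hS2 hS4 hbm hσm hK hc.bdd_σ hX hX'⟩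

end Literature.Analysis.FunctionSpaces
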